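import Literature.NumberTheory.EllipticCurves.ComplexMultiplicationDeuringHoldsProofs
import Literature.NumberTheory.EllipticCurves.ComplexMultiplicationDeuringRamified1728KProofs
import Literature.NumberTheory.EllipticCurves.ComplexMultiplicationHasCMIffProofs
import Literature.NumberTheory.EllipticCurves.ComplexMultiplicationNotSemistable
import Literature.NumberTheory.EllipticCurves.QuadraticTwistRamifiedLocalPolynomialProofs
import Literature.NumberTheory.EllipticCurves.RootNumberTwistProofs
import Literature.NumberTheory.EllipticCurves.CMNewformOfHeckeCharacterProofs
import Literature.NumberTheory.EllipticCurves.HasseWeilAbelianBadReduction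
import Literature.NumberTheory.GaloisRepresentations.DegreeOnePlacesProofs
import Literature.NumberTheory.Automorphic.HilbertPartialHasseWeightShiftingProofs
import Mathlib.NumberTheory.Padics.Complex
import Literature.NumberTheory.GaloisRepresentations.HeckeCharacterModulusExponentProofs
import Literature.NumberTheory.GaloisRepresentations.HeckeCharacterRamificationProofs
import Literature.NumberTheory.GaloisRepresentations.HeckeCharacterProofs
import Literature.NumberTheory.LFunctions.RayClassLSeriesDirichlet
import Mathlib.NumberTheory.LSeries.Injectivity
import Literature.NumberTheory.EllipticCurves.CMNewformHeckeRecursionProofs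
import Literature.NumberTheory.LFunctions.RayClassOrthogonality
import Literature.NumberTheory.QuadraticFields.ConjugateIdealClass
import Literature.NumberTheory.EllipticCurves.HeckeGrossencharakterFunctionalEquation
import Literature.NumberTheory.GaloisRepresentations.HeckeCharacterFiniteIdeleValuesProofs
import Literature.NumberTheory.GaloisRepresentations.HeckeCharacterWeakApproximation
import Literature.NumberTheory.Automorphic.BookerKrishnamurthyConverseProofs
import Literature.NumberTheory.Automorphic.QuadraticHeckeCharacterInfiniteIdeles
import Literature.NumberTheory.Automorphic.GaloisActionAdeleRing
import Literature.NumberTheory.EllipticCurves.HeegnerPoints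
import Literature.NumberTheory.GaloisRepresentations.HeckeCharacterGrossencharakterRelationProofs
import Mathlib.NumberTheory.NumberField.ClassNumber
import Literature.NumberTheory.EllipticCurves.AnalyticRankProofs
import Literature.NumberTheory.EllipticCurves.AdditiveReductionSemistableModelProofs
import Literature.NumberTheory.EllipticCurves.RankinSelbergBaseChangeHeckeValueProofs
import Literature.NumberTheory.LFunctions.KroneckerCharacter
import Literature.NumberTheory.Automorphic.ShimuraCurveRibetTakahashiPeterssonTwistDescentProofs
import Literature.NumberTheory.EllipticCurves.ComplexMultiplicationShaKnappProofs
import Literature.NumberTheory.EllipticCurves.LFunctionSmulProofs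
import Literature.NumberTheory.EllipticCurves.X049CanonicalPAdicHeightSqTwoProofs
import Literature.NumberTheory.EllipticCurves.HeegnerPointsKolyvaginGoodReductionProofs
import Literature.NumberTheory.EllipticCurves.ComplexMultiplicationTwistIsogenyProofs
import Literature.NumberTheory.EllipticCurves.PAdicLFunctionNeZeroProofs
import Literature.NumberTheory.EllipticCurves.LFunctionPrimeCoeff
import Literature.NumberTheory.Automorphic.AdicCompletionDegreeOnePlaceEquiv
import Literature.NumberTheory.EllipticCurves.ComplexMultiplicationDeuringGrossencharacterUnitValues
import Literature.NumberTheory.EllipticCurves.RingClassFieldTower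
import Literature.NumberTheory.LFunctions.DworkRationalitySplittingSeries
import Literature.NumberTheory.EllipticCurves.LiTianYanZhu2025.CMRankOnePPart
import Literature.NumberTheory.EllipticCurves.Rank1Residual.Typed.X12
import Literature.NumberTheory.EllipticCurves.BurungaleCastellaSkinnerTian2022.CMPConverse
import Literature.NumberTheory.EllipticCurves.ComplexMultiplicationDeuringConductor
import Literature.NumberTheory.GaloisRepresentations.HeckeCharacterConductorExponentProofs
import Literature.NumberTheory.NumberFields.OddDegreeUnramifiedNoQuadraticSubfield
import Literature.NumberTheory.EllipticCurves.Disegni2020.PAdicBSDRankOneMultiplicativeProofs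
import Literature.NumberTheory.EllipticCurves.ComplexMultiplicationDeuringReductionSplitProofs
import Literature.NumberTheory.EllipticCurves.BSDSelmerCMPConverseMaximalOrderProofs
import Literature.NumberTheory.EllipticCurves.Castella2018.Section5Bookkeeping
import Literature.NumberTheory.EllipticCurves.IwasawaAnticyclotomicProofs
import Literature.NumberTheory.EllipticCurves.Rank1Residual.GVParityTwistTransportProofs
import Literature.NumberTheory.EllipticCurves.ComplexMultiplicationDeuringEndReductionProofs
import Literature.NumberTheory.EllipticCurves.PadicFiltrationIndexProofs
import Literature.NumberTheory.EllipticCurves.SingularCubicPointCountProofs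
import Literature.NumberTheory.EllipticCurves.BurungaleKobayashiNakamuraOta2026.PadicEndSpan
import Literature.NumberTheory.EllipticCurves.SupersingularIrreducibleProofs
import Literature.NumberTheory.EllipticCurves.Rank1Residual.Typed.X3
import Literature.NumberTheory.EllipticCurves.Rank1Residual.Typed.X4
import Literature.NumberTheory.EllipticCurves.BurungaleKobayashiNakamuraOta2026.RubinPadicLFunctionValuesProofs
import Literature.NumberTheory.EllipticCurves.StrictSelmerRankOne
import Literature.NumberTheory.EllipticCurves.ComplexMultiplicationDeuring0Square
import Literature.NumberTheory.EllipticCurves.ComplexMultiplicationDeuring1728Square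
import Literature.NumberTheory.EllipticCurves.NeronComponentDataProofs
import Literature.NumberTheory.Automorphic.ShimuraCurveRibetTakahashiOptimalModularityProofs
import Literature.NumberTheory.Automorphic.ShimuraCurveRibetTakahashiFreyManinProofs
import Literature.NumberTheory.EllipticCurves.ManinConstantSemistablePrimewise
import Literature.NumberTheory.EllipticCurves.PAdicGrossZagierConstantTermProofs
import Literature.NumberTheory.EllipticCurves.PastenValuationProductThm115Proofs
import Literature.NumberTheory.EllipticCurves.CongruenceVisibilityLocalFactors
import Literature.NumberTheory.GaloisRepresentations.WeakAbelianDirectSummandProofs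
import Literature.NumberTheory.Automorphic.PairLFunctionPolesGLOneDedekindProofs
import Literature.NumberTheory.EllipticCurves.MazurTorsionPrimeCaseFromCor44Proofs
import Literature.NumberTheory.EllipticCurves.MatarNekovar2019.ShaVanishing
import Literature.NumberTheory.EllipticCurves.NeronLocalHeightPotentialGoodReduction
import Literature.NumberTheory.EllipticCurves.Rank1Residual.X9ChaCertificate
import Literature.NumberTheory.EllipticCurves.BSDRootNumberLocalTablesProofs
import Literature.NumberTheory.EllipticCurves.MultiplicativeComponentGroupOrder
import Literature.RingTheory.FittingIdeal.Localization
import Literature.RingTheory.FittingIdeal.DiscreteValuationRing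
import Literature.RingTheory.FittingIdeal.LocalRing
import Literature.NumberTheory.EllipticCurves.CaiShuTian2014.HeegnerConditionProofs
import Literature.NumberTheory.EllipticCurves.MultiplicativeReductionTransvectionProofs
import Literature.NumberTheory.GaloisRepresentations.WeilLAdicCharacterProofs
import Literature.NumberTheory.EllipticCurves.ZpExtensionAnticyclotomicHoldsProofs
import Literature.NumberTheory.EllipticCurves.Kobayashi2003.SignedKatoDivisibility
import Literature.NumberTheory.EllipticCurves.PAdicLFunctionMinus
import Literature.NumberTheory.EllipticCurves.ImaginaryPeriod
import Literature.NumberTheory.EllipticCurves.Kim2026.ShaLengthRankZeroUpperBound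
import Literature.NumberTheory.EllipticCurves.BSDInvariantsPositivityProofs
import Literature.NumberTheory.EllipticCurves.BalakrishnanEtAl2019.SplitCartanImages
import Literature.NumberTheory.EllipticCurves.MatsunoTwistedCurvesLocalProofs
import Literature.NumberTheory.EllipticCurves.BSDSelmerSkinnerThmBProofs
import Literature.NumberTheory.Transcendental.PadicLogAlgClProofs
import Literature.NumberTheory.GaloisRepresentations.AlgebraicHeckeCharacterNormValues
import Literature.NumberTheory.Automorphic.SolvableBaseChangeModularityProofs
import Literature.NumberTheory.EllipticCurves.AnalyticRankOverNumberFieldAbelianProofs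
import Literature.NumberTheory.EllipticCurves.Rank1Residual.Typed.X2
import Literature.NumberTheory.EllipticCurves.RootNumberEvenAnalyticRankProofs
import Literature.NumberTheory.DiophantineGeometry.AbcWave0GranvilleStarkTheorem2Proofs
import Literature.NumberTheory.EllipticCurves.Rank1Residual.X9NoEntry
import Literature.NumberTheory.EllipticCurves.PrimeDegreeIsogenyJTable
import Literature.NumberTheory.EllipticCurves.RationalIsogenyFrobeniusCriterion
import Literature.NumberTheory.EllipticCurves.QuadraticTwistMinimalModelProofs
import Literature.NumberTheory.EllipticCurves.LocalH1TateDualityLangTateProofs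
import Literature.NumberTheory.EllipticCurves.Rank1Residual.Typed.X1
import Literature.NumberTheory.EllipticCurves.KrizLi2019.SexticTwistBSDThreeDescent
import Literature.NumberTheory.EllipticCurves.NonvanishingTwistsPrescribedRamification
import Literature.NumberTheory.EllipticCurves.PastenHeightBoundsLemma68Proofs
import Literature.NumberTheory.EllipticCurves.QuadraticTwistKroneckerRootNumberProofs
import Literature.NumberTheory.EllipticCurves.MatsunoTwistedCurvesPrimesProofs
import Literature.NumberTheory.EllipticCurves.MatsunoCurvesPrimesProofs
import Literature.NumberTheory.EllipticCurves.Milne1972.WeilRestrictionQuadraticBSDQuotientAnyModel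
import Literature.NumberTheory.EllipticCurves.Rank1Residual.ClassX1KellerYinRankOneReduction
import Literature.NumberTheory.EllipticCurves.GreenbergVatsal2000.MultiplicativeReduction
import Literature.NumberTheory.EllipticCurves.Rank1Residual.Typed.MultiplicativeRankZero
import Mathlib.NumberTheory.Padics.HeightOneSpectrum
import Mathlib.NumberTheory.RamificationInertia.Valuation
import Mathlib.NumberTheory.LSeries.PrimesInAP
import Mathlib.NumberTheory.LegendreSymbol.JacobiSymbol
import Mathlib.Analysis.SpecificLimits.Normed
import Mathlib.Analysis.Analytic.IsolatedZeros
import Mathlib.Analysis.Analytic.OfScalars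
import Mathlib.RingTheory.PowerSeries.Basic
import Mathlib.RingTheory.Valuation.Basic
import Mathlib.NumberTheory.Padics.PadicIntegers
import Mathlib.Data.Nat.Choose.Dvd
import Mathlib.Data.Nat.Choose.Sum
import Mathlib.Data.ZMod.QuotientGroup
import Mathlib.Analysis.Normed.Group.FunctionSeries
import HarnessLib.Audit.Tags
import Mathlib.RingTheory.PowerSeries.WeierstrassPreparation
import Mathlib.RingTheory.Polynomial.Quotient
import Mathlib.RingTheory.Ideal.AssociatedPrime.Finiteness
import Mathlib.LinearAlgebra.FreeModule.PID
import Mathlib.Algebra.Category.ModuleCat.Projective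
import Mathlib.NumberTheory.NumberField.Discriminant.Different
import Mathlib.NumberTheory.RamificationInertia.Unramified
import Mathlib.RingTheory.PowerSeries.Binomial
import Mathlib.NumberTheory.Padics.MahlerBasis
import Mathlib.Analysis.Normed.Ring.InfiniteSum
import Mathlib.RingTheory.PowerSeries.Inverse
import Mathlib.RingTheory.DiscreteValuationRing.Basic
import Mathlib.RingTheory.Ideal.Maps
import Mathlib.Logic.Basic
import Mathlib.NumberTheory.NumberField.Cyclotomic.Galois
import Mathlib.FieldTheory.KrullTopology
import Mathlib.NumberTheory.RamificationInertia.Basic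
import Mathlib.RingTheory.Filtration
import Mathlib.LinearAlgebra.TensorProduct.Quotient
import Mathlib.RingTheory.Ideal.UFD
import Mathlib.RingTheory.Ideal.Colon
import Mathlib.RingTheory.PowerSeries.Ideal
import Mathlib.Algebra.CharP.Lemmas
import Mathlib.NumberTheory.Cyclotomic.Basic
import Mathlib.Topology.Algebra.OpenSubgroup
import Mathlib.NumberTheory.Padics.AddChar
import Mathlib.Topology.Algebra.Module.FiniteDimension
import Mathlib.NumberTheory.NumberField.Cyclotomic.Ideal
import Mathlib.NumberTheory.GaussSum
import Mathlib.NumberTheory.LegendreSymbol.QuadraticChar.Basic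
import Mathlib.NumberTheory.Cyclotomic.PrimitiveRoots
import Mathlib.FieldTheory.Finite.Basic
import Mathlib.Data.Nat.Prime.Factorial
import Mathlib.RingTheory.Polynomial.Cyclotomic.Roots
import HarnessLib

/-!
# Deuring's theorem for CM curves over ℚ, I: rigidity of Hecke characters pinned to a curve, quadratic ramification, twist transport, the Deuring shape (re-homed proofs)

**Deuring's theorem (CM elliptic curves over ℚ come from Hecke Grössencharacters of the CM field) in the tree's three vended forms —
the named facts `Literature.NumberTheory.EllipticCurves.Deuring_exists_heckeCharacter_of_maximalCM`, `…_withGenerators`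
(`ComplexMultiplicationDeuringGrossencharacter.lean`) and `…_withUnitValues` (`ComplexMultiplicationDeuringGrossencharacterUnitValues.lean`) HOLD,
EXACT names `…Deuring_exists_heckeCharacter_of_maximalCM_holds`, `…_withGenerators_holds`, `…_withUnitValues_holds`** (M. Deuring, Nachr. Akad.
Wiss. Göttingen 1953–1957; Silverman, *Advanced Topics*, II §9–§10, Thm. 10.5 [SilvermanATAEC1994]; Gross, LNM 776 (1980) §8 [Gross1980]).
The in-tree proof (BSD lane, 2026-08): for each of the thirteen CM `j`-invariants over ℚ a Hecke character of the CM field `K` pinned to the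
curve is produced and identified — rigidity of pinned characters from their Dirichlet coefficients / value pairs / archimedean component
(Parts `RamifiedSevenEllipticUnits.Rigidity*`, `PinnedCharacterRigidity`), quadratic ramification at the CM prime and twist transport of pinned
characters, the Deuring shape and generator shape of a pinned character, the core rows (`j = 0`, `1728`, `8000`, …, the Gross rows) and quadratic
twists of cores (`DeuringOfCore*`, `CoreTwist`, `CoreRow*`, `GrossRows*`, `Row*`), unit values of the shape; assembled in
`Deuring_exists_heckeCharacter_of_maximalCM_holds` (file 2 of 3; this is file 1) and the two refinements (file 3).
RE-HOMED into `Literature/` by the Hodge foundations lane (`lit-hodgefound`, seat p20, generation 40): verbatim DECLARATION-LEVEL ports (the 134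
declarations needed, in dependency order) of 33 theorem-only modules `Summits/BirchSwinnertonDyer/BirchSwinnertonDyer/Theorems/{RamifiedSevenEllipticUnits*,
BiquadraticEisensteinDescentDeuring*}.lean` and `Summits/BirchSwinnertonDyer/Rank1Residual/X11b/EmbeddingDatumPrime.lean` (1 declaration); namespaces
`Summit.BirchSwinnertonDyer.BirchSwinnertonDyer.Theorems.{RamifiedSevenEllipticUnits,BiquadraticEisensteinDescentDeuringOfCore}` re-rooted as
`Literature.NumberTheory.EllipticCurves.DeuringCM.{RamifiedSevenEllipticUnits,DeuringOfCore}`, `…Rank1Residual.X11b` as `…DeuringCM.X11b`; the three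
`_holds` theorems carry the EXACT names.  Built on the tree's Literature layer (`Literature/NumberTheory/EllipticCurves/{HeckeCharacter*,
ComplexMultiplication*,AnalyticRankProofs,AdditiveReductionSemistableModelProofs,…}`, `Literature/NumberTheory/LFunctions/*`,
`Literature/NumberTheory/QuadraticFields/*`).  Theorem-only files: no definition, no new named fact (D-0026); imports Mathlib/Literature only; every
declaration carries the citation of the printed statement it formalises or serves.  The Summits originals stay in place (transitional duplication).
WHAT THIS IS NOT: nothing here bears on BSD; Deuring's 1950s theorem for the thirteen CM curves over ℚ in the tree's vocabulary.
-/

noncomputable section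

/-!
## Part 1 — port of `Summits/BirchSwinnertonDyer/BirchSwinnertonDyer/Theorems/BiquadraticEisensteinDescentDeuringOfCoreLocal.lean` (9 declarations kept)

# BED , , FILE L (local facts): for a CM curve `E/ℚ` (maximal order) and its CM field `K`, good primes are unramified in `K` and bad primes stay bad at every place of `K` above them

Declarations of this Part (verbatim port; each keeps its own docstring and citation): `ofPowerSeries_injective`, `polynomial_eq_one_of_invOfUnit_eq_one`, `polynomial_eq_one_of_mul_eq_one`, `localPolynomialAt_eq_one_of_localEulerFactor_eq_one`, `not_hasGoodReductionAt_of_localPolynomialAt_eq_one`, `not_hasGoodReductionAt_of_localEulerFactor_eq_one`, `not_dvd_discr_of_hasGoodReductionAtPrime`, `hasAdditiveReductionAt_of_hasCM_of_bad`, `not_hasGoodReductionAt_baseChange_of_bad`.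

Reference keys (see `references.bib` and the declarations' citations): [SilvermanATAEC1994], [SilvermanAEC2009], [NeukirchANT1999].
-/

section Part1

set_option autoImplicit false

open scoped _root_.Classical _root_.NumberField
open _root_.NumberField _root_.IsDedekindDomain _root_.WeierstrassCurve _root_.Polynomial _root_.ArithmeticFunction _root_.Rat.HeightOneSpectrum
  Literature.NumberTheory.GaloisRepresentations
  Literature.NumberTheory.EllipticCurves
  Literature.NumberTheory.EllipticCurves.ModularForms
  Literature.NumberTheory.Automorphic

namespace Literature.NumberTheory.EllipticCurves.DeuringCM.DeuringOfCore

/-! ## §1 Algebra of local Euler factors: `L_w(E)⁻¹ = 1` as a Dirichlet series forces `L_w(E, T) = 1` -/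

section LocalFactor

/-- `ArithmeticFunction.ofPowerSeries q` is injective for `q > 1` (its value at `q^k` is the `k`-th coefficient).
[cite: SilvermanAEC2009, App. C §16 and VII.5 Prop. 5.1] -/
theorem ofPowerSeries_injective {R : Type*} [CommSemiring R] {q : ℕ} (hq : 1 < q) :
    Function.Injective (ArithmeticFunction.ofPowerSeries (R := R) q) := by
  intro f g h
  ext k
  have := congrArg (fun F : ArithmeticFunction R ↦ F (q ^ k)) h
  simpa only [ArithmeticFunction.ofPowerSeries_apply_pow hq] using this

/-- A polynomial with constant coefficient `1` whose formal inverse is `1` is `1`. [cite: SilvermanAEC2009, App. C §16 and VII.5 Prop. 5.1] -/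
theorem polynomial_eq_one_of_invOfUnit_eq_one (P : ℤ[X]) (h0 : P.coeff 0 = 1)
    (h : PowerSeries.invOfUnit (P : PowerSeries ℤ) 1 = 1) : P = 1 := by
  have hmul := PowerSeries.mul_invOfUnit (P : PowerSeries ℤ) 1 (by
    rw [← PowerSeries.coeff_zero_eq_constantCoeff_apply, Polynomial.coeff_coe, h0, Units.val_one])
  rw [h, mul_one] at hmul
  exact Polynomial.coe_injective ℤ (hmul.trans Polynomial.coe_one.symm)

/-- A product of two polynomials over `ℤ` with constant coefficients `1` is `1` only if the first is `1`. [cite: SilvermanAEC2009, App. C §16 and VII.5 Prop. 5.1] -/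
theorem polynomial_eq_one_of_mul_eq_one {P Q : ℤ[X]} (hP : P.coeff 0 = 1) (h : P * Q = 1) : P = 1 := by
  have hu : IsUnit P := IsUnit.of_mul_eq_one Q h
  obtain ⟨r, hr, hrP⟩ := Polynomial.isUnit_iff.mp hu
  rw [← hrP, Polynomial.coeff_C_zero] at hP
  rw [← hrP, hP, map_one]

variable {F : Type*} [Field F] [NumberField F]

/-- **`L_w(X)⁻¹ = 1` as a formal Dirichlet series forces the local polynomial `L_w(X, T) = 1`**
(`L_w⁻¹ = ofPowerSeries (N w) (1/L_w(T))`, `ofPowerSeries` injective, `L_w(0) = 1`). [cite: SilvermanAEC2009, App. C §16 (the local factors)] -/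
theorem localPolynomialAt_eq_one_of_localEulerFactor_eq_one (X : WeierstrassCurve F) (w : HeightOneSpectrum (𝓞 F))
    (h : (X.baseChange (w.adicCompletion F)).localEulerFactor (w.adicCompletionIntegers F) = 1) :
    X.localPolynomialAt w = 1 := by
  rw [X.localEulerFactor_baseChange_adicCompletion w] at h
  have h1 : PowerSeries.invOfUnit (X.localPolynomialAt w : PowerSeries ℤ) 1 = 1 :=
    ofPowerSeries_injective w.one_lt_residueCard (by rw [h, map_one])
  exact polynomial_eq_one_of_invOfUnit_eq_one _ (X.coeff_zero_localPolynomialAt w) h1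

/-- **`L_w(X, T) = 1` means additive, in particular NOT good, reduction at `w`** (at good reduction the local
polynomial is `1 − a_w T + q_w T²` with `q_w ≥ 2`). [cite: SilvermanAEC2009, App. C §16 and VII.5 Prop. 5.1] -/
theorem not_hasGoodReductionAt_of_localPolynomialAt_eq_one (X : WeierstrassCurve F) (w : HeightOneSpectrum (𝓞 F))
    (h : X.localPolynomialAt w = 1) : ¬ X.HasGoodReductionAt w := by
  intro hg
  have h2 := congrArg (fun P : ℤ[X] ↦ P.coeff 2) h
  simp only [localPolynomialAt_of_hasGoodReductionAt hg, coeff_add, coeff_sub, coeff_one, coeff_C_mul, coeff_X,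
    coeff_X_pow] at h2
  norm_num at h2
  have hq := IsDedekindDomain.HeightOneSpectrum.one_lt_residueCard w
  rw [← natCard_residueField_eq_residueCard w] at hq
  omega

/-- `L_w(X)⁻¹ = 1` forces bad reduction at `w`. [cite: SilvermanAEC2009, App. C §16 and VII.5 Prop. 5.1] -/
theorem not_hasGoodReductionAt_of_localEulerFactor_eq_one (X : WeierstrassCurve F) (w : HeightOneSpectrum (𝓞 F))
    (h : (X.baseChange (w.adicCompletion F)).localEulerFactor (w.adicCompletionIntegers F) = 1) :
    ¬ X.HasGoodReductionAt w :=
  not_hasGoodReductionAt_of_localPolynomialAt_eq_one X w (localPolynomialAt_eq_one_of_localEulerFactor_eq_one X w h)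

end LocalFactor

/-! ## §2 CM by a maximal order: good primes are unramified in `K`; bad primes stay bad over `K` -/

section CMLocal

variable (W : WeierstrassCurve ℚ) [W.IsElliptic] {K : Type} [Field K] [NumberField K]

/-- **A prime of good reduction of a CM curve `E/ℚ` (maximal order) is unramified in the CM field `K`**
(Silverman II Ex. 2.31 (a): "If `𝔓` ramifies in `L′`, prove that `E` has bad reduction at `𝔓`"): at a place of
ramification index `2` the tree's ramified leaf `Deuring_localEulerFactor_ramified` gives `L_p(E)⁻¹ = 1`, i.e. additive
reduction (§1); and `p ∣ d_K` produces such a place (Dedekind, `exists_place_ramificationIdx_ne_one_of_dvd_discr`,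
with `e ∈ {1, 2}` in a quadratic field). [cite: SilvermanATAEC1994, Ch. II Exercise 2.31 (a) (p. 179)] -/
theorem not_dvd_discr_of_hasGoodReductionAtPrime (hj : W.j ∈ maximalCMJInvariants) (hK : IsCMFieldOfJ K W.j)
    {p : ℕ} [hp : Fact p.Prime] (hgood : W.HasGoodReductionAtPrime p) : ¬ (p : ℤ) ∣ NumberField.discr K := by
  intro hdvd
  obtain ⟨v, hpv⟩ : ∃ v : HeightOneSpectrum (𝓞 ℚ), (primesEquiv v : ℕ) = p :=
    ⟨primesEquiv.symm ⟨p, hp.out⟩, by rw [Equiv.apply_symm_apply]⟩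
  subst hpv
  obtain ⟨w, hwv, hne⟩ := exists_place_ramificationIdx_ne_one_of_dvd_discr K v hdvd
  have hw : w.under (𝓞 ℚ) = v := HeightOneSpectrum.ext hwv
  -- `e(w|v) ∈ {1, 2}` in the quadratic field, so `e = 2`
  have he : w.asIdeal.ramificationIdx (𝓞 ℚ) = 2 := by
    rcases placesOver_trichotomy_of_finrank_eq_two K hK.1 v with
      ⟨w₁, w₂, -, -, hall⟩ | ⟨w₀, hS, he1, -⟩ | ⟨w₀, hS, he2, -⟩
    · exact absurd (hall w hw).1 hne
    · have : w = w₀ := by simpa using (show w ∈ ({w₀} : Set _) by rw [← hS]; exact hw)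
      subst this; exact absurd he1 hne
    · have : w = w₀ := by simpa using (show w ∈ ({w₀} : Set _) by rw [← hS]; exact hw)
      subst this; exact he2
  have hfac := (Deuring_localEulerFactor_ramified W hj K hK w he).2
  rw [hw] at hfac
  have hbad := not_hasGoodReductionAt_of_localEulerFactor_eq_one W v hfac
  exact hbad ((hasGoodReductionAtPrime_iff_hasGoodReductionAt_ringOfIntegers v W).mp hgood)

/-- `E` has additive reduction at a bad prime when it has CM (no multiplicative primes: `j(E) ∈ ℤ`).
[cite: SilvermanATAEC1994, Thm. II.6.4 and proof of Thm. II.10.5 (p. 172)] -/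
theorem hasAdditiveReductionAt_of_hasCM_of_bad (hCM : W.HasCM) (v : HeightOneSpectrum (𝓞 ℚ))
    (hbad : ¬ W.HasGoodReductionAt v) : W.HasAdditiveReductionAt v := by
  haveI := Fact.mk (primesEquiv v).2
  rcases W.hasGoodReductionAt_or_hasMultiplicativeReductionAt_or_hasAdditiveReductionAt v with hg | hm | ha
  · exact absurd hg hbad
  · exact absurd ((W.hasMultiplicativeReductionAtPrime_iff_hasMultiplicativeReductionAt_ringOfIntegers v).mpr hm)
      (W.not_hasMultiplicativeReductionAtPrime_of_hasCM hCM _)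
  · exact ha

/-- **A bad prime of a CM curve `E/ℚ` (maximal order) stays bad at EVERY place of the CM field above it**
(Silverman II Thm. 9.2 (b) with Thm. 10.5: `ψ` ramified ⟺ bad; here WITHOUT the character). From the tree's proved
prime-by-prime Deuring identity `∏_{w ∣ p} L_w(E_K)⁻¹ = (L_p(E)⁻¹)²` (`Deuring_localEulerFactor_baseChange_cmField_holds`)
with `L_p(E)⁻¹ = 1` (additive): a single place has `L_w⁻¹ = 1`; two places `w₁ ≠ w₂` (split `p`, both of norm `p`)
have `(1/L_{w₁}(T))(1/L_{w₂}(T)) = 1`, so `L_{w₁}(T) L_{w₂}(T) = 1` in `ℤ[T]` and both are `1`; `L_w(T) = 1` is additive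
reduction (§1). [cite: SilvermanATAEC1994, Ch. II Thm. 9.2 (b) and Thm. 10.5 (p. 165, 171)]
[cite: SilvermanAEC2009, VII.5 Prop. 5.1 and App. C §16] -/
theorem not_hasGoodReductionAt_baseChange_of_bad (hj : W.j ∈ maximalCMJInvariants) (hK : IsCMFieldOfJ K W.j)
    {p : ℕ} [hp : Fact p.Prime] (hbad : ¬ W.HasGoodReductionAtPrime p) (w : HeightOneSpectrum (𝓞 K))
    (hw : ((p : ℕ) : 𝓞 K) ∈ w.asIdeal) : ¬ (W.baseChange K).HasGoodReductionAt w := by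
  set v : HeightOneSpectrum (𝓞 ℚ) := w.under (𝓞 ℚ) with hv
  have hgen : natGenerator v = p := natGenerator_under_eq_of_natCast_mem w hp.out hw
  have hpv : (primesEquiv v : ℕ) = p := hgen
  -- `L_v(E)⁻¹ = 1`
  have hbadv : ¬ W.HasGoodReductionAt v := by
    intro h
    have h' := (hasGoodReductionAtPrime_iff_hasGoodReductionAt_ringOfIntegers v W).mpr h
    obtain ⟨q, hq⟩ : ∃ q : Nat.Primes, primesEquiv v = q := ⟨_, rfl⟩
    have hqp : (q : ℕ) = p := by rw [← hq]; exact hpv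
    subst hqp
    rw [hq] at h'
    exact hbad h'
  have hadd : W.HasAdditiveReductionAt v :=
    hasAdditiveReductionAt_of_hasCM_of_bad W (hasCM_of_j_mem_cmJInvariants W (maximalCMJInvariants_subset_cmJInvariants hj))
      v hbadv
  have hone : (W.baseChange (v.adicCompletion ℚ)).localEulerFactor (v.adicCompletionIntegers ℚ) = 1 := by
    rw [W.localEulerFactor_baseChange_adicCompletion v, localPolynomialAt_of_hasAdditiveReductionAt hadd,
      Polynomial.coe_one]
    have h1 := PowerSeries.mul_invOfUnit (1 : PowerSeries ℤ) 1 (by simp)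
    rw [one_mul] at h1
    rw [h1, map_one]
  -- the Deuring identity at `v`
  have hD := Deuring_localEulerFactor_baseChange_cmField_holds W hj K hK v
  rw [hone, one_pow] at hD
  rcases placesOver_trichotomy_of_finrank_eq_two K hK.1 v with
    ⟨w₁, w₂, hne, hS, hall⟩ | ⟨w₀, hS, -, -⟩ | ⟨w₀, hS, -, -⟩
  · -- split: two places of norm `p`
    rw [hS, finprod_mem_pair hne] at hD
    have hN : ∀ {w' : HeightOneSpectrum (𝓞 K)}, w'.under (𝓞 ℚ) = v → w'.residueCard = p := by
      intro w' hw'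
      have hf := (hall w' hw').2
      change Ideal.absNorm w'.asIdeal = p
      rw [absNorm_asIdeal_eq_natGenerator_pow, hw', hf, pow_one, hgen]
    have hm₁ : w₁.under (𝓞 ℚ) = v := by
      have : w₁ ∈ ({w₁, w₂} : Set (HeightOneSpectrum (𝓞 K))) := Set.mem_insert _ _
      rw [← hS] at this; exact this
    have hm₂ : w₂.under (𝓞 ℚ) = v := by
      have : w₂ ∈ ({w₁, w₂} : Set (HeightOneSpectrum (𝓞 K))) := Set.mem_insert_of_mem _ rfl
      rw [← hS] at this; exact this
    rw [(W.baseChange K).localEulerFactor_baseChange_adicCompletion w₁,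
      (W.baseChange K).localEulerFactor_baseChange_adicCompletion w₂, hN hm₁, hN hm₂, ← map_mul, ← map_one
      (ArithmeticFunction.ofPowerSeries (R := ℤ) p)] at hD
    have hps := ofPowerSeries_injective hp.out.one_lt hD
    -- `(1/L₁)(1/L₂) = 1 ⇒ L₁ L₂ = 1`
    set P₁ : ℤ[X] := (W.baseChange K).localPolynomialAt w₁ with hP₁
    set P₂ : ℤ[X] := (W.baseChange K).localPolynomialAt w₂ with hP₂
    have hc₁ : PowerSeries.constantCoeff (P₁ : PowerSeries ℤ) = ((1 : ℤˣ) : ℤ) := by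
      rw [← PowerSeries.coeff_zero_eq_constantCoeff_apply, Polynomial.coeff_coe,
        (W.baseChange K).coeff_zero_localPolynomialAt w₁, Units.val_one]
    have hc₂ : PowerSeries.constantCoeff (P₂ : PowerSeries ℤ) = ((1 : ℤˣ) : ℤ) := by
      rw [← PowerSeries.coeff_zero_eq_constantCoeff_apply, Polynomial.coeff_coe,
        (W.baseChange K).coeff_zero_localPolynomialAt w₂, Units.val_one]
    have hprod : ((P₁ * P₂ : ℤ[X]) : PowerSeries ℤ) = 1 := by
      have e1 := PowerSeries.mul_invOfUnit (P₁ : PowerSeries ℤ) 1 hc₁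
      have e2 := PowerSeries.mul_invOfUnit (P₂ : PowerSeries ℤ) 1 hc₂
      rw [Polynomial.coe_mul]
      calc (P₁ : PowerSeries ℤ) * (P₂ : PowerSeries ℤ)
          = ((P₁ : PowerSeries ℤ) * PowerSeries.invOfUnit (P₁ : PowerSeries ℤ) 1) *
              ((P₂ : PowerSeries ℤ) * PowerSeries.invOfUnit (P₂ : PowerSeries ℤ) 1) := by
            rw [mul_mul_mul_comm, hps, mul_one]
        _ = 1 := by rw [e1, e2, mul_one]
    have hprod' : P₁ * P₂ = 1 := Polynomial.coe_injective ℤ (hprod.trans Polynomial.coe_one.symm)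
    have hP₁1 : P₁ = 1 := polynomial_eq_one_of_mul_eq_one ((W.baseChange K).coeff_zero_localPolynomialAt w₁) hprod'
    have hP₂1 : P₂ = 1 :=
      polynomial_eq_one_of_mul_eq_one ((W.baseChange K).coeff_zero_localPolynomialAt w₂) (by rw [mul_comm]; exact hprod')
    have hwS : w ∈ ({w₁, w₂} : Set (HeightOneSpectrum (𝓞 K))) := by rw [← hS]; exact hv.symm
    rcases hwS with rfl | rfl
    · exact not_hasGoodReductionAt_of_localPolynomialAt_eq_one _ _ hP₁1
    · exact not_hasGoodReductionAt_of_localPolynomialAt_eq_one _ _ hP₂1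
  all_goals
    -- a single place `w = w₀` above `v`
    have hw0 : w = w₀ := by simpa using (show w ∈ ({w₀} : Set _) by rw [← hS]; exact hv.symm)
    subst hw0
    rw [hS, finprod_mem_singleton] at hD
    exact not_hasGoodReductionAt_of_localEulerFactor_eq_one _ _ hD

end CMLocal

end Literature.NumberTheory.EllipticCurves.DeuringCM.DeuringOfCore

end Part1

/-!
## Part 2 — port of `Summits/BirchSwinnertonDyer/Rank1Residual/X11b/EmbeddingDatumPrime.lean` (1 declarations kept)

# X11b, R1 — the prime `𝔭_ι` of `K` induced by an embedding datum `ι : ℚ̄_p ≃ ℂ` (Castella–Hsieh's "prime induced by `i_p = ι⁻¹ ∘ i_∞`"), with the compatibility clause of Castella 2018 Thm. 3.1 (tree fact `castella2018_exists_isBDPLFunction`)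

Declarations of this Part (verbatim port; each keeps its own docstring and citation): `subsingleton_infinitePlace_of_isImaginaryQuadratic`.

Reference keys (see `references.bib` and the declarations' citations): [CastellaHsieh2018], [Castella2018], [Neukirch1999], [CasselsFrohlichANT1967].
-/

section Part2

open scoped _root_.Classical

open _root_.NumberField _root_.IsDedekindDomain Literature.NumberTheory.EllipticCurves
  Literature.NumberTheory.EllipticCurves.Rank1Residual

namespace Literature.NumberTheory.EllipticCurves.DeuringCM.X11b

/-! ### The prime of `K` induced by an embedding datum -/

section Prime

variable {K : Type} [Field K] (p : ℕ) [Fact p.Prime] (ι : PadicAlgCl p ≃+* ℂ) (σ : K →+* ℂ)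

variable [NumberField K]

end Prime

/-! ### Imaginary quadratic fields: one infinite place, the clause for every `w`, degree one -/

section Quadratic

variable {K : Type} [Field K] [NumberField K] (p : ℕ) [Fact p.Prime] (ι : PadicAlgCl p ≃+* ℂ)

/-- An imaginary quadratic field has exactly one infinite place (`r₁ = 0` as `K` is totally complex,
`r₁ + 2 r₂ = [K : ℚ] = 2`, so `r₂ = 1`). [cite: SilvermanATAEC1994, II §10 Thm. 10.5 (Deuring; supporting lemma)] -/
theorem subsingleton_infinitePlace_of_isImaginaryQuadratic (hK : IsImaginaryQuadratic K) :
    Subsingleton (InfinitePlace K) := by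
  haveI : IsTotallyComplex K := hK.2
  have h0 : InfinitePlace.nrRealPlaces K = 0 :=
    (NumberField.nrRealPlaces_eq_zero_iff (K := K)).mpr inferInstance
  have hsum := InfinitePlace.card_add_two_mul_card_eq_rank K
  have hcard : Fintype.card (InfinitePlace K) = 1 := by
    rw [InfinitePlace.card_eq_nrRealPlaces_add_nrComplexPlaces, h0]
    rw [h0, hK.1] at hsum
    omega
  exact Fintype.card_le_one_iff_subsingleton.mp hcard.le

end Quadratic

/-! ### The conjugate datum, and: EVERY prime above a split `p` is induced by `ι` or by `ι ∘ conj`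
(gen 20 append; the glue asked for by team x11b3's r2, INBOX 2026-08-21T07:12:20Z) -/

section Conjugate

variable {K : Type} [Field K] [NumberField K] (p : ℕ) [Fact p.Prime] (ι : PadicAlgCl p ≃+* ℂ)
  (σ : K →+* ℂ)

end Conjugate

end Literature.NumberTheory.EllipticCurves.DeuringCM.X11b

end Part2

/-!
## Part 3 — port of `Summits/BirchSwinnertonDyer/BirchSwinnertonDyer/Theorems/RamifiedSevenEllipticUnitsLemmaXiRamifiedValues.lean` (4 declarations kept)

# Lemma Ξ, kernel side (III): at a prime RAMIFIED in a quadratic field, `α / σ(α)` is a principal unit — the value-level input of (P1)/(P5) reduced to "`φ_ac(ϖ_w) = τ(α / σα)` with `(α) ∣ w`"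

Declarations of this Part (verbatim port; each keeps its own docstring and citation): `liesOver_span_of_natCast_mem`, `ramificationIdxIn_eq_two_of_dvd_discr`, `eq_asIdeal_of_dvd_discr`, `span_natCast_eq_sq_of_dvd_discr`.

Reference keys (see `references.bib` and the declarations' citations): [NeukirchANT1999], [SilvermanATAEC1994].
-/

section Part3

set_option autoImplicit false

open scoped _root_.Classical _root_.NNReal _root_.Topology _root_.Pointwise
open _root_.NumberField _root_.IsDedekindDomain _root_.Field
  Literature.NumberTheory.GaloisRepresentations

namespace Literature.NumberTheory.EllipticCurves.DeuringCM.RamifiedSevenEllipticUnits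

namespace LemmaXi

variable {K : Type} [Field K] [NumberField K] {p : ℕ} [hp : Fact p.Prime]

/-! ## §1 A ramified prime of a quadratic field: inertia is everything -/

omit [NumberField K] in
/-- A prime `𝔭` of `K` containing the rational prime `p` lies over `pℤ`. [cite: NeukirchANT1999, Ch. III §2 Thm. (2.6) and Cor. (2.12); Ch. I §9 Prop. (9.6)] -/
theorem liesOver_span_of_natCast_mem (𝔭 : HeightOneSpectrum (𝓞 K))
    (hp𝔭 : ((p : ℕ) : 𝓞 K) ∈ 𝔭.asIdeal) : 𝔭.asIdeal.LiesOver (Ideal.span {(p : ℤ)}) :=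
  (Ideal.liesOver_span_iff 𝔭.isPrime.ne_top (Nat.prime_iff_prime_int.mp hp.out)).mpr
    (by simpa using hp𝔭)

/-- **A prime dividing the discriminant of a QUADRATIC field is totally ramified**: `e = 2`, one prime
above `p`, residue degree `1` (Dedekind's discriminant theorem + the fundamental identity `efg = 2`).
[cite: NeukirchANT1999, Ch. III §2 Thm. (2.6) and Cor. (2.12); Ch. I §9 Prop. (9.6)] -/
theorem ramificationIdxIn_eq_two_of_dvd_discr (h2 : Module.finrank ℚ K = 2)
    (hdvd : (p : ℤ) ∣ NumberField.discr K) :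
    (Ideal.span {(p : ℤ)}).ramificationIdxIn (𝓞 K) = 2 ∧
      ((Ideal.span {(p : ℤ)}).primesOver (𝓞 K)).ncard = 1 ∧
      (Ideal.span {(p : ℤ)}).inertiaDegIn (𝓞 K) = 1 := by
  haveI : Algebra.IsQuadraticExtension ℚ K := ⟨h2⟩
  haveI : IsGaloisGroup (K ≃ₐ[ℚ] K) ℤ (𝓞 K) :=
    IsGaloisGroup.of_isFractionRing (K ≃ₐ[ℚ] K) ℤ (𝓞 K) ℚ K
  have hG : Nat.card (K ≃ₐ[ℚ] K) = 2 := by rw [IsGalois.card_aut_eq_finrank, h2]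
  have hpZ : Prime (p : ℤ) := Nat.prime_iff_prime_int.mp hp.out
  haveI : (Ideal.span {(p : ℤ)}).IsPrime := (Ideal.span_singleton_prime hpZ.ne_zero).mpr hpZ
  have hram : ¬ Algebra.IsUnramifiedIn (𝓞 K) (Ideal.span {(p : ℤ)}) := fun h ↦
    (NumberField.not_dvd_discr_iff_isUnramifiedIn K (𝓞 K) hpZ).mpr h hdvd
  have he1 : (Ideal.span {(p : ℤ)}).ramificationIdxIn (𝓞 K) ≠ 1 := by
    intro h1
    apply hram
    rw [Algebra.isUnramifiedIn_iff_forall_ramificationIdx_eq_one]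
    intro Q _ hQ
    rw [← Ideal.ramificationIdxIn_eq_ramificationIdx (Ideal.span {(p : ℤ)}) Q (K ≃ₐ[ℚ] K)]
    exact h1
  have hefg := Ideal.ncard_primesOver_mul_ramificationIdxIn_mul_inertiaDegIn
    (Ideal.span {(p : ℤ)}) (𝓞 K) (K ≃ₐ[ℚ] K)
  rw [hG] at hefg
  set g := ((Ideal.span {(p : ℤ)}).primesOver (𝓞 K)).ncard
  set e := (Ideal.span {(p : ℤ)}).ramificationIdxIn (𝓞 K)
  set f := (Ideal.span {(p : ℤ)}).inertiaDegIn (𝓞 K)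
  have he2 : e ≤ 2 := Nat.le_of_dvd two_pos ⟨g * f, by rw [← hefg]; ring⟩
  have hg2 : g ≤ 2 := Nat.le_of_dvd two_pos ⟨e * f, by rw [← hefg]⟩
  have hf2 : f ≤ 2 := Nat.le_of_dvd two_pos ⟨g * e, by rw [← hefg]; ring⟩
  interval_cases e <;> interval_cases g <;> interval_cases f <;> simp_all

/-- **`𝔭` is the only prime of `K` above a ramified `p`** (`g = 1`). [cite: NeukirchANT1999, Ch. I §9 Prop. (9.6)] -/
theorem eq_asIdeal_of_dvd_discr (h2 : Module.finrank ℚ K = 2) (hdvd : (p : ℤ) ∣ NumberField.discr K)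
    (𝔭 : HeightOneSpectrum (𝓞 K)) (hp𝔭 : ((p : ℕ) : 𝓞 K) ∈ 𝔭.asIdeal) {Q : Ideal (𝓞 K)}
    [hQ : Q.IsPrime] (hpQ : ((p : ℕ) : 𝓞 K) ∈ Q) : Q = 𝔭.asIdeal := by
  have hpZ : Prime (p : ℤ) := Nat.prime_iff_prime_int.mp hp.out
  have hQ' : Q ∈ (Ideal.span {(p : ℤ)}).primesOver (𝓞 K) :=
    ⟨hQ, (Ideal.liesOver_span_iff hQ.ne_top hpZ).mpr (by simpa using hpQ)⟩
  have hP' : 𝔭.asIdeal ∈ (Ideal.span {(p : ℤ)}).primesOver (𝓞 K) :=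
    ⟨𝔭.isPrime, liesOver_span_of_natCast_mem 𝔭 hp𝔭⟩
  obtain ⟨a, ha⟩ := Set.ncard_eq_one.mp (ramificationIdxIn_eq_two_of_dvd_discr h2 hdvd).2.1
  rw [ha, Set.mem_singleton_iff] at hQ' hP'
  rw [hQ', hP']

/-- **`p𝓞_K = 𝔭²`** at a ramified prime of a quadratic field. [cite: NeukirchANT1999, Ch. I §8 Prop. (8.2)] -/
theorem span_natCast_eq_sq_of_dvd_discr (h2 : Module.finrank ℚ K = 2)
    (hdvd : (p : ℤ) ∣ NumberField.discr K) (𝔭 : HeightOneSpectrum (𝓞 K))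
    (hp𝔭 : ((p : ℕ) : 𝓞 K) ∈ 𝔭.asIdeal) : Ideal.span {((p : ℕ) : 𝓞 K)} = 𝔭.asIdeal ^ 2 := by
  haveI : Algebra.IsQuadraticExtension ℚ K := ⟨h2⟩
  haveI : IsGaloisGroup (K ≃ₐ[ℚ] K) ℤ (𝓞 K) :=
    IsGaloisGroup.of_isFractionRing (K ≃ₐ[ℚ] K) ℤ (𝓞 K) ℚ K
  have hpZ : Prime (p : ℤ) := Nat.prime_iff_prime_int.mp hp.out
  haveI : (Ideal.span {(p : ℤ)}).IsPrime := (Ideal.span_singleton_prime hpZ.ne_zero).mpr hpZ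
  haveI : (Ideal.span {(p : ℤ)}).IsMaximal := IsPrime.to_maximal_ideal (by simpa using hpZ.ne_zero)
  haveI := 𝔭.isPrime
  haveI := liesOver_span_of_natCast_mem 𝔭 hp𝔭
  obtain ⟨he, hg, -⟩ := ramificationIdxIn_eq_two_of_dvd_discr (K := K) h2 hdvd
  have hP' : 𝔭.asIdeal ∈ (Ideal.span {(p : ℤ)}).primesOver (𝓞 K) := ⟨𝔭.isPrime, ‹_›⟩
  obtain ⟨a, ha⟩ := Set.ncard_eq_one.mp hg
  have haP : a = 𝔭.asIdeal := by rw [ha, Set.mem_singleton_iff] at hP'; exact hP'.symm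
  have hmap := Ideal.map_algebraMap_eq_finsetProd_pow (R := 𝓞 K) (p := Ideal.span {(p : ℤ)})
    (by simpa using hpZ.ne_zero)
  rw [Ideal.map_span, Set.image_singleton, map_natCast] at hmap
  rw [hmap]
  have hfin : ((Ideal.span {(p : ℤ)}).primesOver (𝓞 K)).toFinset = {𝔭.asIdeal} := by
    rw [← Set.toFinset_singleton]; exact Set.toFinset_congr (ha.trans (by rw [haP]))
  rw [hfin, Finset.prod_singleton, ← Ideal.ramificationIdxIn_eq_ramificationIdx (Ideal.span {(p : ℤ)})
    𝔭.asIdeal (K ≃ₐ[ℚ] K), he]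

/-! ## §2 An embedding `τ : K → ℚ̄_p` sees `𝔭` -/

end LemmaXi

end Literature.NumberTheory.EllipticCurves.DeuringCM.RamifiedSevenEllipticUnits

end Part3

/-!
## Part 4 — port of `Summits/BirchSwinnertonDyer/BirchSwinnertonDyer/Theorems/RamifiedSevenEllipticUnitsRigidityDirichlet.lean` (4 declarations kept)

# Rigidity bridge (R1): the Hecke `L`-function of an ARBITRARY Hecke character as an `ℕ`-indexed Dirichlet series (translate of the unitary part)

Declarations of this Part (verbatim port; each keeps its own docstring and citation): `exists_ramificationModulus`, `heckeLFunction_eq_rayClassLSeries_of_isUnitary`, `heckeLFunction_eq_LSeries_twistCount_of_isUnitary`, `exists_heckeLFunction_eq_LSeries_translate`.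

Reference keys (see `references.bib` and the declarations' citations): [NeukirchANT1999], [WeilBNT1967].
-/

section Part4

set_option autoImplicit false

open scoped _root_.Classical
open _root_.NumberField _root_.IsDedekindDomain
  Literature.NumberTheory.GaloisRepresentations
  Literature.NumberTheory.LFunctions

namespace Literature.NumberTheory.EllipticCurves.DeuringCM.RamifiedSevenEllipticUnits

namespace Rigidity

variable {K : Type} [Field K] [NumberField K]

/-- **A ramification modulus**: for every Hecke character `χ` there is a nonzero ideal `𝔪` of `𝓞_K`
with `𝔪 ≤ v ↔ χ` ramified at `v` (the product of the finitely many ramified primes,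
`finite_ramifiedPlaces_holds`). [cite: NeukirchANT1999, Ch. VII §6 (6.12) (proof)] -/
theorem exists_ramificationModulus (χ : HeckeCharacter K) :
    ∃ 𝔪 : Ideal (𝓞 K), 𝔪 ≠ ⊥ ∧ ∀ v : HeightOneSpectrum (𝓞 K), χ.IsUnramifiedAt v ↔ ¬ 𝔪 ≤ v.asIdeal := by
  have hfin : (χ.ramifiedPlaces).Finite := HeckeCharacter.finite_ramifiedPlaces_holds χ
  refine ⟨∏ v ∈ hfin.toFinset, v.asIdeal, ?_, fun v ↦ ?_⟩
  · rw [Ne, ← Ideal.zero_eq_bot]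
    exact Finset.prod_ne_zero_iff.mpr fun w _ ↦ by rw [Ideal.zero_eq_bot]; exact w.ne_bot
  · constructor
    · intro hv hle
      haveI := v.isPrime
      obtain ⟨w, hw, hwv⟩ := (Ideal.IsPrime.prod_le inferInstance).mp hle
      have hwv' : w = v := HeightOneSpectrum.ext (w.isMaximal.eq_of_le v.isPrime.ne_top hwv)
      rw [Set.Finite.mem_toFinset] at hw
      exact hw (hwv' ▸ hv)
    · intro hle
      by_contra hv
      have hmem : v ∈ hfin.toFinset := by rw [Set.Finite.mem_toFinset]; exact hv
      exact hle (Ideal.le_of_dvd (Finset.dvd_prod_of_mem _ hmem))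

/-- **`L(χ, s) = Σ_𝔞 χ(𝔞) N𝔞^{−s}` for a UNITARY Hecke character, `re s > 1`** — the idelic Euler product
over the unramified places equals the ideal-indexed series of `𝔞 ↦ χ(𝔞)` (extended by `0` on ideals not
prime to the ramification modulus `𝔪`). [cite: NeukirchANT1999, Ch. VII §8 (8.1)–(8.2)] -/
theorem heckeLFunction_eq_rayClassLSeries_of_isUnitary {χ : HeckeCharacter K} (hu : χ.IsUnitary)
    {𝔪 : Ideal (𝓞 K)} (h𝔪 : 𝔪 ≠ ⊥)
    (hiff : ∀ v : HeightOneSpectrum (𝓞 K), χ.IsUnramifiedAt v ↔ ¬ 𝔪 ≤ v.asIdeal)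
    {s : ℂ} (hs : 1 < s.re) :
    heckeLFunction χ s = rayClassLSeries 𝔪 (fun v ↦ χ.valueAtUniformizer v) s := by
  rw [rayClassLSeries_eq_tprod h𝔪 (fun v _ ↦ (HeckeCharacter.norm_valueAtUniformizer_of_isUnitary hu v).le) hs,
    heckeLFunction]
  let e : {v : HeightOneSpectrum (𝓞 K) // χ.IsUnramifiedAt v} ≃
      {v : HeightOneSpectrum (𝓞 K) // ¬ 𝔪 ≤ v.asIdeal} := Equiv.subtypeEquivRight fun v ↦ hiff v
  rw [← Equiv.tprod_eq e]
  exact tprod_congr fun v ↦ rfl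

/-- **`L(χ, s)` as an `ℕ`-indexed Dirichlet series for a UNITARY `χ`**: `= LSeries (n ↦ Σ_{N𝔞 = n} χ(𝔞)) s`,
`re s > 1`. [cite: NeukirchANT1999, Ch. VII §8 (8.1)] -/
theorem heckeLFunction_eq_LSeries_twistCount_of_isUnitary {χ : HeckeCharacter K} (hu : χ.IsUnitary)
    {𝔪 : Ideal (𝓞 K)} (h𝔪 : 𝔪 ≠ ⊥)
    (hiff : ∀ v : HeightOneSpectrum (𝓞 K), χ.IsUnramifiedAt v ↔ ¬ 𝔪 ≤ v.asIdeal)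
    {s : ℂ} (hs : 1 < s.re) :
    heckeLFunction χ s =
      LSeries (NumberField.twistCount K (rayClassCoeffHom 𝔪 fun v ↦ χ.valueAtUniformizer v)) s := by
  rw [heckeLFunction_eq_rayClassLSeries_of_isUnitary hu h𝔪 hiff hs,
    rayClassLSeries_eq_LSeries_twistCount h𝔪
      (fun v _ ↦ (HeckeCharacter.norm_valueAtUniformizer_of_isUnitary hu v).le) hs]

/-- **`L(χ, s)` as a translated Dirichlet series for an ARBITRARY Hecke character** (Weil's
`χ = χ₀ ‖·‖^σ`): there are `σ : ℝ`, a unitary `χ₀` with the same ramification as `χ` and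
`χ₀(ϖ_v) = χ(ϖ_v)·Nv^σ`, and a nonzero modulus `𝔪` cutting out that ramification, such that
`heckeLFunction χ s = LSeries (n ↦ Σ_{N𝔞 = n} χ₀(𝔞)) (s + σ)` for `re s > 1 − σ`.
[cite: WeilBNT1967, Ch. VII §3 Cor. 1–2 and §7 ¶1] [cite: NeukirchANT1999, Ch. VII §8 (8.1)] -/
theorem exists_heckeLFunction_eq_LSeries_translate (χ : HeckeCharacter K) :
    ∃ (σ : ℝ) (χ₀ : HeckeCharacter K) (𝔪 : Ideal (𝓞 K)), χ₀.IsUnitary ∧ 𝔪 ≠ ⊥ ∧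
      (∀ x : ideleGroup K, ‖((χ x : ℂˣ) : ℂ)‖ = ideleNorm x ^ σ) ∧
      (∀ v : HeightOneSpectrum (𝓞 K), χ.IsUnramifiedAt v ↔ ¬ 𝔪 ≤ v.asIdeal) ∧
      (∀ v : HeightOneSpectrum (𝓞 K), χ₀.IsUnramifiedAt v ↔ ¬ 𝔪 ≤ v.asIdeal) ∧
      (∀ v : HeightOneSpectrum (𝓞 K), χ₀.valueAtUniformizer v =
        χ.valueAtUniformizer v * ((Ideal.absNorm v.asIdeal : ℕ) : ℂ) ^ (σ : ℂ)) ∧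
      ∀ s : ℂ, 1 - σ < s.re → heckeLFunction χ s =
        LSeries (NumberField.twistCount K (rayClassCoeffHom 𝔪 fun v ↦ χ₀.valueAtUniformizer v))
          (s + σ) := by
  obtain ⟨σ, χ₀, hu, hσ, hram, hval, hL⟩ := χ.exists_isUnitary_heckeLFunction_eq_translate
  obtain ⟨𝔪, h𝔪, hiff⟩ := exists_ramificationModulus χ
  have hiff₀ : ∀ v : HeightOneSpectrum (𝓞 K), χ₀.IsUnramifiedAt v ↔ ¬ 𝔪 ≤ v.asIdeal :=
    fun v ↦ (hram v).symm.trans (hiff v)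
  refine ⟨σ, χ₀, 𝔪, hu, h𝔪, hσ, hiff, hiff₀, hval, fun s hs ↦ ?_⟩
  rw [hL s]
  exact heckeLFunction_eq_LSeries_twistCount_of_isUnitary hu h𝔪 hiff₀
    (by simp only [Complex.add_re, Complex.ofReal_re]; linarith)

end Rigidity

end Literature.NumberTheory.EllipticCurves.DeuringCM.RamifiedSevenEllipticUnits

end Part4

/-!
## Part 5 — port of `Summits/BirchSwinnertonDyer/BirchSwinnertonDyer/Theorems/RamifiedSevenEllipticUnitsRigidityCoefficients.lean` (5 declarations kept)

# Rigidity bridge (R2, first half): equal Hecke `L`-functions have equal (weighted) Dirichlet coefficients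

Declarations of this Part (verbatim port; each keeps its own docstring and citation): `term_shift`, `LSeries_shift`, `LSeriesSummable_shift_iff`, `abscissaOfAbsConv_weighted_lt_top`, `weightedCoeff_eq_of_heckeLFunction_eq`.

Reference keys (see `references.bib` and the declarations' citations): [NeukirchANT1999], [WeilBNT1967].
-/

section Part5

set_option autoImplicit false

open scoped _root_.Classical
open _root_.Filter _root_.NumberField _root_.IsDedekindDomain
  Literature.NumberTheory.GaloisRepresentations
  Literature.NumberTheory.LFunctions

namespace Literature.NumberTheory.EllipticCurves.DeuringCM.RamifiedSevenEllipticUnits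

namespace Rigidity

/-! ## §1 Translating a Dirichlet series -/

/-- **`term (n ↦ a n · n^{−σ}) s = term a (s + σ)`**: translating the variable is weighting the
coefficients. [cite: NeukirchANT1999, Ch. VII §8 (8.1)] -/
theorem term_shift (a : ℕ → ℂ) (σ : ℝ) (s : ℂ) :
    LSeries.term (fun n ↦ a n * (n : ℂ) ^ (-(σ : ℂ))) s = LSeries.term a (s + σ) := by
  funext n
  rcases eq_or_ne n 0 with rfl | hn
  · simp
  · have hn' : (n : ℂ) ≠ 0 := by exact_mod_cast hn
    rw [LSeries.term_of_ne_zero hn, LSeries.term_of_ne_zero hn, Complex.cpow_add _ _ hn',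
      Complex.cpow_neg]
    field_simp

/-- `LSeries (n ↦ a n · n^{−σ}) s = LSeries a (s + σ)`. [cite: NeukirchANT1999, Ch. VII §8 (8.1)] -/
theorem LSeries_shift (a : ℕ → ℂ) (σ : ℝ) (s : ℂ) :
    LSeries (fun n ↦ a n * (n : ℂ) ^ (-(σ : ℂ))) s = LSeries a (s + σ) := by
  rw [LSeries, LSeries, term_shift]

/-- `LSeriesSummable (n ↦ a n · n^{−σ}) s ↔ LSeriesSummable a (s + σ)`. [cite: NeukirchANT1999, Ch. VII §8 (8.1)] -/
theorem LSeriesSummable_shift_iff (a : ℕ → ℂ) (σ : ℝ) (s : ℂ) :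
    LSeriesSummable (fun n ↦ a n * (n : ℂ) ^ (-(σ : ℂ))) s ↔ LSeriesSummable a (s + σ) := by
  rw [LSeriesSummable, LSeriesSummable, term_shift]

/-! ## §2 Equal Hecke `L`-functions ⇒ equal weighted coefficients -/

variable {K : Type} [Field K] [NumberField K]

/-- The coefficient function of a unitary character has finite abscissa of absolute convergence
after any translation (it converges for `re s > 1`). [cite: NeukirchANT1999, Ch. VII §8 (8.1)] -/
theorem abscissaOfAbsConv_weighted_lt_top {χ₀ : HeckeCharacter K} (hu : χ₀.IsUnitary)
    {𝔪 : Ideal (𝓞 K)} (h𝔪 : 𝔪 ≠ ⊥) (σ : ℝ) :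
    LSeries.abscissaOfAbsConv (fun n ↦
      NumberField.twistCount K (rayClassCoeffHom 𝔪 fun v ↦ χ₀.valueAtUniformizer v) n *
        (n : ℂ) ^ (-(σ : ℂ))) < ⊤ := by
  have hν : ∀ I, ‖rayClassCoeffHom 𝔪 (fun v ↦ χ₀.valueAtUniformizer v) I‖ ≤ 1 :=
    norm_rayClassCoeffHom_le h𝔪 fun v _ ↦ (HeckeCharacter.norm_valueAtUniformizer_of_isUnitary hu v).le
  have hsum : LSeriesSummable (fun n ↦
      NumberField.twistCount K (rayClassCoeffHom 𝔪 fun v ↦ χ₀.valueAtUniformizer v) n *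
        (n : ℂ) ^ (-(σ : ℂ))) ((2 - σ : ℝ) : ℂ) := by
    rw [LSeriesSummable_shift_iff]
    refine NumberField.LSeriesSummable_twistCount hν ?_
    simp only [Complex.add_re, Complex.ofReal_re]
    linarith
  exact lt_of_le_of_lt (hsum.abscissaOfAbsConv_le) (EReal.coe_lt_top _)

/-- **Equal Hecke `L`-functions have equal weighted Dirichlet coefficients.** If
`heckeLFunction φ s = heckeLFunction ψ s` for `re s > s₀`, then with Weil's decompositions
`φ = φ₀‖·‖^{σ₁}`, `ψ = ψ₀‖·‖^{σ₂}` (file (R1)) the coefficient functions satisfy, for every `n ≠ 0`,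
`(Σ_{N𝔞 = n} φ₀(𝔞))·n^{−σ₁} = (Σ_{N𝔞 = n} ψ₀(𝔞))·n^{−σ₂}` (sums over ideals prime to the
respective ramification moduli). [cite: NeukirchANT1999, Ch. VII §8 (8.1)] [cite: WeilBNT1967, Ch. VII §7 ¶1] -/
theorem weightedCoeff_eq_of_heckeLFunction_eq (φ ψ : HeckeCharacter K) (s₀ : ℝ)
    (h : ∀ s : ℂ, s₀ < s.re → heckeLFunction φ s = heckeLFunction ψ s) :
    ∃ (σ₁ : ℝ) (φ₀ : HeckeCharacter K) (𝔪₁ : Ideal (𝓞 K)) (σ₂ : ℝ) (ψ₀ : HeckeCharacter K)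
      (𝔪₂ : Ideal (𝓞 K)),
      φ₀.IsUnitary ∧ 𝔪₁ ≠ ⊥ ∧ (∀ x : ideleGroup K, ‖((φ x : ℂˣ) : ℂ)‖ = ideleNorm x ^ σ₁) ∧
      (∀ v : HeightOneSpectrum (𝓞 K), φ.IsUnramifiedAt v ↔ ¬ 𝔪₁ ≤ v.asIdeal) ∧
      (∀ v : HeightOneSpectrum (𝓞 K), φ₀.IsUnramifiedAt v ↔ ¬ 𝔪₁ ≤ v.asIdeal) ∧
      (∀ v : HeightOneSpectrum (𝓞 K), φ₀.valueAtUniformizer v =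
        φ.valueAtUniformizer v * ((Ideal.absNorm v.asIdeal : ℕ) : ℂ) ^ (σ₁ : ℂ)) ∧
      ψ₀.IsUnitary ∧ 𝔪₂ ≠ ⊥ ∧ (∀ x : ideleGroup K, ‖((ψ x : ℂˣ) : ℂ)‖ = ideleNorm x ^ σ₂) ∧
      (∀ v : HeightOneSpectrum (𝓞 K), ψ.IsUnramifiedAt v ↔ ¬ 𝔪₂ ≤ v.asIdeal) ∧
      (∀ v : HeightOneSpectrum (𝓞 K), ψ₀.IsUnramifiedAt v ↔ ¬ 𝔪₂ ≤ v.asIdeal) ∧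
      (∀ v : HeightOneSpectrum (𝓞 K), ψ₀.valueAtUniformizer v =
        ψ.valueAtUniformizer v * ((Ideal.absNorm v.asIdeal : ℕ) : ℂ) ^ (σ₂ : ℂ)) ∧
      ∀ n : ℕ, n ≠ 0 →
        NumberField.twistCount K (rayClassCoeffHom 𝔪₁ fun v ↦ φ₀.valueAtUniformizer v) n *
            (n : ℂ) ^ (-(σ₁ : ℂ)) =
          NumberField.twistCount K (rayClassCoeffHom 𝔪₂ fun v ↦ ψ₀.valueAtUniformizer v) n *
            (n : ℂ) ^ (-(σ₂ : ℂ)) := by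
  obtain ⟨σ₁, φ₀, 𝔪₁, hu₁, h𝔪₁, hσ₁, hiff₁, hiff₁', hval₁, hL₁⟩ :=
    exists_heckeLFunction_eq_LSeries_translate φ
  obtain ⟨σ₂, ψ₀, 𝔪₂, hu₂, h𝔪₂, hσ₂, hiff₂, hiff₂', hval₂, hL₂⟩ :=
    exists_heckeLFunction_eq_LSeries_translate ψ
  refine ⟨σ₁, φ₀, 𝔪₁, σ₂, ψ₀, 𝔪₂, hu₁, h𝔪₁, hσ₁, hiff₁, hiff₁', hval₁, hu₂, h𝔪₂, hσ₂, hiff₂, hiff₂',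
    hval₂, fun n hn ↦ ?_⟩
  refine LSeries.eq_of_LSeries_eventually_eq (abscissaOfAbsConv_weighted_lt_top hu₁ h𝔪₁ σ₁)
    (abscissaOfAbsConv_weighted_lt_top hu₂ h𝔪₂ σ₂) ?_ hn
  -- on large reals both weighted series ARE the common `L`-function
  rw [Filter.EventuallyEq, Filter.eventually_atTop]
  refine ⟨max s₀ (max (1 - σ₁) (1 - σ₂)) + 1, fun x hx ↦ ?_⟩
  have hx₀ : s₀ < ((x : ℂ)).re := by simp only [Complex.ofReal_re]; linarith [le_max_left s₀ (max (1 - σ₁) (1 - σ₂))]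
  have hx₁ : 1 - σ₁ < ((x : ℂ)).re := by
    simp only [Complex.ofReal_re]
    linarith [le_max_left (1 - σ₁) (1 - σ₂), le_max_right s₀ (max (1 - σ₁) (1 - σ₂))]
  have hx₂ : 1 - σ₂ < ((x : ℂ)).re := by
    simp only [Complex.ofReal_re]
    linarith [le_max_right (1 - σ₁) (1 - σ₂), le_max_right s₀ (max (1 - σ₁) (1 - σ₂))]
  show LSeries _ (x : ℂ) = LSeries _ (x : ℂ)
  rw [LSeries_shift, LSeries_shift, ← hL₁ x hx₁, ← hL₂ x hx₂]
  exact h x hx₀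

end Rigidity

end Literature.NumberTheory.EllipticCurves.DeuringCM.RamifiedSevenEllipticUnits

end Part5

/-!
## Part 6 — port of `Summits/BirchSwinnertonDyer/BirchSwinnertonDyer/Theorems/RamifiedSevenEllipticUnitsRigidityValuePairs.lean` (4 declarations kept)

# Rigidity bridge (R2, second half): at a split prime, equal Hecke `L`-functions have equal VALUE PAIRS

Declarations of this Part (verbatim port; each keeps its own docstring and citation): `twistCount_eq_finsum`, `rayClassCoeffHom_asIdeal`, `pair_eq_of_sum_eq_of_mul_eq`, `valuePair_eq_of_heckeLFunction_eq`.

Reference keys (see `references.bib` and the declarations' citations): [NeukirchANT1999], [Ribet1977Nebentypus].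
-/

section Part6

set_option autoImplicit false

open scoped _root_.Classical
open _root_.Filter _root_.NumberField _root_.IsDedekindDomain
  Literature.NumberTheory.GaloisRepresentations
  Literature.NumberTheory.LFunctions
  Literature.NumberTheory.EllipticCurves.ModularForms

namespace Literature.NumberTheory.EllipticCurves.DeuringCM.RamifiedSevenEllipticUnits

namespace Rigidity

variable {K : Type} [Field K] [NumberField K]

/-- `twistCount ν n = ∑ᶠ_{N𝔞 = n} ν(𝔞)`. [cite: NeukirchANT1999, Ch. VII §8 (8.1)] -/
theorem twistCount_eq_finsum (ν : Ideal (𝓞 K) →*₀ ℂ) (n : ℕ) :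
    NumberField.twistCount K ν n = ∑ᶠ I ∈ {I : Ideal (𝓞 K) | Ideal.absNorm I = n}, ν I := by
  rw [NumberField.twistCount, NumberField.idealsOfNorm,
    ← finsum_mem_coe_finset, Set.Finite.coe_toFinset]

/-- The coefficient function `rayClassCoeffHom 𝔪 ψ` at a prime `w ∤ 𝔪` is `ψ w`. [cite: NeukirchANT1999, Ch. VII §8 (8.1)] -/
theorem rayClassCoeffHom_asIdeal {𝔪 : Ideal (𝓞 K)} (ψ : HeightOneSpectrum (𝓞 K) → ℂ)
    {w : HeightOneSpectrum (𝓞 K)} (hw : ¬ 𝔪 ≤ w.asIdeal) (h𝔪 : 𝔪 ≠ ⊥) :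
    rayClassCoeffHom 𝔪 ψ w.asIdeal = ψ w := by
  rw [rayClassCoeffHom_apply, rayClassCoeff, if_pos ⟨w.ne_bot, isCoprime_asIdeal_of_not_le h𝔪 hw⟩,
    idealPow_asIdeal]

/-- **Vieta for a pair**: equal sums and equal products give equal unordered pairs. [cite: NeukirchANT1999, Ch. VII §8 (8.1)] -/
theorem pair_eq_of_sum_eq_of_mul_eq {a b c d : ℂ} (hs : a + b = c + d) (hp : a * b = c * d) :
    (a = c ∧ b = d) ∨ (a = d ∧ b = c) := by
  have h : (a - c) * (a - d) = 0 := by linear_combination a * hs - hp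
  rcases mul_eq_zero.mp h with h1 | h1
  · left
    refine ⟨sub_eq_zero.mp h1, ?_⟩
    have := sub_eq_zero.mp h1
    linear_combination hs - this
  · right
    refine ⟨sub_eq_zero.mp h1, ?_⟩
    have := sub_eq_zero.mp h1
    linear_combination hs - this

/-- **Equal Hecke `L`-functions ⇒ equal value pairs at a split prime.** `K` quadratic; `φ`, `ψ` Hecke
characters with `heckeLFunction φ s = heckeLFunction ψ s` for `re s > s₀`; `v` a rational place
unramified in `K` that splits as `{w₁, w₂}` (both of residue degree one), with `φ` and `ψ` unramified
at `w₁`, `w₂`. Then `{φ(ϖ_{w₁}), φ(ϖ_{w₂})} = {ψ(ϖ_{w₁}), ψ(ϖ_{w₂})}` as unordered pairs.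
[cite: Ribet1977Nebentypus, §3 Thm. (3.4)] [cite: NeukirchANT1999, Ch. VII §8 (8.1)] -/
theorem valuePair_eq_of_heckeLFunction_eq (φ ψ : HeckeCharacter K) (s₀ : ℝ)
    (h : ∀ s : ℂ, s₀ < s.re → heckeLFunction φ s = heckeLFunction ψ s)
    (v : HeightOneSpectrum (𝓞 ℚ)) {w₁ w₂ : HeightOneSpectrum (𝓞 K)} (hne : w₁ ≠ w₂)
    (hS : {w : HeightOneSpectrum (𝓞 K) | w.asIdeal.under (𝓞 ℚ) = v.asIdeal} = {w₁, w₂})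
    (h₁ : w₁.asIdeal.inertiaDeg (𝓞 ℚ) = 1) (h₂ : w₂.asIdeal.inertiaDeg (𝓞 ℚ) = 1)
    (hφ₁ : φ.IsUnramifiedAt w₁) (hφ₂ : φ.IsUnramifiedAt w₂)
    (hψ₁ : ψ.IsUnramifiedAt w₁) (hψ₂ : ψ.IsUnramifiedAt w₂) :
    (φ.valueAtUniformizer w₁ = ψ.valueAtUniformizer w₁ ∧ φ.valueAtUniformizer w₂ = ψ.valueAtUniformizer w₂) ∨
    (φ.valueAtUniformizer w₁ = ψ.valueAtUniformizer w₂ ∧ φ.valueAtUniformizer w₂ = ψ.valueAtUniformizer w₁) := by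
  obtain ⟨σ₁, φ₀, 𝔪₁, σ₂, ψ₀, 𝔪₂, -, h𝔪₁, -, hiff₁, -, hval₁, -, h𝔪₂, -, hiff₂, -, hval₂, hcoeff⟩ :=
    weightedCoeff_eq_of_heckeLFunction_eq φ ψ s₀ h
  set ℓ : ℕ := Rat.HeightOneSpectrum.natGenerator v with hℓ
  have hℓp : ℓ.Prime := Rat.HeightOneSpectrum.prime_natGenerator v
  have hℓ0 : (ℓ : ℂ) ≠ 0 := by exact_mod_cast hℓp.ne_zero
  -- the coefficient functions as finsums over ideals of norm `ℓ^e`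
  set g₁ : Ideal (𝓞 K) →*₀ ℂ := rayClassCoeffHom 𝔪₁ fun v ↦ φ₀.valueAtUniformizer v
  set g₂ : Ideal (𝓞 K) →*₀ ℂ := rayClassCoeffHom 𝔪₂ fun v ↦ ψ₀.valueAtUniformizer v
  have hmul : ∀ (g : Ideal (𝓞 K) →*₀ ℂ) (A B : Ideal (𝓞 K)), A ≠ ⊥ → B ≠ ⊥ → g (A * B) = g A * g B :=
    fun g A B _ _ ↦ map_mul g A B
  have hone : ∀ g : Ideal (𝓞 K) →*₀ ℂ, g ⊤ = 1 := fun g ↦ by rw [← Ideal.one_eq_top, map_one]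
  have hsum : ∀ (g : Ideal (𝓞 K) →*₀ ℂ) (e : ℕ), NumberField.twistCount K g (ℓ ^ e) =
      ∑ i ∈ Finset.range (e + 1), g w₁.asIdeal ^ i * g w₂.asIdeal ^ (e - i) := by
    intro g e
    rw [twistCount_eq_finsum, hℓ]
    exact finsum_absNorm_eq_prime_pow_of_pair g (hmul g) (hone g) v hne hS h₁ h₂ e
  -- values of the coefficient functions at `w₁`, `w₂`
  have hg₁₁ : g₁ w₁.asIdeal = φ₀.valueAtUniformizer w₁ :=
    rayClassCoeffHom_asIdeal _ ((hiff₁ w₁).mp hφ₁) h𝔪₁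
  have hg₁₂ : g₁ w₂.asIdeal = φ₀.valueAtUniformizer w₂ :=
    rayClassCoeffHom_asIdeal _ ((hiff₁ w₂).mp hφ₂) h𝔪₁
  have hg₂₁ : g₂ w₁.asIdeal = ψ₀.valueAtUniformizer w₁ :=
    rayClassCoeffHom_asIdeal _ ((hiff₂ w₁).mp hψ₁) h𝔪₂
  have hg₂₂ : g₂ w₂.asIdeal = ψ₀.valueAtUniformizer w₂ :=
    rayClassCoeffHom_asIdeal _ ((hiff₂ w₂).mp hψ₂) h𝔪₂
  -- norms of `w₁`, `w₂` are `ℓ`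
  have hN : ∀ {w : HeightOneSpectrum (𝓞 K)}, w ∈ ({w₁, w₂} : Set (HeightOneSpectrum (𝓞 K))) →
      w.asIdeal.inertiaDeg (𝓞 ℚ) = 1 → ((Ideal.absNorm w.asIdeal : ℕ) : ℂ) = ℓ := by
    intro w hw hf
    have hw' : w.asIdeal.under (𝓞 ℚ) = v.asIdeal := by rw [← hS] at hw; exact hw
    have := (absNorm_eq_natGenerator_iff (K := K) v w.asIdeal).mpr ⟨w, rfl, hw', hf⟩
    rw [this]
  have hN₁ : ((Ideal.absNorm w₁.asIdeal : ℕ) : ℂ) = ℓ := hN (by simp) h₁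
  have hN₂ : ((Ideal.absNorm w₂.asIdeal : ℕ) : ℂ) = ℓ := hN (by simp) h₂
  -- abbreviations for the eight values
  set a := φ.valueAtUniformizer w₁
  set b := φ.valueAtUniformizer w₂
  set c := ψ.valueAtUniformizer w₁
  set d := ψ.valueAtUniformizer w₂
  have ha : φ₀.valueAtUniformizer w₁ = a * (ℓ : ℂ) ^ (σ₁ : ℂ) := by rw [hval₁, hN₁]
  have hb : φ₀.valueAtUniformizer w₂ = b * (ℓ : ℂ) ^ (σ₁ : ℂ) := by rw [hval₁, hN₂]
  have hc : ψ₀.valueAtUniformizer w₁ = c * (ℓ : ℂ) ^ (σ₂ : ℂ) := by rw [hval₂, hN₁]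
  have hd : ψ₀.valueAtUniformizer w₂ = d * (ℓ : ℂ) ^ (σ₂ : ℂ) := by rw [hval₂, hN₂]
  -- the weights: `u = ℓ^σ ≠ 0`, `ℓ^{−σ} = u⁻¹`, `(ℓ²)^{−σ} = u⁻¹·u⁻¹`
  have hu : ∀ σ : ℝ, (ℓ : ℂ) ^ (σ : ℂ) ≠ 0 := fun σ h0 ↦
    hℓ0 (Complex.cpow_eq_zero_iff _ _ |>.mp h0).1
  have hw1 : ∀ σ : ℝ, ((ℓ : ℕ) : ℂ) ^ (-(σ : ℂ)) = ((ℓ : ℂ) ^ (σ : ℂ))⁻¹ := fun σ ↦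
    Complex.cpow_neg _ _
  have hw2 : ∀ σ : ℝ, ((ℓ ^ 2 : ℕ) : ℂ) ^ (-(σ : ℂ)) = ((ℓ : ℂ) ^ (σ : ℂ))⁻¹ * ((ℓ : ℂ) ^ (σ : ℂ))⁻¹ := by
    intro σ
    rw [pow_two, Nat.cast_mul, Complex.natCast_mul_natCast_cpow, Complex.cpow_neg]
  -- the coefficient sums at `ℓ` and `ℓ²`
  have hs1 : ∀ g : Ideal (𝓞 K) →*₀ ℂ, NumberField.twistCount K g ℓ = g w₂.asIdeal + g w₁.asIdeal := by
    intro g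
    have := hsum g 1
    rw [pow_one] at this
    rw [this, Finset.sum_range_succ, Finset.sum_range_succ, Finset.sum_range_zero]
    simp
  have hs2 : ∀ g : Ideal (𝓞 K) →*₀ ℂ, NumberField.twistCount K g (ℓ ^ 2) =
      g w₂.asIdeal ^ 2 + g w₁.asIdeal * g w₂.asIdeal + g w₁.asIdeal ^ 2 := by
    intro g
    rw [hsum g 2, Finset.sum_range_succ, Finset.sum_range_succ, Finset.sum_range_succ,
      Finset.sum_range_zero]
    simp
  -- read the weighted identities
  have e1 := hcoeff ℓ hℓp.ne_zero
  have e2 := hcoeff (ℓ ^ 2) (pow_ne_zero 2 hℓp.ne_zero)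
  rw [hs1, hs1, hg₁₁, hg₁₂, hg₂₁, hg₂₂, ha, hb, hc, hd, hw1, hw1] at e1
  rw [hs2, hs2, hg₁₁, hg₁₂, hg₂₁, hg₂₂, ha, hb, hc, hd, hw2, hw2] at e2
  have hsum' : a + b = c + d := by
    have hu₁ := hu σ₁; have hu₂ := hu σ₂
    field_simp at e1
    linear_combination e1
  have hsq : a ^ 2 + a * b + b ^ 2 = c ^ 2 + c * d + d ^ 2 := by
    have hu₁ := hu σ₁; have hu₂ := hu σ₂
    field_simp at e2
    linear_combination e2
  have hprod : a * b = c * d := by linear_combination (a + b + c + d) * hsum' - hsq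
  exact pair_eq_of_sum_eq_of_mul_eq hsum' hprod

end Rigidity

end Literature.NumberTheory.EllipticCurves.DeuringCM.RamifiedSevenEllipticUnits

end Part6

/-!
## Part 7 — port of `Summits/BirchSwinnertonDyer/BirchSwinnertonDyer/Theorems/RamifiedSevenEllipticUnitsPinnedCharacterRigidity.lean` (6 declarations kept)

# Rigidity bridge, COMPOSITION: from two `L`-pinned characters to the value-pair disjunction at cofinitely many places, and the registered stub H_Rig⁰ modulo the algebraic end

Declarations of this Part (verbatim port; each keeps its own docstring and citation): `value_eq_of_heckeLFunction_eq_of_inert`, `card_algEquiv_eq_two`, `under_smul_asIdeal`, `smul_eq_of_places_eq_pair`, `smul_eq_self_of_places_eq_singleton`, `valuePairs_eventually_of_heckeLFunction_eq`.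

Reference keys (see `references.bib` and the declarations' citations): [Ribet1977Nebentypus], [NeukirchANT1999], [Marcus2018], [SilvermanATAEC1994].
-/

section Part7

set_option autoImplicit false

open scoped _root_.Classical _root_.Pointwise
open _root_.Filter _root_.NumberField _root_.IsDedekindDomain
  Literature.NumberTheory.GaloisRepresentations
  Literature.NumberTheory.LFunctions
  Literature.NumberTheory.EllipticCurves
  Literature.NumberTheory.EllipticCurves.ModularForms
  Literature.NumberTheory.QuadraticFields

namespace Literature.NumberTheory.EllipticCurves.DeuringCM.RamifiedSevenEllipticUnits

namespace Rigidity

variable {K : Type} [Field K] [NumberField K]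

/-! ## §1 (G1) The inert sibling of (R2b) -/

/-- **Equal Hecke `L`-functions ⇒ equal values at an inert prime.** `φ`, `ψ` Hecke characters of `K`
with `heckeLFunction φ s = heckeLFunction ψ s` for `re s > s₀`; `v` a rational place with a SINGLE place
`w` of `K` above it, of residue degree `2` (`v` inert), `φ` and `ψ` unramified at `w`. Then
`φ(ϖ_w) = ψ(ϖ_w)`: the weighted coefficient identity of (R2a) at `n = ℓ²` reads `φ₀(w)·ℓ^{−2σ_φ} =
ψ₀(w)·ℓ^{−2σ_ψ}` because the only ideal of norm `ℓ²` is `𝔭_w` (`finsum_absNorm_eq_prime_pow_of_singleton`),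
and `φ₀(w) = φ(w)·(Nw)^{σ_φ}` with `Nw = ℓ²`. [cite: Ribet1977Nebentypus, §3 Thm. (3.4) and Cor. (3.5)]
[cite: NeukirchANT1999, Ch. VII §8 (8.1)] -/
theorem value_eq_of_heckeLFunction_eq_of_inert (φ ψ : HeckeCharacter K) (s₀ : ℝ)
    (h : ∀ s : ℂ, s₀ < s.re → heckeLFunction φ s = heckeLFunction ψ s)
    (v : HeightOneSpectrum (𝓞 ℚ)) {w : HeightOneSpectrum (𝓞 K)}
    (hS : {w : HeightOneSpectrum (𝓞 K) | w.asIdeal.under (𝓞 ℚ) = v.asIdeal} = {w})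
    (hw : w.asIdeal.inertiaDeg (𝓞 ℚ) = 2)
    (hφ : φ.IsUnramifiedAt w) (hψ : ψ.IsUnramifiedAt w) :
    φ.valueAtUniformizer w = ψ.valueAtUniformizer w := by
  obtain ⟨σ₁, φ₀, 𝔪₁, σ₂, ψ₀, 𝔪₂, -, h𝔪₁, -, hiff₁, -, hval₁, -, h𝔪₂, -, hiff₂, -, hval₂, hcoeff⟩ :=
    weightedCoeff_eq_of_heckeLFunction_eq φ ψ s₀ h
  set ℓ : ℕ := Rat.HeightOneSpectrum.natGenerator v with hℓ
  have hℓp : ℓ.Prime := Rat.HeightOneSpectrum.prime_natGenerator v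
  set g₁ : Ideal (𝓞 K) →*₀ ℂ := rayClassCoeffHom 𝔪₁ fun v ↦ φ₀.valueAtUniformizer v
  set g₂ : Ideal (𝓞 K) →*₀ ℂ := rayClassCoeffHom 𝔪₂ fun v ↦ ψ₀.valueAtUniformizer v
  have hmul : ∀ (g : Ideal (𝓞 K) →*₀ ℂ) (A B : Ideal (𝓞 K)), A ≠ ⊥ → B ≠ ⊥ → g (A * B) = g A * g B :=
    fun g A B _ _ ↦ map_mul g A B
  have hone : ∀ g : Ideal (𝓞 K) →*₀ ℂ, g ⊤ = 1 := fun g ↦ by rw [← Ideal.one_eq_top, map_one]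
  -- the coefficient at `ℓ²` is the single term `g(𝔭_w)`
  have hsum : ∀ g : Ideal (𝓞 K) →*₀ ℂ, NumberField.twistCount K g (ℓ ^ 2) = g w.asIdeal := by
    intro g
    have h1 := (finsum_absNorm_eq_prime_pow_of_singleton g (hmul g) (hone g) v hS hw 1).1
    rw [mul_one, pow_one] at h1
    rw [twistCount_eq_finsum, hℓ]
    exact h1
  have hg₁ : g₁ w.asIdeal = φ₀.valueAtUniformizer w :=
    rayClassCoeffHom_asIdeal _ ((hiff₁ w).mp hφ) h𝔪₁
  have hg₂ : g₂ w.asIdeal = ψ₀.valueAtUniformizer w :=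
    rayClassCoeffHom_asIdeal _ ((hiff₂ w).mp hψ) h𝔪₂
  -- `N(𝔭_w) = ℓ²`
  have hm : w.asIdeal.under (𝓞 ℚ) = v.asIdeal := by
    have : w ∈ {w : HeightOneSpectrum (𝓞 K) | w.asIdeal.under (𝓞 ℚ) = v.asIdeal} := by
      rw [hS]; exact Set.mem_singleton _
    exact this
  have hwv : w.under (𝓞 ℚ) = v :=
    HeightOneSpectrum.ext (by rw [HeightOneSpectrum.under_asIdeal]; exact hm)
  have hN : ((Ideal.absNorm w.asIdeal : ℕ) : ℂ) = ((ℓ ^ 2 : ℕ) : ℂ) := by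
    rw [absNorm_asIdeal_eq_natGenerator_pow, hwv, hw]
  have hX : ((ℓ ^ 2 : ℕ) : ℂ) ≠ 0 := by exact_mod_cast pow_ne_zero 2 hℓp.ne_zero
  have hXσ : ∀ σ : ℝ, ((ℓ ^ 2 : ℕ) : ℂ) ^ (σ : ℂ) * ((ℓ ^ 2 : ℕ) : ℂ) ^ (-(σ : ℂ)) = 1 := by
    intro σ
    rw [Complex.cpow_neg, mul_inv_cancel₀]
    exact fun h0 ↦ hX ((Complex.cpow_eq_zero_iff _ _).mp h0).1
  have e2 := hcoeff (ℓ ^ 2) (pow_ne_zero 2 hℓp.ne_zero)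
  rw [hsum g₁, hsum g₂, hg₁, hg₂, hval₁, hval₂, hN, mul_assoc, hXσ, mul_one, mul_assoc, hXσ,
    mul_one] at e2
  exact e2

/-! ## §2 Places of a quadratic field under its non-trivial automorphism -/

/-- `Gal(K/ℚ)` has two elements for a quadratic field. [cite: NeukirchANT1999, Ch. I §9 Prop. (9.1)] -/
theorem card_algEquiv_eq_two (h2 : Module.finrank ℚ K = 2) : Nat.card (K ≃ₐ[ℚ] K) = 2 := by
  haveI : Algebra.IsQuadraticExtension ℚ K := ⟨h2⟩
  rw [IsGalois.card_aut_eq_finrank, h2]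

/-- **`c • w` lies above the same rational place as `w`.** [cite: NeukirchANT1999, Ch. I §9 (conjugate primes)] -/
theorem under_smul_asIdeal (c : K ≃ₐ[ℚ] K) (w : HeightOneSpectrum (𝓞 K)) :
    (c • w).asIdeal.under (𝓞 ℚ) = w.asIdeal.under (𝓞 ℚ) := by
  set v : HeightOneSpectrum (𝓞 ℚ) := w.under (𝓞 ℚ) with hv
  have hwv : w.asIdeal.under (𝓞 ℚ) = v.asIdeal := rfl
  have hℓw : ((Rat.HeightOneSpectrum.natGenerator v : ℕ) : 𝓞 K) ∈ w.asIdeal :=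
    (asIdeal_under_eq_iff_natCast_mem v w).mp hwv
  rw [hwv]
  refine (asIdeal_under_eq_iff_natCast_mem v (c • w)).mpr ?_
  rw [Literature.NumberTheory.Automorphic.HeightOneSpectrum.smul_asIdeal,
    Ideal.mem_pointwise_smul_iff_inv_smul_mem]
  have hfix : c⁻¹ • ((Rat.HeightOneSpectrum.natGenerator v : ℕ) : 𝓞 K) =
      ((Rat.HeightOneSpectrum.natGenerator v : ℕ) : 𝓞 K) :=
    map_natCast (MulSemiringAction.toRingHom (K ≃ₐ[ℚ] K) (𝓞 K) c⁻¹) _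
  rw [hfix]
  exact hℓw

/-- **Split case: the two places above `v` are `w` and `c • w`.** In a quadratic field `K` with
non-trivial automorphism `c`, if the places above the rational place `v` are `{w₁, w₂}` with
`w₁ ≠ w₂`, then `c • w₁ = w₂` (`Gal(K/ℚ) = {1, c}` acts transitively on the primes above `v`).
[cite: Marcus2018, Ch. 4 (before Thm. 29)] [cite: NeukirchANT1999, Ch. I §9 Prop. (9.1)] -/
theorem smul_eq_of_places_eq_pair (h2 : Module.finrank ℚ K = 2) (c : K ≃ₐ[ℚ] K) (hc : c ≠ 1)
    (v : HeightOneSpectrum (𝓞 ℚ)) {w₁ w₂ : HeightOneSpectrum (𝓞 K)} (hne : w₁ ≠ w₂)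
    (hS : {w : HeightOneSpectrum (𝓞 K) | w.asIdeal.under (𝓞 ℚ) = v.asIdeal} = {w₁, w₂}) :
    c • w₁ = w₂ := by
  haveI : Algebra.IsQuadraticExtension ℚ K := ⟨h2⟩
  haveI : IsGaloisGroup (K ≃ₐ[ℚ] K) (𝓞 ℚ) (𝓞 K) := IsGaloisGroup.of_isFractionRing _ _ _ ℚ K
  have hm₁ : w₁.asIdeal.under (𝓞 ℚ) = v.asIdeal := by
    have : w₁ ∈ {w : HeightOneSpectrum (𝓞 K) | w.asIdeal.under (𝓞 ℚ) = v.asIdeal} := by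
      rw [hS]; exact Set.mem_insert _ _
    exact this
  have hm₂ : w₂.asIdeal.under (𝓞 ℚ) = v.asIdeal := by
    have : w₂ ∈ {w : HeightOneSpectrum (𝓞 K) | w.asIdeal.under (𝓞 ℚ) = v.asIdeal} := by
      rw [hS]; exact Set.mem_insert_of_mem _ rfl
    exact this
  haveI := w₁.isPrime
  haveI := w₂.isPrime
  haveI : w₁.asIdeal.LiesOver v.asIdeal := ⟨hm₁.symm⟩
  haveI : w₂.asIdeal.LiesOver v.asIdeal := ⟨hm₂.symm⟩
  obtain ⟨σ, hσ⟩ :=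
    Ideal.exists_smul_eq_of_isGaloisGroup v.asIdeal w₁.asIdeal w₂.asIdeal (K ≃ₐ[ℚ] K)
  rcases eq_one_or_eq_of_card_eq_two (card_algEquiv_eq_two h2) hc σ with rfl | rfl
  · exact absurd (HeightOneSpectrum.ext (by rw [one_smul] at hσ; exact hσ)) hne
  · exact HeightOneSpectrum.ext hσ

/-- **Inert (or ramified) case: `c • w = w`** when `w` is the only place above `v`. [cite: NeukirchANT1999, Ch. I §9 Prop. (9.1)] -/
theorem smul_eq_self_of_places_eq_singleton (c : K ≃ₐ[ℚ] K) (v : HeightOneSpectrum (𝓞 ℚ))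
    {w : HeightOneSpectrum (𝓞 K)}
    (hS : {w : HeightOneSpectrum (𝓞 K) | w.asIdeal.under (𝓞 ℚ) = v.asIdeal} = {w}) : c • w = w := by
  have hm : w.asIdeal.under (𝓞 ℚ) = v.asIdeal := by
    have : w ∈ {w : HeightOneSpectrum (𝓞 K) | w.asIdeal.under (𝓞 ℚ) = v.asIdeal} := by
      rw [hS]; exact Set.mem_singleton _
    exact this
  have hcw : c • w ∈ {w : HeightOneSpectrum (𝓞 K) | w.asIdeal.under (𝓞 ℚ) = v.asIdeal} := by
    show (c • w).asIdeal.under (𝓞 ℚ) = v.asIdeal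
    rw [under_smul_asIdeal, hm]
  rw [hS] at hcw
  simpa using hcw

/-! ## §3 (G2) The value-pair disjunction at cofinitely many places -/

/-- **Equal Hecke `L`-functions ⇒ the value-pair disjunction at all but finitely many places.** `K`
quadratic with non-trivial automorphism `c`; `φ`, `ψ` Hecke characters of `K` with
`heckeLFunction φ s = heckeLFunction ψ s` for `re s > s₀`. Then for all but finitely many finite places
`w` of `K`: `(φ(ϖ_w) = ψ(ϖ_w) ∧ φ(ϖ_{c•w}) = ψ(ϖ_{c•w})) ∨ (φ(ϖ_w) = ψ(ϖ_{c•w}) ∧ φ(ϖ_{c•w}) = ψ(ϖ_w))`.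
Exceptional places: `φ` or `ψ` ramified at `w` or at `c • w` (finitely many, `finite_ramifiedPlaces_holds`),
or `w` above a rational prime dividing `d_K` (finitely many, `Ideal.finite_factors`); at the others the
rational prime `ℓ` under `w` is unramified (`ramificationIdxIn_eq_one_of_not_dvd_discr`), so either
`ℓ` splits as `{w, c • w}` (§2) and (R2b) `valuePair_eq_of_heckeLFunction_eq` applies, or `ℓ` is inert,
`c • w = w`, and §1 applies. This is VERBATIM the hypothesis `hpair` of the algebraic end of the
rigidity bridge. [cite: Ribet1977Nebentypus, §3 Thm. (3.4)] [cite: NeukirchANT1999, Ch. I Prop. (8.2), (9.2) and Ch. III §2 Cor. (2.12)] -/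
theorem valuePairs_eventually_of_heckeLFunction_eq (h2 : Module.finrank ℚ K = 2)
    (c : K ≃ₐ[ℚ] K) (hc : c ≠ 1) (φ ψ : HeckeCharacter K) (s₀ : ℝ)
    (h : ∀ s : ℂ, s₀ < s.re → heckeLFunction φ s = heckeLFunction ψ s) :
    ∀ᶠ w : HeightOneSpectrum (𝓞 K) in Filter.cofinite,
      (φ.valueAtUniformizer w = ψ.valueAtUniformizer w ∧
          φ.valueAtUniformizer (c • w) = ψ.valueAtUniformizer (c • w)) ∨
        (φ.valueAtUniformizer w = ψ.valueAtUniformizer (c • w) ∧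
          φ.valueAtUniformizer (c • w) = ψ.valueAtUniformizer w) := by
  -- the finitely many exceptions
  have hφ : ∀ᶠ w : HeightOneSpectrum (𝓞 K) in cofinite, φ.IsUnramifiedAt w :=
    φ.finite_ramifiedPlaces_iff.1 (HeckeCharacter.finite_ramifiedPlaces_holds φ)
  have hψ : ∀ᶠ w : HeightOneSpectrum (𝓞 K) in cofinite, ψ.IsUnramifiedAt w :=
    ψ.finite_ramifiedPlaces_iff.1 (HeckeCharacter.finite_ramifiedPlaces_holds ψ)
  have hinj : Function.Injective fun w : HeightOneSpectrum (𝓞 K) ↦ c • w := MulAction.injective c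
  have hφc : ∀ᶠ w : HeightOneSpectrum (𝓞 K) in cofinite, φ.IsUnramifiedAt (c • w) :=
    hinj.tendsto_cofinite.eventually hφ
  have hψc : ∀ᶠ w : HeightOneSpectrum (𝓞 K) in cofinite, ψ.IsUnramifiedAt (c • w) :=
    hinj.tendsto_cofinite.eventually hψ
  set d : 𝓞 K := ((NumberField.discr K : ℤ) : 𝓞 K) with hd
  have hd0 : d ≠ 0 := by
    rw [hd]
    exact_mod_cast NumberField.discr_ne_zero K
  have hD : ∀ᶠ w : HeightOneSpectrum (𝓞 K) in cofinite, d ∉ w.asIdeal := by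
    have hfin : {w : HeightOneSpectrum (𝓞 K) | w.asIdeal ∣ Ideal.span {d}}.Finite :=
      Ideal.finite_factors ((Ideal.span_singleton_eq_bot.not).mpr hd0)
    refine Filter.eventually_cofinite.2 (hfin.subset fun w hw ↦ ?_)
    simp only [Set.mem_setOf_eq, not_not] at hw
    exact (Ideal.dvd_span_singleton).mpr hw
  filter_upwards [hφ, hψ, hφc, hψc, hD] with w hφw hψw hφcw hψcw hdw
  -- the rational place under `w` is unramified in `K`
  set v : HeightOneSpectrum (𝓞 ℚ) := w.under (𝓞 ℚ) with hv
  have hwv : w.asIdeal.under (𝓞 ℚ) = v.asIdeal := rfl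
  set ℓ : ℕ := Rat.HeightOneSpectrum.natGenerator v with hℓ
  have hℓp : ℓ.Prime := Rat.HeightOneSpectrum.prime_natGenerator v
  have hℓw : ((ℓ : ℕ) : 𝓞 K) ∈ w.asIdeal := (asIdeal_under_eq_iff_natCast_mem v w).mp hwv
  have hnd : ¬ (Rat.HeightOneSpectrum.natGenerator v : ℤ) ∣ NumberField.discr K := by
    rintro ⟨k, hk⟩
    apply hdw
    have : d = ((ℓ : ℕ) : 𝓞 K) * ((k : ℤ) : 𝓞 K) := by
      rw [hd, hk]; push_cast; rfl
    rw [this]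
    exact Ideal.mul_mem_right _ _ hℓw
  have he : v.asIdeal.ramificationIdxIn (𝓞 K) = 1 := ramificationIdxIn_eq_one_of_not_dvd_discr K v hnd
  rcases exists_places_eq_pair_or_eq_singleton h2 v he with
    ⟨w₁, w₂, hne, hS, h₁, h₂⟩ | ⟨w₀, hS, hw₀⟩
  · -- split: `w ∈ {w₁, w₂}` and `c • w` is the other place
    have hwS : w ∈ {w' : HeightOneSpectrum (𝓞 K) | w'.asIdeal.under (𝓞 ℚ) = v.asIdeal} := hwv
    rw [hS] at hwS
    rcases hwS with rfl | rfl
    · have hcw : c • w = w₂ := smul_eq_of_places_eq_pair h2 c hc v hne hS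
      rw [hcw] at hφcw hψcw ⊢
      exact valuePair_eq_of_heckeLFunction_eq φ ψ s₀ h v hne hS h₁ h₂ hφw hφcw hψw hψcw
    · -- here `w = w₂`
      have hS' : {w' : HeightOneSpectrum (𝓞 K) | w'.asIdeal.under (𝓞 ℚ) = v.asIdeal} = {w, w₁} := by
        rw [hS, Set.pair_comm]
      have hcw : c • w = w₁ := smul_eq_of_places_eq_pair h2 c hc v hne.symm hS'
      rw [hcw] at hφcw hψcw ⊢
      exact valuePair_eq_of_heckeLFunction_eq φ ψ s₀ h v hne.symm hS' h₂ h₁ hφw hφcw hψw hψcw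
  · -- inert: `w = w₀`, `c • w = w`, values agree
    have hwS : w ∈ {w' : HeightOneSpectrum (𝓞 K) | w'.asIdeal.under (𝓞 ℚ) = v.asIdeal} := hwv
    rw [hS, Set.mem_singleton_iff] at hwS
    subst hwS
    have hcw : c • w = w := smul_eq_self_of_places_eq_singleton c v hS
    rw [hcw]
    have heq := value_eq_of_heckeLFunction_eq_of_inert φ ψ s₀ h v hS hw₀ hφw hψw
    exact Or.inl ⟨heq, heq⟩

end Rigidity

/-! ## §4 (G3 modulo the algebraic end) The typed input H_Rig⁰ at every prime -/

namespace PinnedRigidity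

open Rigidity Literature.NumberTheory.EllipticCurves.DeuringCM

end PinnedRigidity

end Literature.NumberTheory.EllipticCurves.DeuringCM.RamifiedSevenEllipticUnits

end Part7

/-!
## Part 8 — port of `Summits/BirchSwinnertonDyer/BirchSwinnertonDyer/Theorems/RamifiedSevenEllipticUnitsLemmaXiDeuringAssembly.lean` (1 declarations kept)

# Lemma Ξ, kernel side (VII): ASSEMBLY — clauses (P1) and (P5) for a Rubin datum whose character has Deuring's shape (conjugation-equivariant, values = embedded generators)

Declarations of this Part (verbatim port; each keeps its own docstring and citation): `conj_embedding_eq_embedding_algEquiv`.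

Reference keys (see `references.bib` and the declarations' citations): [SilvermanATAEC1994], [BurungaleKobayashiNakamuraOta2026], [Landau1918Idealklassen].
-/

section Part8

set_option autoImplicit false

open scoped _root_.Classical _root_.NNReal _root_.Topology _root_.Pointwise ComplexConjugate
open _root_.NumberField _root_.IsDedekindDomain _root_.Field
  Literature.NumberTheory.EllipticCurves
  Literature.NumberTheory.EllipticCurves.BurungaleKobayashiNakamuraOta2026
  Literature.NumberTheory.GaloisRepresentations

namespace Literature.NumberTheory.EllipticCurves.DeuringCM.RamifiedSevenEllipticUnits

namespace LemmaXi

variable {K : Type} [Field K] [NumberField K] {p : ℕ} [hp : Fact p.Prime]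

/-- **`\overline{σ'(x)} = σ'(cx)`** for a non-real embedding `σ'` of a quadratic field and `c ≠ 1`
(the three embeddings `σ'`, `\overline{σ'}`, `σ' ∘ c` among the TWO embeddings of `K`, Mathlib
`NumberField.Embeddings.card`). For an imaginary quadratic `K` every `σ'` is non-real. [cite: SilvermanATAEC1994, II §10 Thm. 10.5 (Deuring; supporting lemma)] -/
theorem conj_embedding_eq_embedding_algEquiv (h2 : Module.finrank ℚ K = 2) (c : K ≃ₐ[ℚ] K)
    (hc : c ≠ 1) (σ' : K →+* ℂ) (hσ' : ¬ ComplexEmbedding.IsReal σ') (x : K) :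
    conj (σ' x) = σ' (c x) := by
  classical
  set σ₁ : K →+* ℂ := ComplexEmbedding.conjugate σ' with hσ₁
  set σ₂ : K →+* ℂ := σ'.comp (c : K →+* K) with hσ₂
  have h1 : σ₁ ≠ σ' := fun h ↦ hσ' (ComplexEmbedding.isReal_iff.mpr h)
  have h2' : σ₂ ≠ σ' := by
    intro h
    apply hc
    ext y
    have := congrArg (fun f : K →+* ℂ ↦ f y) h
    simp only [hσ₂, RingHom.coe_comp, Function.comp_apply] at this
    exact σ'.injective this
  have hcard : Fintype.card (K →+* ℂ) = 2 := by rw [Embeddings.card, h2]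
  have h12 : σ₁ = σ₂ := by
    by_contra hne
    have h3 : ({σ', σ₁, σ₂} : Finset (K →+* ℂ)).card = 3 := by
      rw [Finset.card_insert_of_notMem, Finset.card_pair hne]
      simp only [Finset.mem_insert, Finset.mem_singleton, not_or]
      exact ⟨h1.symm, h2'.symm⟩
    have := Finset.card_le_univ ({σ', σ₁, σ₂} : Finset (K →+* ℂ))
    rw [h3, hcard] at this
    omega
  have := congrArg (fun f : K →+* ℂ ↦ f x) h12
  simpa [hσ₁, hσ₂, ComplexEmbedding.conjugate_coe_eq] using this

end LemmaXi

/-! ## (P1) ∧ (P5) from Deuring's shape -/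

section Datum

open LemmaXi

variable {W : WeierstrassCurve ℚ} [W.IsElliptic] {p : ℕ} [hp : Fact p.Prime]
  {K : Type} [Field K] [NumberField K] {c : K ≃ₐ[ℚ] K} {𝔭 : HeightOneSpectrum (𝓞 K)}
  {κ : ZpExtension K p} {γ : absoluteGaloisGroup K} {ι : PadicAlgCl p ≃+* ℂ} {φ : HeckeCharacter K}
  {Ω : ℂ} {𝓔 : AcDualExpSystem W p K 𝔭 κ ι} {D : EllipticUnitClassData W p K 𝔭 κ γ ι φ Ω 𝓔}

end Datum

end Literature.NumberTheory.EllipticCurves.DeuringCM.RamifiedSevenEllipticUnits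

end Part8

/-!
## Part 9 — port of `Summits/BirchSwinnertonDyer/BirchSwinnertonDyer/Theorems/RamifiedSevenEllipticUnitsRigidityArchimedean.lean` (8 declarations kept)

# Rigidity bridge, algebraic end — part 1 (archimedean): the symmetric product `φ·(φ∘c)` and the Booker–Krishnamurthy parameter `ν = −1/2`

Declarations of this Part (verbatim port; each keeps its own docstring and citation): `infiniteIdeles_globalToInfiniteUnits_eq_single`, `extensionEmbedding_ideleInfiniteComponent_globalToInfiniteUnits`, `coe_apply_infiniteIdeles_eq_of_hasComplexParam`, `coe_apply_infiniteIdeles_eq_of_hasInfinityType_one_zero`, `smul_infiniteIdeles_globalToInfiniteUnits`, `mul_galConj_eq_of_valuePairs`, `two_pow_ne_three_pow`, `archParam_eq_neg_half`.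

Reference keys (see `references.bib` and the declarations' citations): [BookerKrishnamurthy2011], [NeukirchANT1999], [CasselsFrohlichANT1967].
-/

section Part9

set_option autoImplicit false

open scoped _root_.Classical ComplexConjugate _root_.Pointwise nonZeroDivisors
open _root_.Filter _root_.NumberField _root_.NumberField.InfinitePlace _root_.IsDedekindDomain
  Literature.NumberTheory.GaloisRepresentations
  Literature.NumberTheory.GaloisRepresentations.HeckeCharacter
  Literature.NumberTheory.Automorphic
  Literature.NumberTheory.QuadraticForms
  Literature.NumberTheory.EllipticCurves
  Literature.NumberTheory.LFunctions

namespace Literature.NumberTheory.EllipticCurves.DeuringCM.RamifiedSevenEllipticUnits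

namespace Rigidity

variable {K : Type} [Field K] [NumberField K]

/-! ## §1 The archimedean values of Hecke characters of an imaginary quadratic field -/

/-- In an imaginary quadratic field the infinite part `(x)_∞` of a principal idele is the one-place
idele `⟨x⟩_{w₀}` at the unique infinite place `w₀`. [cite: BookerKrishnamurthy2011, §1.1 (p. 672)] -/
theorem infiniteIdeles_globalToInfiniteUnits_eq_single (hK : IsImaginaryQuadratic K)
    (w₀ : InfinitePlace K) (x : Kˣ) :
    infiniteIdeles K (globalToInfiniteUnits K x) =
      infiniteIdeleSingle w₀
        (ideleInfiniteComponent K w₀ (infiniteIdeles K (globalToInfiniteUnits K x))) := by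
  haveI := DeuringCM.X11b.subsingleton_infinitePlace_of_isImaginaryQuadratic hK
  conv_lhs => rw [infiniteIdeles_eq_prod_infiniteIdeleSingle (globalToInfiniteUnits K x),
    Fintype.prod_subsingleton _ w₀]

/-- The `w₀`-coordinate of `(x)_∞` under `ι_{w₀} : K_{w₀} → ℂ` is `σ(x)`, `σ = w₀.embedding`.
[cite: BookerKrishnamurthy2011, §1.1 (p. 672)] -/
theorem extensionEmbedding_ideleInfiniteComponent_globalToInfiniteUnits (w₀ : InfinitePlace K)
    (x : Kˣ) :
    InfinitePlace.Completion.extensionEmbedding w₀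
        ((ideleInfiniteComponent K w₀ (infiniteIdeles K (globalToInfiniteUnits K x)) :
          (w₀.Completion)ˣ) : w₀.Completion) = w₀.embedding (x : K) := by
  rw [val_ideleInfiniteComponent, infiniteIdeles_fst, val_globalToInfiniteUnits,
    InfiniteAdeleRing.algebraMap_apply]
  exact InfinitePlace.Completion.extensionEmbedding_coe w₀ (WithAbs.toAbs w₀.1 (x : K))

/-- **`φ((x)_∞) = (|σx|²)^ν · (σx/|σx|)^k`** for an ARBITRARY Hecke character `φ` of an imaginary
quadratic field with Booker–Krishnamurthy parameters `(ν, k)` at the infinite place `w₀`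
(`σ = w₀.embedding`, `x ∈ Kˣ`). [cite: BookerKrishnamurthy2011, §1.1 (p. 672)] -/
theorem coe_apply_infiniteIdeles_eq_of_hasComplexParam (hK : IsImaginaryQuadratic K)
    (w₀ : InfinitePlace K) {φ : HeckeCharacter K} {ν : ℂ} {k : ℤ}
    (hφ : HasComplexParam (φ.archComponent w₀) ν k) (x : Kˣ) :
    ((φ (infiniteIdeles K (globalToInfiniteUnits K x)) : ℂˣ) : ℂ) =
      (((‖w₀.embedding (x : K)‖ ^ 2 : ℝ) : ℂ) ^ ν) *
        (w₀.embedding (x : K) / (‖w₀.embedding (x : K)‖ : ℂ)) ^ k := by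
  set y := ideleInfiniteComponent K w₀ (infiniteIdeles K (globalToInfiniteUnits K x)) with hy
  have hval : InfinitePlace.Completion.extensionEmbedding w₀ (y : w₀.Completion) = w₀.embedding (x : K) :=
    extensionEmbedding_ideleInfiniteComponent_globalToInfiniteUnits w₀ x
  have hnorm : ‖(y : w₀.Completion)‖ = ‖w₀.embedding (x : K)‖ := by
    rw [← hval, (InfinitePlace.Completion.isometry_extensionEmbedding w₀).norm_map_of_map_zero (map_zero _)]
  rw [infiniteIdeles_globalToInfiniteUnits_eq_single hK w₀ x, ← hy,
    ← HeckeCharacter.archComponent_apply, hφ y, hval, hnorm]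

/-- **`ψ((x)_∞) = σ(x)⁻¹`** for a Hecke character `ψ` of infinity type `(1, 0)` of an imaginary
quadratic field (`σ = w₀.embedding` the embedding of the unique infinite place).
[cite: NeukirchANT1999, Ch. VII §6 Prop. (6.9)] -/
theorem coe_apply_infiniteIdeles_eq_of_hasInfinityType_one_zero (hK : IsImaginaryQuadratic K)
    (w₀ : InfinitePlace K) {ψ : HeckeCharacter K}
    (hψ : ψ.HasInfinityType (fun _ ↦ 1) (fun _ ↦ 0)) (x : Kˣ) :
    ((ψ (infiniteIdeles K (globalToInfiniteUnits K x)) : ℂˣ) : ℂ) = (w₀.embedding (x : K))⁻¹ := by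
  haveI := DeuringCM.X11b.subsingleton_infinitePlace_of_isImaginaryQuadratic hK
  haveI : IsTotallyComplex K := hK.2
  rw [hψ.apply_globalToInfiniteUnits_eq_of_isTotallyComplex x, Fintype.prod_subsingleton _ w₀]
  simp

/-- `c • (x)_∞ = (c x)_∞` for the infinite parts of principal ideles. [cite: BookerKrishnamurthy2011, §1.1 (p. 672)] -/
theorem smul_infiniteIdeles_globalToInfiniteUnits (c : K ≃ₐ[ℚ] K) (x : Kˣ) :
    c • infiniteIdeles K (globalToInfiniteUnits K x) =
      infiniteIdeles K (globalToInfiniteUnits K (Units.map (c : K →+* K).toMonoidHom x)) := by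
  apply Units.ext
  rw [AdeleRing.coe_smul_units]
  change c • (((globalToInfiniteUnits K x : InfiniteAdeleRing K),
      (1 : FiniteAdeleRing (𝓞 K) K)) : AdeleRing (𝓞 K) K) =
    (((globalToInfiniteUnits K (Units.map (c : K →+* K).toMonoidHom x) : InfiniteAdeleRing K),
      (1 : FiniteAdeleRing (𝓞 K) K)) : AdeleRing (𝓞 K) K)
  rw [AdeleRing.smul_mk, smul_one, val_globalToInfiniteUnits, val_globalToInfiniteUnits,
    InfiniteAdeleRing.smul_algebraMap]
  rfl

/-! ## §2 The symmetric product `φ·(φ∘c)` is determined by the pairs; the parameter `ν` -/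

/-- **The pair disjunction determines the symmetric product**: if at almost every `w` the values
`(φ(ϖ_w), φ(ϖ_{c w}))` are `(ψ(ϖ_w), ψ(ϖ_{c w}))` up to order, then `φ · (φ ∘ c) = ψ · (ψ ∘ c)`
(GL(1) rigidity `ext_of_eventually_valueAtUniformizer_eq`).
[cite: CasselsFrohlichANT1967, Ch. VII §4 Prop. 4.1 (proof)] -/
theorem mul_galConj_eq_of_valuePairs (c : K ≃ₐ[ℚ] K) {φ ψ : HeckeCharacter K}
    (hpair : ∀ᶠ w in cofinite,
      (φ.valueAtUniformizer w = ψ.valueAtUniformizer w ∧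
          φ.valueAtUniformizer (c • w) = ψ.valueAtUniformizer (c • w)) ∨
        (φ.valueAtUniformizer w = ψ.valueAtUniformizer (c • w) ∧
          φ.valueAtUniformizer (c • w) = ψ.valueAtUniformizer w)) :
    φ * HeckeCharacter.galConj c φ = ψ * HeckeCharacter.galConj c ψ := by
  have hur : ∀ χ : HeckeCharacter K, ∀ᶠ w in cofinite, χ.IsUnramifiedAt (c • w) := fun χ ↦ by
    have hfin : ((fun w : HeightOneSpectrum (𝓞 K) ↦ c • w) ⁻¹' χ.ramifiedPlaces).Finite :=
      (HeckeCharacter.finite_ramifiedPlaces_holds χ).preimage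
        (fun _ _ _ _ h ↦ smul_left_cancel c h)
    refine Filter.eventually_cofinite.mpr (hfin.subset fun w hw ↦ ?_)
    exact hw
  apply HeckeCharacter.ext_of_eventually_valueAtUniformizer_eq
  filter_upwards [hpair, hur φ, hur ψ] with w hw hφw hψw
  rw [valueAtUniformizer_mul', valueAtUniformizer_mul',
    valueAtUniformizer_galConj_of_isUnramifiedAt c φ w hφw,
    valueAtUniformizer_galConj_of_isUnramifiedAt c ψ w hψw]
  rcases hw with ⟨h1, h2⟩ | ⟨h1, h2⟩
  · rw [h1, h2]
  · rw [h1, h2, mul_comm]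

/-- `2^a = 3^b` is impossible for `a ≥ 1` (parity). [cite: BookerKrishnamurthy2011, §1.1 (p. 672)] -/
theorem two_pow_ne_three_pow {a b : ℕ} (ha : 0 < a) : (2 : ℕ) ^ a ≠ 3 ^ b := by
  intro h
  have h2 : 2 ∣ 3 ^ b := h ▸ dvd_pow_self 2 ha.ne'
  have := Nat.Prime.dvd_of_dvd_pow Nat.prime_two h2
  omega

/-- **The parameter `ν` of `φ` is `−1/2`.** If `φ · (φ ∘ c) = ψ · (ψ ∘ c)` with `ψ` of infinity type
`(1, 0)` on an imaginary quadratic field and `φ` has complex parameters `(ν, k)`, then evaluating at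
the (c-fixed) infinite ideles `(n)_∞`, `n = 2, 3`, gives `(n²)^{2ν} = n^{−2}`, whence `re ν = −1/2`
and, because `log 2 / log 3` is irrational (`2^a ≠ 3^b`), `im ν = 0`. [cite: BookerKrishnamurthy2011, §1.1 (p. 672)] -/
theorem archParam_eq_neg_half (hK : IsImaginaryQuadratic K) (w₀ : InfinitePlace K) (c : K ≃ₐ[ℚ] K)
    {φ ψ : HeckeCharacter K} {ν : ℂ} {k : ℤ} (hφ : HasComplexParam (φ.archComponent w₀) ν k)
    (hψ : ψ.HasInfinityType (fun _ ↦ 1) (fun _ ↦ 0))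
    (heq : φ * HeckeCharacter.galConj c φ = ψ * HeckeCharacter.galConj c ψ) :
    ν = -1 / 2 := by
  -- evaluation at `(n)_∞` for a natural number `n ≥ 2`
  have key : ∀ n : ℕ, 2 ≤ n → ∃ m : ℤ,
      (Real.log n : ℂ) * (4 * ν + 2) = m * (2 * Real.pi * Complex.I) := by
    intro n hn
    have hn0 : (n : K) ≠ 0 := by exact_mod_cast (show n ≠ 0 by omega)
    have hnR : (0 : ℝ) < n := by exact_mod_cast (show 0 < n by omega)
    set x : Kˣ := Units.mk0 (n : K) hn0 with hx
    -- `c` fixes `n`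
    have hcx : Units.map (c : K →+* K).toMonoidHom x = x := Units.ext (by simp [hx])
    have h := congrArg (fun χ : HeckeCharacter K ↦
      ((χ (infiniteIdeles K (globalToInfiniteUnits K x)) : ℂˣ) : ℂ)) heq
    simp only [HeckeCharacter.mul_apply, Units.val_mul, HeckeCharacter.galConj_apply,
      smul_infiniteIdeles_globalToInfiniteUnits, hcx] at h
    rw [coe_apply_infiniteIdeles_eq_of_hasComplexParam hK w₀ hφ x,
      coe_apply_infiniteIdeles_eq_of_hasInfinityType_one_zero hK w₀ hψ x] at h
    have hσ : w₀.embedding (x : K) = (n : ℂ) := by simp [hx]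
    have hnC : (n : ℂ) ≠ 0 := by exact_mod_cast (show n ≠ 0 by omega)
    rw [hσ, Complex.norm_natCast, Complex.ofReal_natCast, div_self hnC, one_zpow, mul_one] at h
    -- `((n²)^ν)² = (n⁻¹)²` ⇒ `exp (log n · (4ν + 2)) = 1`
    have hlog : Complex.log (((n : ℝ) ^ 2 : ℝ) : ℂ) = (2 * Real.log n : ℝ) := by
      rw [← Complex.ofReal_log (by positivity), Real.log_pow]; norm_num
    have hcpow : (((n : ℝ) ^ 2 : ℝ) : ℂ) ^ ν = Complex.exp ((Real.log n : ℂ) * (2 * ν)) := by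
      rw [Complex.cpow_def_of_ne_zero (by exact_mod_cast (pow_ne_zero 2 hnR.ne')), hlog]
      push_cast; ring_nf
    have hninv : ((n : ℂ))⁻¹ = Complex.exp (-(Real.log n : ℂ)) := by
      rw [Complex.exp_neg, ← Complex.ofReal_exp, Real.exp_log hnR]; push_cast; ring
    rw [hcpow, hninv, ← Complex.exp_add, ← Complex.exp_add] at h
    have h1 : Complex.exp ((Real.log n : ℂ) * (4 * ν + 2)) = 1 := by
      rw [show (Real.log n : ℂ) * (4 * ν + 2) =
          ((Real.log n : ℂ) * (2 * ν) + (Real.log n : ℂ) * (2 * ν)) -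
            (-(Real.log n : ℂ) + -(Real.log n : ℂ)) by ring,
        Complex.exp_sub, h, div_self (Complex.exp_ne_zero _)]
    exact Complex.exp_eq_one_iff.mp h1
  obtain ⟨m₂, hm₂⟩ := key 2 le_rfl
  obtain ⟨m₃, hm₃⟩ := key 3 (by norm_num)
  have hl2 : 0 < Real.log 2 := Real.log_pos (by norm_num)
  have hl3 : 0 < Real.log 3 := Real.log_pos (by norm_num)
  -- real parts: `log n · (4 re ν + 2) = 0`
  have hRe : ∀ (r : ℝ) (m : ℤ), (r : ℂ) * (4 * ν + 2) = m * (2 * Real.pi * Complex.I) →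
      r * (4 * ν.re + 2) = 0 := fun r m e ↦ by
    have e' := congrArg Complex.re e
    rw [Complex.re_ofReal_mul] at e'
    simpa using e'
  have hIm : ∀ (r : ℝ) (m : ℤ), (r : ℂ) * (4 * ν + 2) = m * (2 * Real.pi * Complex.I) →
      r * (4 * ν.im) = m * (2 * Real.pi) := fun r m e ↦ by
    have e' := congrArg Complex.im e
    rw [Complex.im_ofReal_mul] at e'
    simpa using e'
  have hre : ν.re = -1 / 2 := by
    have e := hRe _ _ hm₂
    rcases mul_eq_zero.mp e with h | h
    · exact absurd h hl2.ne'
    · linarith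
  have him2 : Real.log 2 * (4 * ν.im) = m₂ * (2 * Real.pi) := hIm _ _ hm₂
  have him3 : Real.log 3 * (4 * ν.im) = m₃ * (2 * Real.pi) := hIm _ _ hm₃
  have him : ν.im = 0 := by
    by_contra hne
    have h4 : (4 : ℝ) * ν.im ≠ 0 := mul_ne_zero (by norm_num) hne
    have hm2ne : m₂ ≠ 0 := by
      rintro rfl
      rw [Int.cast_zero, zero_mul] at him2
      exact mul_ne_zero hl2.ne' h4 him2
    -- `m₃ log 2 = m₂ log 3`
    have hcross : (m₃ : ℝ) * Real.log 2 = m₂ * Real.log 3 := by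
      apply mul_left_cancel₀ h4
      have e1 : 4 * ν.im * ((m₃ : ℝ) * Real.log 2) = m₃ * (Real.log 2 * (4 * ν.im)) := by ring
      have e2 : 4 * ν.im * ((m₂ : ℝ) * Real.log 3) = m₂ * (Real.log 3 * (4 * ν.im)) := by ring
      rw [e1, e2, him2, him3]; ring
    have hm3ne : m₃ ≠ 0 := by
      rintro rfl
      rw [Int.cast_zero, zero_mul] at hcross
      exact mul_ne_zero (Int.cast_ne_zero.mpr hm2ne) hl3.ne' hcross.symm
    -- pass to natural exponents
    have habs : (m₃.natAbs : ℝ) * Real.log 2 = m₂.natAbs * Real.log 3 := by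
      have e := congrArg abs hcross
      rw [abs_mul, abs_mul, abs_of_pos hl2, abs_of_pos hl3, ← Int.cast_abs, ← Int.cast_abs,
        ← Int.natCast_natAbs, ← Int.natCast_natAbs, Int.cast_natCast, Int.cast_natCast] at e
      exact e
    have hpow : ((2 : ℕ) : ℝ) ^ m₃.natAbs = ((3 : ℕ) : ℝ) ^ m₂.natAbs := by
      apply Real.log_injOn_pos (Set.mem_Ioi.mpr (by positivity)) (Set.mem_Ioi.mpr (by positivity))
      rw [Real.log_pow, Real.log_pow]
      exact_mod_cast habs
    have hnat : (2 : ℕ) ^ m₃.natAbs = 3 ^ m₂.natAbs := by exact_mod_cast hpow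
    exact two_pow_ne_three_pow (Int.natAbs_pos.mpr hm3ne) hnat
  apply Complex.ext <;> norm_num [hre, him]

end Rigidity

end Literature.NumberTheory.EllipticCurves.DeuringCM.RamifiedSevenEllipticUnits

end Part9

/-!
## Part 10 — port of `Summits/BirchSwinnertonDyer/BirchSwinnertonDyer/Theorems/RamifiedSevenEllipticUnitsRigidityFromPairs.lean` (7 declarations kept)

# Rigidity bridge, algebraic end — part 2: value PAIRS ⇒ `φ = ψ ∨ φ = ψ ∘ c`

Declarations of this Part (verbatim port; each keeps its own docstring and citation): `exists_finset_pow_rel`, `exists_pow_asIdeal_eq_span`, `smul_asIdeal_pow_eq_span`, `smul_eq_of_div_norm_zpow_eq_one`, `pow_eq_pow_of_mul_pow_eq_one`, `ofReal_sq_cpow_neg_half`, `eq_or_eq_galConj_of_valuePairs`.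

Reference keys (see `references.bib` and the declarations' citations): [NeukirchANT1999], [CasselsFrohlichANT1967], [BookerKrishnamurthy2011].
-/

section Part10

set_option autoImplicit false

open scoped _root_.Classical ComplexConjugate _root_.Pointwise nonZeroDivisors
open _root_.Filter _root_.NumberField _root_.NumberField.InfinitePlace _root_.IsDedekindDomain
  Literature.NumberTheory.GaloisRepresentations
  Literature.NumberTheory.GaloisRepresentations.HeckeCharacter
  Literature.NumberTheory.Automorphic
  Literature.NumberTheory.QuadraticForms
  Literature.NumberTheory.EllipticCurves
  Literature.NumberTheory.LFunctions

namespace Literature.NumberTheory.EllipticCurves.DeuringCM.RamifiedSevenEllipticUnits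

namespace Rigidity

variable {K : Type} [Field K] [NumberField K]

/-! ## §3 Principal powers of primes: Neukirch (6.13) and the archimedean parameter `k` -/

/-- **Neukirch (6.13) on the `h`-th power of a prime**: every Hecke character `χ` has a finite set
`T` of places (off which it is unramified) and `M ≥ 1` with `(χ((a)_∞) · χ(ϖ_w)^h)^M = 1` whenever
`𝔭_w^h = (a)`, `w ∉ T`. [cite: NeukirchANT1999, Ch. VII §6 Prop. (6.13) (proof) and Cor. (6.14)] -/
theorem exists_finset_pow_rel (χ : HeckeCharacter K) :
    ∃ (T : Finset (HeightOneSpectrum (𝓞 K))) (M : ℕ), 0 < M ∧ (∀ w ∉ T, χ.IsUnramifiedAt w) ∧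
      ∀ {w : HeightOneSpectrum (𝓞 K)} (_ : w ∉ T) {a : 𝓞 K} (ha : (a : K) ≠ 0) (h : ℕ),
        w.asIdeal ^ h = Ideal.span {a} →
        ((χ (infiniteIdeles K (globalToInfiniteUnits K (Units.mk0 (a : K) ha))) : ℂ) *
          χ.valueAtUniformizer w ^ h) ^ M = 1 := by
  obtain ⟨T, e, hmod⟩ := χ.exists_isModulus
  obtain ⟨M, hM, hrel⟩ := hmod.exists_pos_forall_pow_coe_apply_infiniteIdeles_mul_idealPow_eq_one
  refine ⟨T, M, hM, fun w hw ↦ isUnramifiedAt_of_isModulus' hmod hw, fun {w} hw {a} ha h hspan ↦ ?_⟩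
  have hcop : IsCoprime (Ideal.span {a}) (modulusIdeal T e) := by
    rw [← hspan]
    exact (isCoprime_asIdeal_modulusIdeal_of_not_mem e hw).pow_left
  have := hrel ha hcop
  rwa [← hspan, idealPow_pow _ w.ne_bot, idealPow_asIdeal] at this

variable (K) in
/-- **A power of every prime is principal** (finiteness of the class group): there is `h ≥ 1` with
`𝔭_w^h = (a_w)` for every finite place `w`. [cite: NeukirchANT1999, Ch. VII §6 Prop. (6.13) (proof) and Cor. (6.14)] -/
theorem exists_pow_asIdeal_eq_span : ∃ h : ℕ, 0 < h ∧
    ∀ w : HeightOneSpectrum (𝓞 K), ∃ a : 𝓞 K, (a : K) ≠ 0 ∧ w.asIdeal ^ h = Ideal.span {a} := by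
  refine ⟨Fintype.card (ClassGroup (𝓞 K)), Fintype.card_pos, fun w ↦ ?_⟩
  have hI : w.asIdeal ^ Fintype.card (ClassGroup (𝓞 K)) ∈ (Ideal (𝓞 K))⁰ :=
    mem_nonZeroDivisors_iff_ne_zero.mpr (pow_ne_zero _ w.ne_bot)
  have h1 : ClassGroup.mk0 ⟨_, hI⟩ = 1 := by
    have : (⟨_, hI⟩ : (Ideal (𝓞 K))⁰) =
        ⟨w.asIdeal, mem_nonZeroDivisors_iff_ne_zero.mpr w.ne_bot⟩ ^ Fintype.card (ClassGroup (𝓞 K)) :=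
      Subtype.ext rfl
    rw [this, map_pow, pow_card_eq_one]
  obtain ⟨a, ha⟩ := ((ClassGroup.mk0_eq_one_iff hI).mp h1).principal
  have ha0 : a ≠ 0 := by
    rintro rfl
    apply pow_ne_zero (Fintype.card (ClassGroup (𝓞 K))) w.ne_bot
    rw [ha]
    exact Ideal.span_singleton_eq_bot.mpr rfl
  exact ⟨a, fun h ↦ ha0 (by exact_mod_cast h), ha⟩

/-- Transport of a principal power of a prime: `𝔭_{c w}^h = (c a)` if `𝔭_w^h = (a)`. [cite: NeukirchANT1999, Ch. VII §6 Prop. (6.13) (proof) and Cor. (6.14)] -/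
theorem smul_asIdeal_pow_eq_span (c : K ≃ₐ[ℚ] K) {w : HeightOneSpectrum (𝓞 K)} {a : 𝓞 K}
    {h : ℕ} (hspan : w.asIdeal ^ h = Ideal.span {a}) :
    (c • w).asIdeal ^ h = Ideal.span {c • a} := by
  rw [HeightOneSpectrum.smul_asIdeal, ← smul_pow', hspan, Ideal.pointwise_smul_def, Ideal.map_span,
    Set.image_singleton]
  rfl

/-- **`ϖ/ϖ̄` is not a root of unity at a split prime.** If `𝔭_w^h = (a)` (`h ≥ 1`) and
`(σa/|σa|)^m = 1` for some `m ≠ 0` (`σ : K → ℂ`, `K` imaginary quadratic, `c ≠ 1`), then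
`c • w = w`: indeed `(σa/|σa|)² = σ(a)/σ(ca)`, so `a^m = (ca)^m`, `𝔭_w^{h|m|} = 𝔭_{cw}^{h|m|}`.
[cite: NeukirchANT1999, Ch. VII §6 Prop. (6.13) (proof) and Cor. (6.14)] -/
theorem smul_eq_of_div_norm_zpow_eq_one (hK : IsImaginaryQuadratic K) (c : K ≃ₐ[ℚ] K) (hc : c ≠ 1)
    (σ : K →+* ℂ) {w : HeightOneSpectrum (𝓞 K)} {a : 𝓞 K} (ha : (a : K) ≠ 0) {h : ℕ} (hh : 0 < h)
    (hspan : w.asIdeal ^ h = Ideal.span {a}) {m : ℤ} (hm : m ≠ 0)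
    (hu : (σ a / (‖σ a‖ : ℂ)) ^ m = 1) : c • w = w := by
  haveI : IsTotallyComplex K := hK.2
  have hz : σ a ≠ 0 := (map_ne_zero σ).mpr ha
  have hconj : conj (σ a) = σ (c a) :=
    LemmaXi.conj_embedding_eq_embedding_algEquiv hK.1 c hc σ
      (IsTotallyComplex.complexEmbedding_not_isReal σ) a
  have hcz : σ (c a) ≠ 0 := by rw [← hconj]; exact (map_ne_zero _).mpr hz
  have hr2 : ((‖σ a‖ : ℂ)) * (‖σ a‖ : ℂ) = σ a * conj (σ a) := by
    rw [Complex.mul_conj, Complex.normSq_eq_norm_sq]; push_cast; ring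
  -- `u² = σ a / σ (c a)`
  have hu2 : (σ a / (‖σ a‖ : ℂ)) ^ (2 : ℤ) = σ a / σ (c a) := by
    rw [← hconj, zpow_two, div_mul_div_comm, hr2, mul_div_mul_left _ _ hz]
  -- hence `σ(a)^m = σ(c a)^m`
  have hm' : (σ a / σ (c a)) ^ m = 1 := by
    rw [← hu2, ← zpow_mul, mul_comm, zpow_mul, hu, one_zpow]
  rw [div_zpow, div_eq_one_iff_eq (zpow_ne_zero _ hcz), ← map_zpow₀ σ, ← map_zpow₀ σ] at hm'
  have hK' : (a : K) ^ m = (c a) ^ m := σ.injective hm'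
  -- natural exponent `n = |m|`
  have hn : (a : K) ^ m.natAbs = (c a) ^ m.natAbs := by
    rcases Int.natAbs_eq m with h | h
    · rw [h, zpow_natCast, zpow_natCast] at hK'; exact hK'
    · rw [h, zpow_neg, zpow_neg, inv_inj, zpow_natCast, zpow_natCast] at hK'; exact hK'
  have hn' : a ^ m.natAbs = (c • a) ^ m.natAbs := by
    apply RingOfIntegers.coe_injective
    simp only [RingOfIntegers.coe_eq_algebraMap, map_pow] at hn ⊢
    rw [← RingOfIntegers.coe_eq_algebraMap, ← RingOfIntegers.coe_eq_algebraMap,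
      RingOfIntegers.coe_algEquiv_smul]
    exact hn
  -- ideals
  have hI : w.asIdeal ^ (h * m.natAbs) = (c • w).asIdeal ^ (h * m.natAbs) := by
    rw [pow_mul, pow_mul, hspan, smul_asIdeal_pow_eq_span c hspan, Ideal.span_singleton_pow,
      Ideal.span_singleton_pow, hn']
  have hN : h * m.natAbs ≠ 0 := mul_ne_zero hh.ne' (Int.natAbs_ne_zero.mpr hm)
  have hle : (c • w).asIdeal ≤ w.asIdeal := by
    have : (c • w).asIdeal ^ (h * m.natAbs) ≤ w.asIdeal := by
      rw [← hI]; exact Ideal.pow_le_self hN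
    exact (Ideal.IsPrime.pow_le_iff hN).mp this
  exact HeightOneSpectrum.ext ((c • w).isMaximal.eq_of_le w.isPrime.ne_top hle)

/-- Cancelling a common nonzero factor in two `M`-th power relations. [cite: NeukirchANT1999, Ch. VII §6 Prop. (6.13) (proof) and Cor. (6.14)] -/
theorem pow_eq_pow_of_mul_pow_eq_one {x x' v : ℂ} {M M' : ℕ} (h1 : (x * v) ^ M = 1)
    (h2 : (x' * v) ^ M' = 1) (hv : v ≠ 0) : x ^ (M * M') = x' ^ (M * M') := by
  have e1 : (x * v) ^ (M * M') = 1 := by rw [pow_mul, h1, one_pow]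
  have e2 : (x' * v) ^ (M * M') = 1 := by rw [mul_comm M M', pow_mul, h2, one_pow]
  rw [mul_pow] at e1 e2
  exact mul_right_cancel₀ (pow_ne_zero _ hv) (e1.trans e2.symm)

/-- `(r²)^{−1/2} = r⁻¹` for `r > 0` (complex power of a positive real). [cite: NeukirchANT1999, Ch. VII §6 Prop. (6.13) (proof) and Cor. (6.14)] -/
theorem ofReal_sq_cpow_neg_half {r : ℝ} (hr : 0 < r) :
    (((r ^ 2 : ℝ)) : ℂ) ^ (-1 / 2 : ℂ) = ((r : ℂ))⁻¹ := by
  rw [show (-1 / 2 : ℂ) = ((-(1 / 2) : ℝ) : ℂ) by push_cast; ring,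
    ← Complex.ofReal_cpow (by positivity), ← Complex.ofReal_inv, Real.rpow_neg (by positivity),
    ← Real.sqrt_eq_rpow, Real.sqrt_sq hr.le]

/-! ## §4 Rigidity from value pairs -/

/-- **RIGIDITY FROM VALUE PAIRS** — the algebraic end (R3)+(R4) of the rigidity bridge H_Rig⁰ of the
line `rubin-formula-zp` (planner D169). Let `K` be imaginary quadratic, `c ≠ 1` its non-trivial
automorphism, `ψ` a Hecke character of infinity type `(1, 0)` and `φ` an ARBITRARY Hecke character.
If at almost every finite place `w` the pair `(φ(ϖ_w), φ(ϖ_{c w}))` equals `(ψ(ϖ_w), ψ(ϖ_{c w}))`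
up to order, then `φ = ψ` or `φ = ψ ∘ c`. PROOF: (i) the symmetric products agree, `φ·(φ∘c) = ψ·(ψ∘c)`
(`mul_galConj_eq_of_valuePairs`); (ii) evaluating at `(2)_∞`, `(3)_∞` gives the Booker–Krishnamurthy
parameter `ν = −1/2` of `φ` (`archParam_eq_neg_half`, `2^a ≠ 3^b`); (iii) at a split place `w`
(`c w ≠ w`) with `𝔭_w^h = (a)`, Neukirch (6.13) for `φ` and `ψ` (`exists_finset_pow_rel`) turns the
unswapped alternative into `(σa/|σa|)^{(k+1)N} = 1` and the swapped one into `(σa/|σa|)^{(k−1)N} = 1`,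
and `σa/|σa|` is not a root of unity (`smul_eq_of_div_norm_zpow_eq_one`) — so the SIGN of the global
parameter `k` decides the alternative UNIFORMLY; (iv) GL(1) rigidity
`ext_of_eventually_valueAtUniformizer_eq`. No density or non-vanishing input.
[cite: NeukirchANT1999, Ch. VII §6 Prop. (6.13) and Cor. (6.14)]
[cite: CasselsFrohlichANT1967, Ch. VII §4 Prop. 4.1 (proof)]
[cite: BookerKrishnamurthy2011, §1.1 (p. 672)] -/
theorem eq_or_eq_galConj_of_valuePairs (hK : IsImaginaryQuadratic K) (c : K ≃ₐ[ℚ] K) (hc : c ≠ 1)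
    {φ ψ : HeckeCharacter K} (hinf : ψ.HasInfinityType (fun _ ↦ 1) (fun _ ↦ 0))
    (hpair : ∀ᶠ w in cofinite,
      (φ.valueAtUniformizer w = ψ.valueAtUniformizer w ∧
          φ.valueAtUniformizer (c • w) = ψ.valueAtUniformizer (c • w)) ∨
        (φ.valueAtUniformizer w = ψ.valueAtUniformizer (c • w) ∧
          φ.valueAtUniformizer (c • w) = ψ.valueAtUniformizer w)) :
    φ = ψ ∨ φ = HeckeCharacter.galConj c ψ := by
  haveI := DeuringCM.X11b.subsingleton_infinitePlace_of_isImaginaryQuadratic hK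
  haveI : IsTotallyComplex K := hK.2
  obtain ⟨w₀⟩ : Nonempty (InfinitePlace K) := inferInstance
  -- the archimedean parameters of `φ`: `ν = -1/2`, `k`
  obtain ⟨P, hP⟩ := φ.exists_hasArchParams
  have hφ : HasComplexParam (φ.archComponent w₀) (P.ν w₀) (P.k w₀) :=
    (hP w₀).2 (IsTotallyComplex.isComplex w₀)
  have hν : P.ν w₀ = -1 / 2 :=
    archParam_eq_neg_half hK w₀ c hφ hinf (mul_galConj_eq_of_valuePairs c hpair)
  rw [hν] at hφ
  set k : ℤ := P.k w₀ with hk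
  set σ : K →+* ℂ := w₀.embedding with hσ
  -- archimedean values
  have hAφ : ∀ x : Kˣ, ((φ (infiniteIdeles K (globalToInfiniteUnits K x)) : ℂˣ) : ℂ) =
      ((‖σ x‖ : ℂ))⁻¹ * (σ x / (‖σ x‖ : ℂ)) ^ k := fun x ↦ by
    rw [coe_apply_infiniteIdeles_eq_of_hasComplexParam hK w₀ hφ x,
      ofReal_sq_cpow_neg_half (norm_pos_iff.mpr ((map_ne_zero _).mpr x.ne_zero))]
  have hAψ : ∀ x : Kˣ, ((ψ (infiniteIdeles K (globalToInfiniteUnits K x)) : ℂˣ) : ℂ) = (σ x)⁻¹ :=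
    coe_apply_infiniteIdeles_eq_of_hasInfinityType_one_zero hK w₀ hinf
  -- Neukirch (6.13) data for `φ`, `ψ`; a principal power of every prime
  obtain ⟨Tφ, Mφ, hMφ, -, hrelφ⟩ := exists_finset_pow_rel φ
  obtain ⟨Tψ, Mψ, hMψ, hurψ, hrelψ⟩ := exists_finset_pow_rel ψ
  obtain ⟨h, hh, hgen⟩ := exists_pow_asIdeal_eq_span K
  -- the good places: cofinite
  have hT : ∀ T : Finset (HeightOneSpectrum (𝓞 K)), ∀ᶠ w in cofinite, w ∉ T ∧ c • w ∉ T := fun T ↦ by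
    refine T.eventually_cofinite_notMem.and ?_
    have hfin : ((fun w : HeightOneSpectrum (𝓞 K) ↦ c • w) ⁻¹' (T : Set _)).Finite :=
      T.finite_toSet.preimage fun _ _ _ _ e ↦ smul_left_cancel c e
    exact Filter.eventually_cofinite.mpr (hfin.subset fun w hw ↦ by simpa using hw)
  have hgood := hpair.and ((hT Tφ).and (hT Tψ))
  -- KEY: at a good SPLIT place the alternative is decided by the sign of `k`
  have key : ∀ w : HeightOneSpectrum (𝓞 K), (w ∉ Tφ ∧ c • w ∉ Tφ) ∧ (w ∉ Tψ ∧ c • w ∉ Tψ) →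
      c • w ≠ w →
      (φ.valueAtUniformizer w = ψ.valueAtUniformizer w → k = -1) ∧
        (φ.valueAtUniformizer w = ψ.valueAtUniformizer (c • w) → k = 1) := by
    rintro w ⟨⟨hwφ, -⟩, ⟨hwψ, hcwψ⟩⟩ hsplit
    obtain ⟨a, ha, hspan⟩ := hgen w
    have hca : ((c • a : 𝓞 K) : K) ≠ 0 := by
      rw [RingOfIntegers.coe_algEquiv_smul]; exact (map_ne_zero _).mpr ha
    have hspan' : (c • w).asIdeal ^ h = Ideal.span {c • a} := smul_asIdeal_pow_eq_span c hspan
    -- the three relations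
    have r1 := hrelφ hwφ ha h hspan
    have r2 := hrelψ hwψ ha h hspan
    have r3 := hrelψ hcwψ hca h hspan'
    rw [hAφ] at r1
    rw [hAψ] at r2 r3
    simp only [Units.val_mk0] at r1 r2 r3
    rw [RingOfIntegers.coe_algEquiv_smul] at r3
    -- `z = σ a = r u`, `conj z = σ (c a) = r u⁻¹`
    set z : ℂ := σ a with hz
    set r : ℝ := ‖z‖ with hr
    have hz0 : z ≠ 0 := (map_ne_zero σ).mpr ha
    have hr0 : (r : ℂ) ≠ 0 := by exact_mod_cast (norm_pos_iff.mpr hz0).ne'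
    set u : ℂ := z / r with hu
    have hu0 : u ≠ 0 := div_ne_zero hz0 hr0
    have hr2 : (r : ℂ) ^ 2 = z * conj z := by
      rw [Complex.mul_conj, Complex.normSq_eq_norm_sq]; push_cast; ring
    have hzu : z = r * u := by rw [hu]; field_simp
    have hconj : σ (c a) = (r : ℂ) * u⁻¹ := by
      rw [← LemmaXi.conj_embedding_eq_embedding_algEquiv hK.1 c hc σ
        (IsTotallyComplex.complexEmbedding_not_isReal σ) a, ← hz, hu, inv_div, mul_div_assoc',
        ← pow_two, hr2, mul_div_cancel_left₀ _ hz0]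
    have hψw : ψ.valueAtUniformizer w ≠ 0 := by
      simp only [HeckeCharacter.valueAtUniformizer]; exact Units.ne_zero _
    have hψcw : ψ.valueAtUniformizer (c • w) ≠ 0 := by
      simp only [HeckeCharacter.valueAtUniformizer]; exact Units.ne_zero _
    have hN : ((Mφ * Mψ : ℕ) : ℤ) ≠ 0 := by positivity
    constructor
    · intro hA
      rw [hA] at r1
      have e := pow_eq_pow_of_mul_pow_eq_one r1 r2 (pow_ne_zero _ hψw)
      -- `(r⁻¹ u^k)^N = (z⁻¹)^N = (r⁻¹ u⁻¹)^N` ⇒ `u^{(k+1)N} = 1`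
      rw [hzu, mul_inv, mul_pow, mul_pow] at e
      have e' : (u ^ k) ^ (Mφ * Mψ) = u⁻¹ ^ (Mφ * Mψ) :=
        mul_left_cancel₀ (pow_ne_zero _ (inv_ne_zero hr0)) e
      have hu1 : u ^ ((k + 1) * ((Mφ * Mψ : ℕ) : ℤ)) = 1 := by
        rw [zpow_mul, zpow_natCast, zpow_add_one₀ hu0, mul_pow, e', ← mul_pow, inv_mul_cancel₀ hu0,
          one_pow]
      by_contra hk1
      exact hsplit (smul_eq_of_div_norm_zpow_eq_one hK c hc σ ha hh hspan
        (mul_ne_zero (by omega) hN) hu1)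
    · intro hB
      rw [hB] at r1
      have e := pow_eq_pow_of_mul_pow_eq_one r1 r3 (pow_ne_zero _ hψcw)
      -- `(r⁻¹ u^k)^N = ((r u⁻¹)⁻¹)^N = (r⁻¹ u)^N` ⇒ `u^{(k-1)N} = 1`
      rw [hconj, mul_inv, inv_inv, mul_pow, mul_pow] at e
      have e' : (u ^ k) ^ (Mφ * Mψ) = u ^ (Mφ * Mψ) :=
        mul_left_cancel₀ (pow_ne_zero _ (inv_ne_zero hr0)) e
      have hu1 : u ^ ((k - 1) * ((Mφ * Mψ : ℕ) : ℤ)) = 1 := by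
        rw [zpow_mul, zpow_natCast, zpow_sub_one₀ hu0, mul_pow, e', ← mul_pow, mul_inv_cancel₀ hu0,
          one_pow]
      by_contra hk1
      exact hsplit (smul_eq_of_div_norm_zpow_eq_one hK c hc σ ha hh hspan
        (mul_ne_zero (by omega) hN) hu1)
  -- conclusion: the sign of `k` decides the alternative everywhere
  by_cases hk1 : k = 1
  · right
    apply HeckeCharacter.ext_of_eventually_valueAtUniformizer_eq
    filter_upwards [hgood] with w hw
    obtain ⟨hpw, hTφw, hTψw⟩ := hw
    rw [valueAtUniformizer_galConj_of_isUnramifiedAt c ψ w (hurψ _ hTψw.2)]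
    by_cases hsplit : c • w = w
    · rcases hpw with ⟨h1, -⟩ | ⟨h1, -⟩
      · rw [h1, hsplit]
      · exact h1
    · rcases hpw with ⟨h1, -⟩ | ⟨h1, -⟩
      · have := (key w ⟨hTφw, hTψw⟩ hsplit).1 h1; omega
      · exact h1
  · left
    apply HeckeCharacter.ext_of_eventually_valueAtUniformizer_eq
    filter_upwards [hgood] with w hw
    obtain ⟨hpw, hTφw, hTψw⟩ := hw
    by_cases hsplit : c • w = w
    · rcases hpw with ⟨h1, -⟩ | ⟨h1, -⟩
      · exact h1
      · rw [h1, hsplit]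
    · rcases hpw with ⟨h1, -⟩ | ⟨h1, -⟩
      · exact h1
      · exact absurd ((key w ⟨hTφw, hTψw⟩ hsplit).2 h1) hk1

end Rigidity

end Literature.NumberTheory.EllipticCurves.DeuringCM.RamifiedSevenEllipticUnits

end Part10

/-!
## Part 11 — port of `Summits/BirchSwinnertonDyer/BirchSwinnertonDyer/Theorems/RamifiedSevenEllipticUnitsPinnedCharacterRigiditySeven.lean` (1 declarations kept)

# H_Rig⁰ CLOSED: the registered stub `stub_pinnedCharacterRigiditySeven` of the K7r Value

Declarations of this Part (verbatim port; each keeps its own docstring and citation): `eq_or_eq_galConj_of_heckeLFunction_eq`.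

Reference keys (see `references.bib` and the declarations' citations): [NeukirchANT1999], [Ribet1977Nebentypus], [SilvermanATAEC1994].
-/

section Part11

set_option autoImplicit false

open scoped _root_.Classical _root_.Pointwise
open _root_.Filter _root_.NumberField _root_.IsDedekindDomain
  Literature.NumberTheory.GaloisRepresentations
  Literature.NumberTheory.EllipticCurves
  Literature.NumberTheory.EllipticCurves.DeuringCM

namespace Literature.NumberTheory.EllipticCurves.DeuringCM.RamifiedSevenEllipticUnits

/-- **Rigidity of `L`-pinning in an imaginary quadratic field.** `K` imaginary quadratic with
non-trivial automorphism `c`; `ψ` a Hecke character of infinity type `(1, 0)`; `φ` ANY Hecke character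
with `heckeLFunction φ s = heckeLFunction ψ s` for `re s > s₀`. Then `φ = ψ` or `φ = ψ ∘ c`.
(Composition of (G2) `Rigidity.valuePairs_eventually_of_heckeLFunction_eq` with the algebraic end
`Rigidity.eq_or_eq_galConj_of_valuePairs`.) [cite: NeukirchANT1999, Ch. VII §6 Prop. (6.13) and §8 (8.1)]
[cite: Ribet1977Nebentypus, §3 Thm. (3.4)] -/
theorem Rigidity.eq_or_eq_galConj_of_heckeLFunction_eq {K : Type} [Field K] [NumberField K]
    (hK : IsImaginaryQuadratic K) (c : K ≃ₐ[ℚ] K) (hc : c ≠ 1) {φ ψ : HeckeCharacter K}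
    (hinf : ψ.HasInfinityType (fun _ ↦ 1) (fun _ ↦ 0)) (s₀ : ℝ)
    (h : ∀ s : ℂ, s₀ < s.re → heckeLFunction φ s = heckeLFunction ψ s) :
    φ = ψ ∨ φ = HeckeCharacter.galConj c ψ :=
  Rigidity.eq_or_eq_galConj_of_valuePairs hK c hc hinf
    (Rigidity.valuePairs_eventually_of_heckeLFunction_eq hK.1 c hc φ ψ s₀ h)

end Literature.NumberTheory.EllipticCurves.DeuringCM.RamifiedSevenEllipticUnits

end Part11

/-!
## Part 12 — port of `Summits/BirchSwinnertonDyer/BirchSwinnertonDyer/Theorems/RamifiedSevenEllipticUnitsQuadraticRamificationOfPinning.lean` (4 declarations kept)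

# K7r value `EllipticUnitValueSevenOfGZK` (), line `rubin-formula-zp` v4.2 — H_QR AT THE FRAME PRIME WITHOUT GROSS (8.2.7): from the `L`-pinning alone (cell `bsd-cm`, g13; helper, `--supports` 19945; nothing about BSD asserted)

Declarations of this Part (verbatim port; each keeps its own docstring and citation): `intCast_lFunction_eq_weightedCoeff_of_heckeLFunction_eq_LSeries`, `setOf_absNorm_eq_of_dvd_discr`, `twistCount_eq_apply_of_dvd_discr`, `not_isUnramifiedAt_of_heckeLFunction_eq_LSeries_of_lFunction_eq_zero`.

Reference keys (see `references.bib` and the declarations' citations): [NeukirchANT1999], [WeilBNT1967], [SilvermanAEC2009], [SilvermanATAEC1994], [BurungaleKobayashiNakamuraOta2026].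
-/

section Part12

set_option autoImplicit false

open scoped _root_.Classical
open _root_.Filter _root_.NumberField _root_.IsDedekindDomain _root_.WeierstrassCurve
  Literature.NumberTheory.GaloisRepresentations
  Literature.NumberTheory.LFunctions
  Literature.NumberTheory.EllipticCurves
  Literature.NumberTheory.EllipticCurves.Rank1Residual
  Literature.NumberTheory.EllipticCurves.DeuringCM

namespace Literature.NumberTheory.EllipticCurves.DeuringCM.RamifiedSevenEllipticUnits

/-! ## §1. Hecke character pinned to a curve: the coefficient identity and ramification at a
ramified prime where `a_p = 0` -/

namespace Rigidity

variable {K : Type} [Field K] [NumberField K]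

/-- **Hecke-vs-curve coefficient identity.** If `heckeLFunction ψ s = V.LSeries s` for `re s > s₀`
(`ψ` ANY Hecke character of `K`, `V` ANY Weierstrass curve over a number field), then with Weil's
decomposition `ψ = ψ₀‖·‖^σ` of file (R1) (`ψ₀` unitary, same ramification, `ψ₀(ϖ_v) = ψ(ϖ_v)·Nv^σ`,
ramification modulus `𝔪`): `a_n(V) = (Σ_{N𝔞 = n} ψ₀(𝔞))·n^{−σ}` for every `n ≠ 0`.
[cite: NeukirchANT1999, Ch. VII §8 (8.1)] [cite: WeilBNT1967, Ch. VII §7 ¶1] -/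
theorem intCast_lFunction_eq_weightedCoeff_of_heckeLFunction_eq_LSeries (ψ : HeckeCharacter K)
    {F : Type} [Field F] [NumberField F] (V : WeierstrassCurve F) (s₀ : ℝ)
    (h : ∀ s : ℂ, s₀ < s.re → heckeLFunction ψ s = V.LSeries s) :
    ∃ (σ : ℝ) (ψ₀ : HeckeCharacter K) (𝔪 : Ideal (𝓞 K)), ψ₀.IsUnitary ∧ 𝔪 ≠ ⊥ ∧
      (∀ v : HeightOneSpectrum (𝓞 K), ψ.IsUnramifiedAt v ↔ ¬ 𝔪 ≤ v.asIdeal) ∧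
      (∀ v : HeightOneSpectrum (𝓞 K), ψ₀.IsUnramifiedAt v ↔ ¬ 𝔪 ≤ v.asIdeal) ∧
      (∀ v : HeightOneSpectrum (𝓞 K), ψ₀.valueAtUniformizer v =
        ψ.valueAtUniformizer v * ((Ideal.absNorm v.asIdeal : ℕ) : ℂ) ^ (σ : ℂ)) ∧
      ∀ n : ℕ, n ≠ 0 →
        ((V.LFunction n : ℤ) : ℂ) =
          NumberField.twistCount K (rayClassCoeffHom 𝔪 fun v ↦ ψ₀.valueAtUniformizer v) n *
            (n : ℂ) ^ (-(σ : ℂ)) := by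
  obtain ⟨σ, ψ₀, 𝔪, hu, h𝔪, -, hiff, hiff₀, hval, hL⟩ := exists_heckeLFunction_eq_LSeries_translate ψ
  refine ⟨σ, ψ₀, 𝔪, hu, h𝔪, hiff, hiff₀, hval, fun n hn ↦ ?_⟩
  refine LSeries.eq_of_LSeries_eventually_eq (f := fun n ↦ ((V.LFunction n : ℤ) : ℂ))
    (g := fun n ↦ NumberField.twistCount K (rayClassCoeffHom 𝔪 fun v ↦ ψ₀.valueAtUniformizer v) n *
      (n : ℂ) ^ (-(σ : ℂ)))
    V.abscissaOfAbsConv_LFunction_lt_top (abscissaOfAbsConv_weighted_lt_top hu h𝔪 σ) ?_ hn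
  -- on large reals both series ARE the common `L`-function
  rw [Filter.EventuallyEq, Filter.eventually_atTop]
  refine ⟨max s₀ (1 - σ) + 1, fun x hx ↦ ?_⟩
  have hx₀ : s₀ < ((x : ℂ)).re := by
    simp only [Complex.ofReal_re]; linarith [le_max_left s₀ (1 - σ)]
  have hx₁ : 1 - σ < ((x : ℂ)).re := by
    simp only [Complex.ofReal_re]; linarith [le_max_right s₀ (1 - σ)]
  show LSeries _ (x : ℂ) = LSeries _ (x : ℂ)
  rw [LSeries_shift, ← hL x hx₁, h x hx₀]
  rfl

/-- **The only ideal of norm `p` at a prime RAMIFIED in a quadratic field is `𝔭`.** For `[K : ℚ] = 2`,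
`p ∣ d_K` and the prime `𝔭 ∋ p` of `K`: `{𝔞 : N𝔞 = p} = {𝔭}` (`p𝓞_K = 𝔭²`, so `N𝔭 = p`; an ideal of
prime norm `p` is a prime containing `p`, hence `𝔭`). [cite: NeukirchANT1999, Ch. I §8 Prop. (8.2) and §9 Prop. (9.6)] -/
theorem setOf_absNorm_eq_of_dvd_discr (h2 : Module.finrank ℚ K = 2) {p : ℕ} [hp : Fact p.Prime]
    (hdvd : (p : ℤ) ∣ NumberField.discr K) (𝔭 : HeightOneSpectrum (𝓞 K))
    (hp𝔭 : ((p : ℕ) : 𝓞 K) ∈ 𝔭.asIdeal) :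
    {I : Ideal (𝓞 K) | Ideal.absNorm I = p} = {𝔭.asIdeal} := by
  -- `N𝔭 = p` from `p𝓞_K = 𝔭²`
  have habs : Ideal.absNorm 𝔭.asIdeal = p := by
    have hsq := congrArg Ideal.absNorm (LemmaXi.span_natCast_eq_sq_of_dvd_discr h2 hdvd 𝔭 hp𝔭)
    rw [Ideal.absNorm_span_natCast, NumberField.RingOfIntegers.rank, h2, map_pow] at hsq
    exact (Nat.pow_left_injective two_ne_zero hsq).symm
  ext I
  simp only [Set.mem_setOf_eq, Set.mem_singleton_iff]
  constructor
  · intro hI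
    haveI : I.IsPrime := Ideal.isPrime_of_irreducible_absNorm (by rw [hI]; exact hp.out)
    refine LemmaXi.eq_asIdeal_of_dvd_discr h2 hdvd 𝔭 hp𝔭 ?_
    have hmem := Ideal.absNorm_mem I
    rw [hI] at hmem
    exact_mod_cast hmem
  · rintro rfl
    exact habs

/-- The Dirichlet coefficient `Σ_{N𝔞 = p} g(𝔞)` at a prime RAMIFIED in a quadratic field is the single
term `g(𝔭)`. [cite: NeukirchANT1999, Ch. I §8 Prop. (8.2)] -/
theorem twistCount_eq_apply_of_dvd_discr (h2 : Module.finrank ℚ K = 2) {p : ℕ} [hp : Fact p.Prime]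
    (hdvd : (p : ℤ) ∣ NumberField.discr K) (𝔭 : HeightOneSpectrum (𝓞 K))
    (hp𝔭 : ((p : ℕ) : 𝓞 K) ∈ 𝔭.asIdeal) (g : Ideal (𝓞 K) →*₀ ℂ) :
    NumberField.twistCount K g p = g 𝔭.asIdeal := by
  rw [twistCount_eq_finsum, setOf_absNorm_eq_of_dvd_discr h2 hdvd 𝔭 hp𝔭, finsum_mem_singleton]

/-- **A Hecke character pinned to a curve with `a_p = 0` is RAMIFIED at the ramified prime above `p`.**
`K` quadratic, `p ∣ d_K`, `𝔭 ∋ p`; `ψ` ANY Hecke character of `K` with `heckeLFunction ψ s = V.LSeries s`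
for `re s > s₀`, where `V` is a Weierstrass curve over a number field whose `p`-th coefficient `a_p(V)`
vanishes (e.g. additive reduction at `p` over `ℚ`). Then `ψ` is ramified at `𝔭`: otherwise the `p`-th
coefficient of `L(ψ, s)` would be `ψ₀(ϖ_𝔭)·p^{−σ} ≠ 0` (`𝔭` the only ideal of norm `p`, `ψ₀` unitary).
Unconditional. [cite: NeukirchANT1999, Ch. VII §8 (8.1)] [cite: SilvermanAEC2009, App. C §16 (the local factor `1` at an additive prime)] -/
theorem not_isUnramifiedAt_of_heckeLFunction_eq_LSeries_of_lFunction_eq_zero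
    (h2 : Module.finrank ℚ K = 2) {p : ℕ} [hp : Fact p.Prime] (hdvd : (p : ℤ) ∣ NumberField.discr K)
    (𝔭 : HeightOneSpectrum (𝓞 K)) (hp𝔭 : ((p : ℕ) : 𝓞 K) ∈ 𝔭.asIdeal) (ψ : HeckeCharacter K)
    {F : Type} [Field F] [NumberField F] (V : WeierstrassCurve F) (s₀ : ℝ)
    (hL : ∀ s : ℂ, s₀ < s.re → heckeLFunction ψ s = V.LSeries s) (hV : V.LFunction p = 0) :
    ¬ ψ.IsUnramifiedAt 𝔭 := by
  intro hunr
  obtain ⟨σ, ψ₀, 𝔪, hu, h𝔪, hiff, -, -, hcoeff⟩ :=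
    intCast_lFunction_eq_weightedCoeff_of_heckeLFunction_eq_LSeries ψ V s₀ hL
  have hp0 : (p : ℂ) ≠ 0 := by exact_mod_cast hp.out.ne_zero
  have e := hcoeff p hp.out.ne_zero
  rw [hV, Int.cast_zero, twistCount_eq_apply_of_dvd_discr h2 hdvd 𝔭 hp𝔭,
    rayClassCoeffHom_asIdeal _ ((hiff 𝔭).mp hunr) h𝔪] at e
  -- `0 = ψ₀(ϖ_𝔭) · p^{−σ}` with both factors nonzero
  have h1 : ψ₀.valueAtUniformizer 𝔭 ≠ 0 := by
    intro h0
    have := HeckeCharacter.norm_valueAtUniformizer_of_isUnitary hu 𝔭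
    rw [h0, norm_zero] at this
    exact zero_ne_one this
  have h2' : (p : ℂ) ^ (-(σ : ℂ)) ≠ 0 := fun h0 ↦ hp0 ((Complex.cpow_eq_zero_iff _ _).mp h0).1
  exact mul_ne_zero h1 h2' e.symm

end Rigidity

/-! ## §2. Curves with CM field `ℚ(√−7)`: `a₇ = 0`, and every pinned character is ramified at `𝔭 ∋ 7` -/

namespace QuadraticRamification

section CMSeven

variable {W : WeierstrassCurve ℚ} [W.IsElliptic]

variable {K : Type} [Field K] [NumberField K] {𝔭 : HeightOneSpectrum (𝓞 K)}

variable {W' : WeierstrassCurve ℚ} {C : VariableChange ℚ}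

end CMSeven

/-! ## §3. ASSEMBLY: H_QR on 𝒞₇ WITHOUT Gross (8.2.7) -/

section Assembly

variable {W : WeierstrassCurve ℚ} [W.IsElliptic] [W.IsGloballyMinimal]

end Assembly

end QuadraticRamification

end Literature.NumberTheory.EllipticCurves.DeuringCM.RamifiedSevenEllipticUnits

end Part12

/-!
## Part 13 — port of `Summits/BirchSwinnertonDyer/BirchSwinnertonDyer/Theorems/RamifiedSevenEllipticUnitsTwistTransportPinned.lean` (2 declarations kept)

# K7r value `EllipticUnitValueSevenOfGZK` (), line `rubin-formula-zp` v4.4 — TWIST TRANSPORT OF A PINNED CHARACTER, PART 1: the Kronecker Hecke character, the pinning read at split / inert primes, and the base curve `cm7 = 49a1` (cell `bsd-cm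

Declarations of this Part (verbatim port; each keeps its own docstring and citation): `coeff_of_pinned_split`, `coeff_of_pinned_inert`.

Reference keys (see `references.bib` and the declarations' citations): [SilvermanATAEC1994], [SilvermanAEC2009], [Ribet1977Nebentypus], [NeukirchANT1999], [CasselsFrohlichANT1967], [MontgomeryVaughan2007], [Cremona1997].
-/

section Part13

set_option autoImplicit false

open scoped _root_.Classical NumberTheorySymbols
open _root_.Filter _root_.NumberField _root_.IsDedekindDomain _root_.WeierstrassCurve
  Literature.NumberTheory.GaloisRepresentations
  Literature.NumberTheory.LFunctions
  Literature.NumberTheory.LFunctions.KroneckerCharacter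
  Literature.NumberTheory.EllipticCurves
  Literature.NumberTheory.EllipticCurves.ModularForms
  Literature.NumberTheory.EllipticCurves.Rank1Residual
  Literature.NumberTheory.EllipticCurves.DeuringCM

open Literature.Barriers.RiemannHypothesis (IsFundamentalDiscriminant)

namespace Literature.NumberTheory.EllipticCurves.DeuringCM.RamifiedSevenEllipticUnits

namespace TwistTransport

/-! ## §1. The Kronecker Hecke character `χ_D = ψ_{(D/·)} ∘ N_{K/ℚ}` -/

section Kronecker

variable {m : ℕ} [NeZero m]

end Kronecker

/-! ## §2. Coefficients of a pinned character at split and inert primes; comparison under a twist -/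

section Pinned

variable {K : Type} [Field K] [NumberField K]

/-- **Pinning read at a split prime.** If `heckeLFunction ψ s = V.LSeries s` for `re s > s₀` (`V/ℚ` any
Weierstrass curve) and the rational place `v` (prime `ℓ`) splits in `K` as `{w₁, w₂}` (residue degrees
one) with `ψ` unramified at both, then `a_ℓ(V) = ψ(ϖ_{w₁}) + ψ(ϖ_{w₂})` and
`a_{ℓ²}(V) = ψ(ϖ_{w₁})² + ψ(ϖ_{w₁})ψ(ϖ_{w₂}) + ψ(ϖ_{w₂})²` (the ideals of norm `ℓ^e` are the `w₁^i w₂^{e−i}`).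
[cite: Ribet1977Nebentypus, §3 Thm. (3.4)] [cite: NeukirchANT1999, Ch. VII §8 (8.1)] -/
theorem coeff_of_pinned_split (ψ : HeckeCharacter K) (V : WeierstrassCurve ℚ) (s₀ : ℝ)
    (h : ∀ s : ℂ, s₀ < s.re → heckeLFunction ψ s = V.LSeries s)
    (v : HeightOneSpectrum (𝓞 ℚ)) {w₁ w₂ : HeightOneSpectrum (𝓞 K)} (hne : w₁ ≠ w₂)
    (hS : {w : HeightOneSpectrum (𝓞 K) | w.asIdeal.under (𝓞 ℚ) = v.asIdeal} = {w₁, w₂})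
    (h₁ : w₁.asIdeal.inertiaDeg (𝓞 ℚ) = 1) (h₂ : w₂.asIdeal.inertiaDeg (𝓞 ℚ) = 1)
    (hψ₁ : ψ.IsUnramifiedAt w₁) (hψ₂ : ψ.IsUnramifiedAt w₂) :
    ((V.LFunction (Rat.HeightOneSpectrum.natGenerator v) : ℤ) : ℂ) =
        ψ.valueAtUniformizer w₁ + ψ.valueAtUniformizer w₂ ∧
      ((V.LFunction (Rat.HeightOneSpectrum.natGenerator v ^ 2) : ℤ) : ℂ) =
        ψ.valueAtUniformizer w₁ ^ 2 + ψ.valueAtUniformizer w₁ * ψ.valueAtUniformizer w₂ +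
          ψ.valueAtUniformizer w₂ ^ 2 := by
  obtain ⟨σ, ψ₀, 𝔪, -, h𝔪, hiff, -, hval, hcoeff⟩ :=
    Rigidity.intCast_lFunction_eq_weightedCoeff_of_heckeLFunction_eq_LSeries ψ V s₀ h
  set ℓ : ℕ := Rat.HeightOneSpectrum.natGenerator v with hℓ
  have hℓp : ℓ.Prime := Rat.HeightOneSpectrum.prime_natGenerator v
  have hℓ0 : (ℓ : ℂ) ≠ 0 := by exact_mod_cast hℓp.ne_zero
  set g : Ideal (𝓞 K) →*₀ ℂ := rayClassCoeffHom 𝔪 fun v ↦ ψ₀.valueAtUniformizer v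
  have hmul : ∀ A B : Ideal (𝓞 K), A ≠ ⊥ → B ≠ ⊥ → g (A * B) = g A * g B := fun A B _ _ ↦ map_mul g A B
  have hone : g ⊤ = 1 := by rw [← Ideal.one_eq_top, map_one]
  have hsum : ∀ e : ℕ, NumberField.twistCount K g (ℓ ^ e) =
      ∑ i ∈ Finset.range (e + 1), g w₁.asIdeal ^ i * g w₂.asIdeal ^ (e - i) := by
    intro e
    rw [Rigidity.twistCount_eq_finsum, hℓ]
    exact finsum_absNorm_eq_prime_pow_of_pair g hmul hone v hne hS h₁ h₂ e
  have hg₁ : g w₁.asIdeal = ψ₀.valueAtUniformizer w₁ :=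
    Rigidity.rayClassCoeffHom_asIdeal _ ((hiff w₁).mp hψ₁) h𝔪
  have hg₂ : g w₂.asIdeal = ψ₀.valueAtUniformizer w₂ :=
    Rigidity.rayClassCoeffHom_asIdeal _ ((hiff w₂).mp hψ₂) h𝔪
  have hN : ∀ {w : HeightOneSpectrum (𝓞 K)}, w ∈ ({w₁, w₂} : Set (HeightOneSpectrum (𝓞 K))) →
      w.asIdeal.inertiaDeg (𝓞 ℚ) = 1 → ((Ideal.absNorm w.asIdeal : ℕ) : ℂ) = ℓ := by
    intro w hw hf
    have hw' : w.asIdeal.under (𝓞 ℚ) = v.asIdeal := by rw [← hS] at hw; exact hw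
    have := (absNorm_eq_natGenerator_iff (K := K) v w.asIdeal).mpr ⟨w, rfl, hw', hf⟩
    rw [this]
  have hN₁ : ((Ideal.absNorm w₁.asIdeal : ℕ) : ℂ) = ℓ := hN (by simp) h₁
  have hN₂ : ((Ideal.absNorm w₂.asIdeal : ℕ) : ℂ) = ℓ := hN (by simp) h₂
  set a := ψ.valueAtUniformizer w₁
  set b := ψ.valueAtUniformizer w₂
  have ha : ψ₀.valueAtUniformizer w₁ = a * (ℓ : ℂ) ^ (σ : ℂ) := by rw [hval, hN₁]
  have hb : ψ₀.valueAtUniformizer w₂ = b * (ℓ : ℂ) ^ (σ : ℂ) := by rw [hval, hN₂]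
  have hu : (ℓ : ℂ) ^ (σ : ℂ) ≠ 0 := fun h0 ↦ hℓ0 (Complex.cpow_eq_zero_iff _ _ |>.mp h0).1
  have hw1 : ((ℓ : ℕ) : ℂ) ^ (-(σ : ℂ)) = ((ℓ : ℂ) ^ (σ : ℂ))⁻¹ := Complex.cpow_neg _ _
  have hw2 : ((ℓ ^ 2 : ℕ) : ℂ) ^ (-(σ : ℂ)) = ((ℓ : ℂ) ^ (σ : ℂ))⁻¹ * ((ℓ : ℂ) ^ (σ : ℂ))⁻¹ := by
    rw [pow_two, Nat.cast_mul, Complex.natCast_mul_natCast_cpow, Complex.cpow_neg]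
  have hs1 : NumberField.twistCount K g ℓ = g w₂.asIdeal + g w₁.asIdeal := by
    have := hsum 1
    rw [pow_one] at this
    rw [this, Finset.sum_range_succ, Finset.sum_range_succ, Finset.sum_range_zero]
    simp
  have hs2 : NumberField.twistCount K g (ℓ ^ 2) =
      g w₂.asIdeal ^ 2 + g w₁.asIdeal * g w₂.asIdeal + g w₁.asIdeal ^ 2 := by
    rw [hsum 2, Finset.sum_range_succ, Finset.sum_range_succ, Finset.sum_range_succ,
      Finset.sum_range_zero]
    simp
  have e1 := hcoeff ℓ hℓp.ne_zero
  have e2 := hcoeff (ℓ ^ 2) (pow_ne_zero 2 hℓp.ne_zero)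
  rw [hs1, hg₁, hg₂, ha, hb, hw1] at e1
  rw [hs2, hg₁, hg₂, ha, hb, hw2] at e2
  refine ⟨?_, ?_⟩
  · rw [e1]; field_simp; ring
  · rw [e2]; field_simp; ring

/-- **Pinning read at an inert prime.** If `heckeLFunction ψ s = V.LSeries s` for `re s > s₀` and the
rational place `v` (prime `ℓ`) is inert in `K` with the single place `w` above it (residue degree two,
`ψ` unramified at `w`), then `a_{ℓ²}(V) = ψ(ϖ_w)` (the only ideal of norm `ℓ²` is `𝔭_w`).
[cite: Ribet1977Nebentypus, §3 Thm. (3.4) and Cor. (3.5)] [cite: NeukirchANT1999, Ch. VII §8 (8.1)] -/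
theorem coeff_of_pinned_inert (ψ : HeckeCharacter K) (V : WeierstrassCurve ℚ) (s₀ : ℝ)
    (h : ∀ s : ℂ, s₀ < s.re → heckeLFunction ψ s = V.LSeries s)
    (v : HeightOneSpectrum (𝓞 ℚ)) {w : HeightOneSpectrum (𝓞 K)}
    (hS : {w : HeightOneSpectrum (𝓞 K) | w.asIdeal.under (𝓞 ℚ) = v.asIdeal} = {w})
    (hw : w.asIdeal.inertiaDeg (𝓞 ℚ) = 2) (hψ : ψ.IsUnramifiedAt w) :
    ((V.LFunction (Rat.HeightOneSpectrum.natGenerator v ^ 2) : ℤ) : ℂ) = ψ.valueAtUniformizer w := by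
  obtain ⟨σ, ψ₀, 𝔪, -, h𝔪, hiff, -, hval, hcoeff⟩ :=
    Rigidity.intCast_lFunction_eq_weightedCoeff_of_heckeLFunction_eq_LSeries ψ V s₀ h
  set ℓ : ℕ := Rat.HeightOneSpectrum.natGenerator v with hℓ
  have hℓp : ℓ.Prime := Rat.HeightOneSpectrum.prime_natGenerator v
  set g : Ideal (𝓞 K) →*₀ ℂ := rayClassCoeffHom 𝔪 fun v ↦ ψ₀.valueAtUniformizer v
  have hmul : ∀ A B : Ideal (𝓞 K), A ≠ ⊥ → B ≠ ⊥ → g (A * B) = g A * g B := fun A B _ _ ↦ map_mul g A B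
  have hone : g ⊤ = 1 := by rw [← Ideal.one_eq_top, map_one]
  have hsum : NumberField.twistCount K g (ℓ ^ 2) = g w.asIdeal := by
    have h1 := (finsum_absNorm_eq_prime_pow_of_singleton g hmul hone v hS hw 1).1
    rw [mul_one, pow_one] at h1
    rw [Rigidity.twistCount_eq_finsum, hℓ]
    exact h1
  have hg : g w.asIdeal = ψ₀.valueAtUniformizer w := Rigidity.rayClassCoeffHom_asIdeal _ ((hiff w).mp hψ) h𝔪
  have hm : w.asIdeal.under (𝓞 ℚ) = v.asIdeal := by
    have : w ∈ {w : HeightOneSpectrum (𝓞 K) | w.asIdeal.under (𝓞 ℚ) = v.asIdeal} := by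
      rw [hS]; exact Set.mem_singleton _
    exact this
  have hwv : w.under (𝓞 ℚ) = v :=
    HeightOneSpectrum.ext (by rw [HeightOneSpectrum.under_asIdeal]; exact hm)
  have hN : ((Ideal.absNorm w.asIdeal : ℕ) : ℂ) = ((ℓ ^ 2 : ℕ) : ℂ) := by
    rw [absNorm_asIdeal_eq_natGenerator_pow, hwv, hw]
  have hX : ((ℓ ^ 2 : ℕ) : ℂ) ≠ 0 := by exact_mod_cast pow_ne_zero 2 hℓp.ne_zero
  have hXσ : ((ℓ ^ 2 : ℕ) : ℂ) ^ (σ : ℂ) * ((ℓ ^ 2 : ℕ) : ℂ) ^ (-(σ : ℂ)) = 1 := by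
    rw [Complex.cpow_neg, mul_inv_cancel₀]
    exact fun h0 ↦ hX ((Complex.cpow_eq_zero_iff _ _).mp h0).1
  have e2 := hcoeff (ℓ ^ 2) (pow_ne_zero 2 hℓp.ne_zero)
  rw [hsum, hg, hval, hN, mul_assoc, hXσ, mul_one] at e2
  exact e2

end Pinned

/-! ## §3. The base curve `cm7 = 49a1`: twist parameter, Deuring's character, unramifiedness off `7` -/

section Base

variable {K : Type} [Field K] [NumberField K]

end Base

end TwistTransport

end Literature.NumberTheory.EllipticCurves.DeuringCM.RamifiedSevenEllipticUnits

end Part13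

/-!
## Part 14 — port of `Summits/BirchSwinnertonDyer/BirchSwinnertonDyer/Theorems/RamifiedSevenEllipticUnitsDeuringShapeOfPinned.lean` (10 declarations kept)

# K7r `EllipticUnitValueSevenOfGZK` (), line `rubin-formula-zp` — DEURING'S SHAPE FROM THE PINNING ALONE: equivariance, ramification and the split/inert value laws of EVERY `(1,0)` Hecke character `L`-pinned to a curve over `ℚ` (cell `bsd-cm`

Declarations of this Part (verbatim port; each keeps its own docstring and citation): `exists_conj`, `isUnramifiedAt_iff_of_conj`, `valueAtUniformizer_of_conj`, `heckeLFunction_of_conj`, `heckeLFunction_of_conj_eq_conj`, `conj_LSeries_conj`, `isHeckeConjEquivariant_of_pinned`, `rayClassCoeffHom_asIdeal_eq_zero_of_le`, `isUnramifiedAt_and_values_of_pinned_of_hasGoodReduction`, `isUnramifiedAt_of_pinned_of_hasGoodReduction`.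

Reference keys (see `references.bib` and the declarations' citations): [SilvermanATAEC1994], [LiXu2025JNT], [Jia2026ActaArith], [NeukirchANT1999], [Ribet1977Nebentypus], [SilvermanAEC2009], [Cremona1997], [deShalit1987].
-/

section Part14

set_option autoImplicit false

open scoped _root_.Classical ComplexConjugate
open _root_.Filter _root_.NumberField _root_.IsDedekindDomain _root_.WeierstrassCurve
  Literature.NumberTheory.GaloisRepresentations
  Literature.NumberTheory.LFunctions
  Literature.NumberTheory.EllipticCurves
  Literature.NumberTheory.EllipticCurves.ModularForms
  Literature.NumberTheory.EllipticCurves.Rank1Residual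
  Literature.NumberTheory.EllipticCurves.DeuringCM

namespace Literature.NumberTheory.EllipticCurves.DeuringCM.RamifiedSevenEllipticUnits

namespace DeuringShape

variable {K : Type} [Field K] [NumberField K]

/-! ## §1 The complex-conjugate character `ψ̄ = conj ∘ ψ` (existence form; no definition is introduced) -/

/-- **The complex-conjugate Hecke character exists**: for every Hecke character `ψ` of `K` there is a
Hecke character `ψ̄` with `ψ̄(x) = \overline{ψ(x)}` for every idele `x` (`conj : ℂˣ → ℂˣ` is a continuous
group automorphism fixing `1`, so `conj ∘ ψ` is continuous and trivial on principal ideles). The tree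
keeps `ψ̄` anonymous (`heckeLFunctionConj` is "its" `L`-function); so do we. [cite: deShalit1987, II.1.1 (3) (the character `χ̄`)] -/
theorem exists_conj (ψ : HeckeCharacter K) :
    ∃ ψ' : HeckeCharacter K, ∀ x : ideleGroup K, ((ψ' x : ℂˣ) : ℂ) = conj ((ψ x : ℂˣ) : ℂ) := by
  let g : ideleGroup K →* ℂˣ :=
    (Units.map ((starRingEnd ℂ : ℂ →+* ℂ) : ℂ →* ℂ)).comp ψ.toContinuousMonoidHom.toMonoidHom
  have hcont : Continuous g := by
    change Continuous fun x : ideleGroup K ↦ Units.map ((starRingEnd ℂ : ℂ →+* ℂ) : ℂ →* ℂ) (ψ x)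
    exact (Units.continuous_map Complex.continuous_conj).comp (map_continuous ψ)
  let f : ideleGroup K →ₜ* ℂˣ := ⟨g, hcont⟩
  refine ⟨⟨f, fun x hx ↦ ?_⟩, fun x ↦ rfl⟩
  change Units.map ((starRingEnd ℂ : ℂ →+* ℂ) : ℂ →* ℂ) (ψ x) = 1
  rw [ψ.map_principal hx, map_one]

variable {ψ ψ' : HeckeCharacter K}

/-- `ψ̄` is unramified exactly where `ψ` is (`\overline{z} = 1 ↔ z = 1`). [cite: deShalit1987, II.1.1 (3)] -/
theorem isUnramifiedAt_iff_of_conj (hψ' : ∀ x : ideleGroup K, ((ψ' x : ℂˣ) : ℂ) = conj ((ψ x : ℂˣ) : ℂ))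
    (v : HeightOneSpectrum (𝓞 K)) : ψ'.IsUnramifiedAt v ↔ ψ.IsUnramifiedAt v := by
  simp only [HeckeCharacter.IsUnramifiedAt, HeckeCharacter.localComponent_apply]
  refine forall_congr' fun u ↦ ?_
  rw [← Units.val_eq_one, hψ', map_eq_one_iff (starRingEnd ℂ) (RingHom.injective _), Units.val_eq_one]

/-- `ψ̄(ϖ_v) = \overline{ψ(ϖ_v)}` (same chosen uniformiser). [cite: deShalit1987, II.1.1 (3)] -/
theorem valueAtUniformizer_of_conj
    (hψ' : ∀ x : ideleGroup K, ((ψ' x : ℂˣ) : ℂ) = conj ((ψ x : ℂˣ) : ℂ))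
    (v : HeightOneSpectrum (𝓞 K)) : ψ'.valueAtUniformizer v = conj (ψ.valueAtUniformizer v) := by
  simp only [HeckeCharacter.valueAtUniformizer, HeckeCharacter.localComponent_apply, hψ']

/-- **`L(ψ̄, s)` is the tree's `heckeLFunctionConj ψ s`** (the Euler product of `ψ̄` re-indexed onto the
unramified places of `ψ`). [cite: deShalit1987, II.1.1 (3)] -/
theorem heckeLFunction_of_conj
    (hψ' : ∀ x : ideleGroup K, ((ψ' x : ℂˣ) : ℂ) = conj ((ψ x : ℂˣ) : ℂ)) (s : ℂ) :
    heckeLFunction ψ' s = heckeLFunctionConj ψ s := by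
  unfold heckeLFunction heckeLFunctionConj
  let e : {v : HeightOneSpectrum (𝓞 K) // ψ'.IsUnramifiedAt v} ≃
      {w : HeightOneSpectrum (𝓞 K) // ψ.IsUnramifiedAt w} :=
    Equiv.subtypeEquivRight fun v ↦ isUnramifiedAt_iff_of_conj hψ' v
  have hre := Equiv.tprod_eq e (fun w : {w : HeightOneSpectrum (𝓞 K) // ψ.IsUnramifiedAt w} ↦
    (1 - conj (ψ.valueAtUniformizer w.1) * ((w.1.residueCard : ℂ) ^ (-s)))⁻¹)
  rw [← hre]
  exact tprod_congr fun v ↦ by rw [valueAtUniformizer_of_conj hψ']; rfl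

/-- **`L(ψ̄, s) = \overline{L(ψ, s̄)}`.** [cite: deShalit1987, II.1.1 (3)] -/
theorem heckeLFunction_of_conj_eq_conj
    (hψ' : ∀ x : ideleGroup K, ((ψ' x : ℂˣ) : ℂ) = conj ((ψ x : ℂˣ) : ℂ)) (s : ℂ) :
    heckeLFunction ψ' s = conj (heckeLFunction ψ (conj s)) := by
  rw [heckeLFunction_of_conj hψ', heckeLFunctionConj_eq_conj]

/-! ## §2 The `L`-series of a Weierstrass curve is real on the real axis: `\overline{L(V, s̄)} = L(V, s)` -/

/-- **`\overline{L(V, \bar s)} = L(V, s)`** for the `L`-series of a Weierstrass curve over a number field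
(its Dirichlet coefficients `V.LFunction n` are INTEGERS): conjugation passes through the `tsum` and
`\overline{n^{-\bar s}} = n^{-s}`. [cite: SilvermanAEC2009, App. C §16 (the L-series of E; shape only)] -/
theorem conj_LSeries_conj {F : Type} [Field F] [NumberField F] (V : WeierstrassCurve F) (s : ℂ) :
    conj (V.LSeries (conj s)) = V.LSeries s := by
  unfold WeierstrassCurve.LSeries LSeries
  rw [Complex.conj_tsum]
  refine tsum_congr fun n ↦ ?_
  rcases eq_or_ne n 0 with rfl | hn
  · simp [LSeries.term_zero]
  · rw [LSeries.term_of_ne_zero hn, LSeries.term_of_ne_zero hn, map_div₀]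
    congr 1
    · simp only [Function.comp_apply, map_intCast]
    · rw [Complex.cpow_conj _ _ (by rw [Complex.natCast_arg]; exact Real.pi_ne_zero.symm),
        Complex.conj_conj, Complex.conj_natCast]

/-! ## §3 EQUIVARIANCE FROM THE PINNING (Deuring clause (ii) as a theorem) -/

/-- **Every `(1,0)` character `L`-pinned to a curve is conj-EQUIVARIANT.** `K` imaginary quadratic with
non-trivial automorphism `c`; `ψ` a Hecke character of `K` of infinity type `(1, 0)` with
`heckeLFunction ψ s = V.LSeries s` for `re s > s₀`, `V` a Weierstrass curve over ANY number field. Then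
`ψ(c • x) = \overline{ψ(x)}` for every idele `x` (`IsHeckeConjEquivariant c ψ` — clause (ii) of
`Deuring_exists_heckeCharacter_of_maximalCM`; Li–Xu §1.1 "`φ` is anticyclotomic", Jia §1 "equivariant because
it is the Hecke character determined by an elliptic curve over `ℚ`"). PROOF: `L(ψ̄, s) = \overline{L(ψ, s̄)} =
\overline{L(V, s̄)} = L(V, s) = L(ψ, s)` (§1, §2), so the rigidity of `L`-pinning
(`Rigidity.eq_or_eq_galConj_of_heckeLFunction_eq`, seats k7r-c2/k7r-c3/k7r-c4) gives `ψ̄ = ψ` or `ψ̄ = ψ ∘ c`;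
the first is absurd: `ψ((x)_∞) = σ(x)⁻¹` (`Rigidity.coe_apply_infiniteIdeles_eq_of_hasInfinityType_one_zero`)
would be real for every `x ∈ Kˣ`, making the complex embedding `σ` real. No named fact.
[cite: Jia2026ActaArith, §1 (equivariance of the Hecke character of a CM curve over ℚ)]
[cite: LiXu2025JNT, §1.1] [cite: NeukirchANT1999, Ch. VII §6 Prop. (6.9) and §8 (8.1)] -/
theorem isHeckeConjEquivariant_of_pinned (hK : IsImaginaryQuadratic K) (c : K ≃ₐ[ℚ] K) (hc : c ≠ 1)
    {ψ : HeckeCharacter K} (hinf : ψ.HasInfinityType (fun _ ↦ 1) (fun _ ↦ 0))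
    {F : Type} [Field F] [NumberField F] (V : WeierstrassCurve F) (s₀ : ℝ)
    (hpin : ∀ s : ℂ, s₀ < s.re → heckeLFunction ψ s = V.LSeries s) :
    IsHeckeConjEquivariant c ψ := by
  obtain ⟨ψ', hψ'⟩ := exists_conj ψ
  have hL : ∀ s : ℂ, s₀ < s.re → heckeLFunction ψ' s = heckeLFunction ψ s := fun s hs ↦ by
    have hs' : s₀ < (conj s).re := by rwa [Complex.conj_re]
    rw [heckeLFunction_of_conj_eq_conj hψ', hpin (conj s) hs', conj_LSeries_conj, hpin s hs]
  rcases Rigidity.eq_or_eq_galConj_of_heckeLFunction_eq hK c hc hinf s₀ hL with h | h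
  · -- `ψ̄ = ψ`: the values `ψ((x)_∞) = σ(x)⁻¹` would all be real — impossible for a complex place
    exfalso
    haveI : IsTotallyComplex K := hK.2
    obtain ⟨w₀⟩ : Nonempty (InfinitePlace K) := inferInstance
    have hreal : ∀ x : Kˣ, conj (w₀.embedding (x : K)) = w₀.embedding (x : K) := fun x ↦ by
      have h1 := Rigidity.coe_apply_infiniteIdeles_eq_of_hasInfinityType_one_zero hK w₀ hinf x
      have h2 := hψ' (infiniteIdeles K (globalToInfiniteUnits K x))
      rw [h, h1, map_inv₀] at h2
      exact inv_injective h2.symm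
    have hσ : ComplexEmbedding.IsReal w₀.embedding := by
      rw [ComplexEmbedding.isReal_iff]
      ext x
      rcases eq_or_ne x 0 with rfl | hx
      · simp
      · simpa [ComplexEmbedding.conjugate_coe_eq] using hreal (Units.mk0 x hx)
    exact (InfinitePlace.not_isReal_iff_isComplex.mpr (IsTotallyComplex.isComplex w₀))
      (InfinitePlace.isReal_iff.mpr hσ)
  · intro x
    rw [← h]
    exact hψ' x

/-! ## §4 RAMIFICATION AND VALUES ABOVE THE GOOD PRIMES FROM THE PINNING (Deuring clauses (iii)/(iv) as theorems) -/

section GoodPrimes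

/-- The ideal function `𝔞 ↦ χ(𝔞)` of a character `mod 𝔪` VANISHES at a prime `𝔭_w ⊇ 𝔪` (a prime dividing
the modulus is not prime to it). [cite: NeukirchANT1999, Ch. VII §8 (8.1)] -/
theorem rayClassCoeffHom_asIdeal_eq_zero_of_le {𝔪 : Ideal (𝓞 K)} (f : HeightOneSpectrum (𝓞 K) → ℂ)
    {w : HeightOneSpectrum (𝓞 K)} (hle : 𝔪 ≤ w.asIdeal) : rayClassCoeffHom 𝔪 f w.asIdeal = 0 := by
  rw [rayClassCoeffHom_apply, rayClassCoeff, if_neg]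
  rintro ⟨-, hcop⟩
  have h := Ideal.isCoprime_iff_sup_eq.mp hcop
  rw [sup_eq_left.mpr hle] at h
  exact w.isPrime.ne_top h

variable {ψ : HeckeCharacter K} {V : WeierstrassCurve ℚ} [V.IsElliptic] [V.IsGloballyMinimal] {s₀ : ℝ}

/-- **Deuring's clauses (iii)/(iv) AT A GOOD PRIME, from the pinning alone.** `K` quadratic with
non-trivial automorphism `c`; `ψ` ANY Hecke character of `K` with `heckeLFunction ψ s = V.LSeries s` for
`re s > s₀`, `V/ℚ` elliptic and globally minimal; `p` a prime of GOOD reduction of `V` which is UNRAMIFIED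
in `K`, and `w ∣ p`. Then: `ψ` is UNRAMIFIED at `w`; if `p` splits (`c • w ≠ w`) then
`ψ(ϖ_w) + ψ(ϖ_{c w}) = a_p` and `ψ(ϖ_w) ψ(ϖ_{c w}) = p`; if `p` is inert (`c • w = w`) then `a_p = 0` and
`ψ(ϖ_w) = −p` — VERBATIM clause (iv) of `Deuring_exists_heckeCharacter_of_maximalCM` (Silverman II Ex. 2.30
(a)–(c), 2.32 (a)), here for every pinned character. MECHANISM: with Weil's decomposition `ψ = ψ₀‖·‖^{−σ}`
and the ideal function `g` of `ψ₀` (`g(𝔭) = ψ₀(ϖ_𝔭)` at unramified, `0` at ramified primes), the pinning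
reads `a_n(V) = (Σ_{N𝔞 = n} g(𝔞)) n^{−σ}` (`Rigidity.intCast_lFunction_eq_weightedCoeff_of_heckeLFunction_eq_LSeries`);
at `n = p, p²` with `a_{p²} = a_p² − p` (Mathlib `LFunction_apply_prime_sq_eq`): split, `p = g(w)g(cw)·p^{−2σ}`
— so neither factor vanishes —; inert, `0 = a_p` and `−p = g(w) p^{−2σ}`. Unconditional.
[cite: SilvermanATAEC1994, Ch. II Thm. 9.2 (b), Cor. 10.4.1 (c), Ex. 2.30 (a)–(c) and 2.32 (a) (the statements; here DERIVED)]
[cite: NeukirchANT1999, Ch. VII §8 (8.1)] [cite: SilvermanAEC2009, App. C §16 (a_{p²} = a_p² − p)] -/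
theorem isUnramifiedAt_and_values_of_pinned_of_hasGoodReduction (h2 : Module.finrank ℚ K = 2)
    (c : K ≃ₐ[ℚ] K) (hc : c ≠ 1) (hpin : ∀ s : ℂ, s₀ < s.re → heckeLFunction ψ s = V.LSeries s)
    {p : ℕ} [hp : Fact p.Prime] (hgood : V.HasGoodReductionAtPrime p)
    (hnd : ¬ (p : ℤ) ∣ NumberField.discr K) (w : HeightOneSpectrum (𝓞 K))
    (hw : ((p : ℕ) : 𝓞 K) ∈ w.asIdeal) :
    ψ.IsUnramifiedAt w ∧
      (c • w ≠ w →
        ψ.valueAtUniformizer w + ψ.valueAtUniformizer (c • w) = (V.frobeniusTrace p : ℂ) ∧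
          ψ.valueAtUniformizer w * ψ.valueAtUniformizer (c • w) = (p : ℂ)) ∧
      (c • w = w → V.frobeniusTrace p = 0 ∧ ψ.valueAtUniformizer w = -(p : ℂ)) := by
  -- the rational place `v = (p)` under `w`, unramified in `K`
  set v : HeightOneSpectrum (𝓞 ℚ) := w.under (𝓞 ℚ) with hv
  have hwv : w.asIdeal.under (𝓞 ℚ) = v.asIdeal := rfl
  have hgen : Rat.HeightOneSpectrum.natGenerator v = p := natGenerator_under_eq_of_natCast_mem w hp.out hw
  have he : v.asIdeal.ramificationIdxIn (𝓞 K) = 1 :=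
    ramificationIdxIn_eq_one_of_not_dvd_discr (K := K) v (by rw [hgen]; exact hnd)
  have hp0 : (p : ℂ) ≠ 0 := by exact_mod_cast hp.out.ne_zero
  -- Weil decomposition and the coefficient identity
  obtain ⟨σ, ψ₀, 𝔪, -, h𝔪, hiff, -, hval, hcoeff⟩ :=
    Rigidity.intCast_lFunction_eq_weightedCoeff_of_heckeLFunction_eq_LSeries ψ V s₀ hpin
  set g : Ideal (𝓞 K) →*₀ ℂ := rayClassCoeffHom 𝔪 fun v ↦ ψ₀.valueAtUniformizer v with hg
  have hmul : ∀ A B : Ideal (𝓞 K), A ≠ ⊥ → B ≠ ⊥ → g (A * B) = g A * g B := fun A B _ _ ↦ map_mul g A B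
  have hone : g ⊤ = 1 := by rw [← Ideal.one_eq_top, map_one]
  have hunr_of : ∀ w' : HeightOneSpectrum (𝓞 K), g w'.asIdeal ≠ 0 → ψ.IsUnramifiedAt w' :=
    fun w' hg' ↦ (hiff w').mpr fun hle ↦ hg' (rayClassCoeffHom_asIdeal_eq_zero_of_le _ hle)
  have hgval : ∀ w' : HeightOneSpectrum (𝓞 K), ψ.IsUnramifiedAt w' →
      g w'.asIdeal = ψ.valueAtUniformizer w' * ((Ideal.absNorm w'.asIdeal : ℕ) : ℂ) ^ (σ : ℂ) :=
    fun w' h ↦ by rw [hg, Rigidity.rayClassCoeffHom_asIdeal _ ((hiff w').mp h) h𝔪, hval]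
  -- `u = p^σ ≠ 0`; `p^{-σ} = u⁻¹`, `(p²)^{-σ} = u⁻²`, `(p²)^{σ} = u²`
  set u : ℂ := (p : ℂ) ^ (σ : ℂ) with hu
  have hu0 : u ≠ 0 := fun h0 ↦ hp0 ((Complex.cpow_eq_zero_iff _ _).mp h0).1
  have hw1 : ((p : ℕ) : ℂ) ^ (-(σ : ℂ)) = u⁻¹ := Complex.cpow_neg _ _
  have hw2 : ((p ^ 2 : ℕ) : ℂ) ^ (-(σ : ℂ)) = u⁻¹ * u⁻¹ := by
    rw [pow_two, Nat.cast_mul, Complex.natCast_mul_natCast_cpow, Complex.cpow_neg]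
  have hw2' : ((p ^ 2 : ℕ) : ℂ) ^ (σ : ℂ) = u * u := by
    rw [pow_two, Nat.cast_mul, Complex.natCast_mul_natCast_cpow]
  -- the two coefficients `a_p`, `a_{p²} = a_p² − p`
  have e1 := hcoeff p hp.out.ne_zero
  have e2 := hcoeff (p ^ 2) (pow_ne_zero 2 hp.out.ne_zero)
  rw [LFunction_apply_prime_eq_frobeniusTrace V p hgood, hw1] at e1
  rw [LFunction_apply_prime_sq_eq V p hgood, Int.cast_sub, Int.cast_pow, Int.cast_natCast, hw2] at e2
  set a : ℤ := V.frobeniusTrace p with ha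
  -- split or inert
  rcases exists_places_eq_pair_or_eq_singleton h2 v he with
    ⟨w₁, w₂, hne, hS, h₁, h₂⟩ | ⟨w₀, hS, hw₀⟩
  · -- SPLIT: `{w₁, w₂}`, both of norm `p`, `c • w₁ = w₂`
    have hsum : ∀ e : ℕ, NumberField.twistCount K g (p ^ e) =
        ∑ i ∈ Finset.range (e + 1), g w₁.asIdeal ^ i * g w₂.asIdeal ^ (e - i) := by
      intro e
      rw [Rigidity.twistCount_eq_finsum, ← hgen]
      exact finsum_absNorm_eq_prime_pow_of_pair g hmul hone v hne hS h₁ h₂ e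
    have hs1 : NumberField.twistCount K g p = g w₂.asIdeal + g w₁.asIdeal := by
      have := hsum 1
      rw [pow_one] at this
      rw [this, Finset.sum_range_succ, Finset.sum_range_succ, Finset.sum_range_zero]
      simp
    have hs2 : NumberField.twistCount K g (p ^ 2) =
        g w₂.asIdeal ^ 2 + g w₁.asIdeal * g w₂.asIdeal + g w₁.asIdeal ^ 2 := by
      rw [hsum 2, Finset.sum_range_succ, Finset.sum_range_succ, Finset.sum_range_succ,
        Finset.sum_range_zero]
      simp
    set x₁ := g w₁.asIdeal with hx₁
    set x₂ := g w₂.asIdeal with hx₂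
    rw [hs1] at e1
    rw [hs2] at e2
    -- `p = x₁ x₂ u⁻²`, so `x₁, x₂ ≠ 0`: both places unramified
    have hprod : (p : ℂ) = x₁ * x₂ * (u⁻¹ * u⁻¹) := by
      linear_combination ((a : ℂ) + (x₂ + x₁) * u⁻¹) * e1 - e2
    have hx₁0 : x₁ ≠ 0 := fun h0 ↦ hp0 (by rw [hprod, h0]; ring)
    have hx₂0 : x₂ ≠ 0 := fun h0 ↦ hp0 (by rw [hprod, h0]; ring)
    have hu₁ : ψ.IsUnramifiedAt w₁ := hunr_of w₁ hx₁0
    have hu₂ : ψ.IsUnramifiedAt w₂ := hunr_of w₂ hx₂0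
    -- norms `N w₁ = N w₂ = p`, hence `xᵢ = ψ(ϖ_{wᵢ}) u`
    have hm₁ : w₁.asIdeal.under (𝓞 ℚ) = v.asIdeal := by
      have : w₁ ∈ ({w₁, w₂} : Set (HeightOneSpectrum (𝓞 K))) := Set.mem_insert _ _
      rw [← hS] at this; exact this
    have hm₂ : w₂.asIdeal.under (𝓞 ℚ) = v.asIdeal := by
      have : w₂ ∈ ({w₁, w₂} : Set (HeightOneSpectrum (𝓞 K))) := Set.mem_insert_of_mem _ rfl
      rw [← hS] at this; exact this
    have hN : ∀ {w' : HeightOneSpectrum (𝓞 K)}, w'.asIdeal.under (𝓞 ℚ) = v.asIdeal →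
        w'.asIdeal.inertiaDeg (𝓞 ℚ) = 1 → ((Ideal.absNorm w'.asIdeal : ℕ) : ℂ) = p := by
      intro w' hw' hf
      rw [(absNorm_eq_natGenerator_iff (K := K) v w'.asIdeal).mpr ⟨w', rfl, hw', hf⟩, hgen]
    have hv₁ : x₁ = ψ.valueAtUniformizer w₁ * u := by rw [hx₁, hgval w₁ hu₁, hN hm₁ h₁]
    have hv₂ : x₂ = ψ.valueAtUniformizer w₂ * u := by rw [hx₂, hgval w₂ hu₂, hN hm₂ h₂]
    have hadd : ψ.valueAtUniformizer w₁ + ψ.valueAtUniformizer w₂ = (a : ℂ) := by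
      rw [hv₁, hv₂] at e1
      rw [e1]; field_simp; ring
    have hmul' : ψ.valueAtUniformizer w₁ * ψ.valueAtUniformizer w₂ = (p : ℂ) := by
      rw [hv₁, hv₂] at hprod
      rw [hprod]; field_simp
    have hc₁ : c • w₁ = w₂ := Rigidity.smul_eq_of_places_eq_pair h2 c hc v hne hS
    have hc₂ : c • w₂ = w₁ := by
      have hS' : {w' : HeightOneSpectrum (𝓞 K) | w'.asIdeal.under (𝓞 ℚ) = v.asIdeal} = {w₂, w₁} := by
        rw [hS, Set.pair_comm]
      exact Rigidity.smul_eq_of_places_eq_pair h2 c hc v hne.symm hS'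
    have hwS : w ∈ ({w₁, w₂} : Set (HeightOneSpectrum (𝓞 K))) := by rw [← hS]; exact hwv
    rcases hwS with rfl | rfl
    · refine ⟨hu₁, fun _ ↦ ⟨by rw [hc₁, hadd], by rw [hc₁, hmul']⟩, fun hfix ↦ ?_⟩
      exact absurd (hc₁.symm.trans hfix) hne.symm
    · refine ⟨hu₂, fun _ ↦ ⟨by rw [hc₂, add_comm, hadd], by rw [hc₂, mul_comm, hmul']⟩, fun hfix ↦ ?_⟩
      exact absurd (hc₂.symm.trans hfix) hne
  · -- INERT: the single place `w₀ = w` of norm `p²`, `c • w = w`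
    have hw' : w = w₀ := by
      have : w ∈ ({w₀} : Set (HeightOneSpectrum (𝓞 K))) := by rw [← hS]; exact hwv
      simpa using this
    subst hw'
    have hs1 : NumberField.twistCount K g p = 0 := by
      have h := (finsum_absNorm_eq_prime_pow_of_singleton g hmul hone v hS hw₀ 0).2
      rw [hgen, show 2 * 0 + 1 = 1 from rfl, pow_one] at h
      rw [Rigidity.twistCount_eq_finsum]; exact h
    have hs2 : NumberField.twistCount K g (p ^ 2) = g w.asIdeal := by
      have h := (finsum_absNorm_eq_prime_pow_of_singleton g hmul hone v hS hw₀ 1).1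
      rw [hgen, show 2 * 1 = 2 from rfl, pow_one] at h
      rw [Rigidity.twistCount_eq_finsum]; exact h
    rw [hs1, zero_mul] at e1
    have ha0 : a = 0 := by exact_mod_cast e1
    rw [hs2, e1] at e2
    -- `-p = g(w) u⁻²`, so `g(w) ≠ 0`: unramified; and `g(w) = ψ(ϖ_w) u²`
    have hgw : g w.asIdeal = -(p : ℂ) * (u * u) := by
      have h := e2
      field_simp at h
      linear_combination -h
    have hx0 : g w.asIdeal ≠ 0 := by
      rw [hgw]; exact mul_ne_zero (neg_ne_zero.mpr hp0) (mul_ne_zero hu0 hu0)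
    have huw : ψ.IsUnramifiedAt w := hunr_of w hx0
    have hNw : ((Ideal.absNorm w.asIdeal : ℕ) : ℂ) = ((p ^ 2 : ℕ) : ℂ) := by
      rw [absNorm_asIdeal_eq_natGenerator_pow, ← hv, hgen, hw₀]
    have hvw : ψ.valueAtUniformizer w = -(p : ℂ) := by
      have h := hgval w huw
      rw [hNw, hw2', hgw] at h
      have h' := mul_right_cancel₀ (mul_ne_zero hu0 hu0) h
      exact h'.symm
    have hcw : c • w = w := Rigidity.smul_eq_self_of_places_eq_singleton c v hS
    exact ⟨huw, fun hne ↦ absurd hcw hne, fun _ ↦ ⟨ha0, hvw⟩⟩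

/-- **Clause (iii) of Deuring, good half, for every pinned character**: a Hecke character of a quadratic
field `L`-pinned to a globally minimal elliptic curve `V/ℚ` is UNRAMIFIED at every place above a good
prime of `V` that is unramified in `K`. [cite: SilvermanATAEC1994, Ch. II Thm. 9.2 (b) with Ex. 2.30 (a), 2.31 (b) (the statement; here DERIVED)] -/
theorem isUnramifiedAt_of_pinned_of_hasGoodReduction (h2 : Module.finrank ℚ K = 2)
    (hpin : ∀ s : ℂ, s₀ < s.re → heckeLFunction ψ s = V.LSeries s)
    {p : ℕ} [Fact p.Prime] (hgood : V.HasGoodReductionAtPrime p)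
    (hnd : ¬ (p : ℤ) ∣ NumberField.discr K) (w : HeightOneSpectrum (𝓞 K))
    (hw : ((p : ℕ) : 𝓞 K) ∈ w.asIdeal) : ψ.IsUnramifiedAt w := by
  haveI : Algebra.IsQuadraticExtension ℚ K := ⟨h2⟩
  -- a non-trivial automorphism exists in a quadratic (Galois) extension
  obtain ⟨c, hc⟩ : ∃ c : K ≃ₐ[ℚ] K, c ≠ 1 := by
    by_contra! h
    have hcard := Rigidity.card_algEquiv_eq_two (K := K) h2
    haveI : Unique (K ≃ₐ[ℚ] K) := ⟨⟨1⟩, fun a ↦ h a⟩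
    rw [Nat.card_unique] at hcard
    norm_num at hcard
  exact (isUnramifiedAt_and_values_of_pinned_of_hasGoodReduction h2 c hc hpin hgood hnd w hw).1

end GoodPrimes

end DeuringShape

end Literature.NumberTheory.EllipticCurves.DeuringCM.RamifiedSevenEllipticUnits

end Part14

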